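import Mathlib
import Summits.Parity.BatemanHorn.Theses.PolynomialMobius
import Summits.Parity.BatemanHorn.Theorems.PolynomialMobiusPolyMobiusTailStubPairSwapCount
import Literature.NumberTheory.Sieve.LinearPairDivisorShortSums

open scoped BigOperators
open Finset Real Filter Polynomial Asymptotics

namespace Summit.Parity.BatemanHorn.Theorems.PolyMobiusTail.EtaFreeWindow

theorem stub_pair_middle_box_reduction2 : ∀ (q₀ a₀ q₁ a₁ : ℤ) (σ₁ σ₂ θ η : ℝ) (x Xb P P' Mb Mb' : ℕ), 0 < q₀ → 0 < q₁ → 0 < P → P < P' → P' ≤ Xb → Mb < Mb' → ((q₁.toNat + a₁.natAbs + q₁.toNat * (a₀.natAbs + 1) + 2 : ℕ) : ℝ) ≤ (x : ℝ) ^ (1 - η) / P → |(∑ d₀ ∈ Finset.Ioc P P', ∑ d₁ ∈ Finset.Icc 1 Xb, ∑ m ∈ Finset.Ioc Mb Mb', if ((d₁ : ℤ) * m - a₁) % q₁ = 0 ∧ (1 ≤ ((d₁ : ℤ) * m - a₁) / q₁ ∧ ((d₁ : ℤ) * m - a₁) / q₁ ≤ x) ∧ (1 ≤ q₀ * (((d₁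 : ℤ) * m - a₁) / q₁) + a₀ ∧ (d₀ : ℤ) ∣ q₀ * (((d₁ : ℤ) * m - a₁) / q₁) + a₀) ∧ ((x : ℝ) ^ (1 - η) < (d₀ : ℝ) * d₁ ∧ (d₀ : ℝ) * d₁ ≤ (x : ℝ) ^ (1 + θ) ∧ ((x : ℝ) ^ σ₁ < (d₀ : ℝ) ∧ (d₀ : ℝ) ≤ (x : ℝ) ^ σ₂)) then ((ArithmeticFunction.moebius d₀ : ℝ) * Real.log d₀) * ((ArithmeticFunction.moebius d₁ : ℝ) * Real.log d₁) else 0) - (∑ d₀ ∈ Finset.Ioc P P', ∑ d₁ ∈ Finset.Icc 1 Xb, ∑ m ∈ Finset.Ioc Mb Mb', if ((d₁ : ℤ) * m - a₁) % q₁ = 0 ∧ (q₁ * (d₀ : ℤ) ∣ q₀ * ((d₁ : ℤ) * m) + (q₁ * a₀ - q₀ * a₁)) ∧ ((x : ℝ) ^ (1 - η) / P < (d₁ : ℝ) ∧ (d₁ : ℝ) ≤ (x : ℝ) ^ (1 + θ) / P' ∧ (d₁ : ℝ) ≤ ((q₁ : ℝ) * x + a₁) / Mb') ∧ ((x : ℝ)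 ^ σ₁ < (d₀ : ℝ) ∧ (d₀ : ℝ) ≤ (x : ℝ) ^ σ₂) then ((ArithmeticFunction.moebius d₀ : ℝ) * Real.log d₀) * ((ArithmeticFunction.moebius d₁ : ℝ) * Real.log d₁) else 0)| ≤ (1 + Real.log Xb) ^ 2 * (((Finset.Ioc P P' ×ˢ Finset.Icc 1 Xb) ×ˢ Finset.Ioc Mb Mb').filter (fun c : (ℕ × ℕ) × ℕ => (((c.1.2 : ℤ) * c.2 - a₁) % q₁ = 0 ∧ (1 ≤ ((c.1.2 : ℤ) * c.2 - a₁) / q₁ ∧ ((c.1.2 : ℤ) * c.2 - a₁) / q₁ ≤ x) ∧ (1 ≤ q₀ * (((c.1.2 : ℤ) * c.2 - a₁) / q₁) + a₀ ∧ (c.1.1 : ℤ) ∣ q₀ * (((c.1.2 : ℤ) * c.2 - a₁) / q₁) + a₀)) ∧ (((x : ℝ) ^ (1 - η) < (c.1.1 : ℝ) * c.1.2 ∧ (c.1.1 : ℝ) * c.1.2 ≤ (x : ℝ) ^ (1 - η) * P' / P) ∨ ((x : ℝ) ^ (1 + θ) * P / P' < (c.1.1 : ℝ) * c.1.2 ∧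 (c.1.1 : ℝ) * c.1.2 ≤ (x : ℝ) ^ (1 + θ)) ∨ (((q₁ : ℝ) * x + a₁) * (Mb + 1) / Mb' < (c.1.2 : ℝ) * c.2)))).card := by
  sorry

theorem stub_pair_middle_boxdisp : ∀ (q₀ a₀ q₁ a₁ : ℤ) (σ₁ σ₂ δ A : ℝ), 0 < q₀ → 0 < q₁ → q₁ * a₀ - q₀ * a₁ ≠ 0 → 0 < σ₁ → σ₁ < σ₂ → σ₂ ≤ 1 → 0 < δ → ∃ K : ℝ, 0 < K ∧ ∃ x₀ : ℕ, ∀ x : ℕ, x₀ ≤ x → ∀ (θ η : ℝ) (Xb P P' Mb Mb' : ℕ), (x : ℝ) ^ σ₁ / 2 ≤ P → P < P' → 2 * P' ≤ 3 * P → (P' : ℝ) ≤ 2 * (x : ℝ) ^ σ₂ → Mb < Mb' → Mb' ≤ Xb → P' ≤ Xb → (Xb : ℝ) ≤ (x : ℝ) ^ (2 : ℝ) → |∑ d₀ ∈ Finset.Ioc P P', ∑ d₁ ∈ Finset.Icc 1 Xb, ∑ m ∈ Finset.Ioc Mb Mb', (if ((d₁ : ℤ) * m - a₁) % q₁ = 0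 ∧ (q₁ * (d₀ : ℤ) ∣ q₀ * ((d₁ : ℤ) * m) + (q₁ * a₀ - q₀ * a₁)) ∧ ((x : ℝ) ^ (1 - η) / P < (d₁ : ℝ) ∧ (d₁ : ℝ) ≤ (x : ℝ) ^ (1 + θ) / P' ∧ (d₁ : ℝ) ≤ ((q₁ : ℝ) * x + a₁) / Mb') ∧ ((x : ℝ) ^ σ₁ < (d₀ : ℝ) ∧ (d₀ : ℝ) ≤ (x : ℝ) ^ σ₂) then ((ArithmeticFunction.moebius d₀ : ℝ) * Real.log d₀) * ((ArithmeticFunction.moebius d₁ : ℝ) * Real.log d₁) else 0)| ≤ K * ((1 + Real.log x) ^ 4 * ((x : ℝ) / Mb') * ((Mb' : ℝ) - Mb + 1) ^ (1 / 2 : ℝ) + ((x : ℝ) / Mb') * ((Mb' : ℝ) - Mb + 1) / (1 + Real.log x) ^ A + (x : ℝ) ^ δ * ((x : ℝ) / Mb') ^ (1 / 2 : ℝ) * ((Mb' : ℝ) - Mb + 1) + (x : ℝ) ^ δ * ((x : ℝ) ^ (1 + θ) / P') ^ (1 / 2 : ℝ) * (P' : ℝ) ^ (3 / 2 : ℝ))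 := by
  sorry

theorem shell_card_le {q₀ a₀ q₁ a₁ : ℤ} (hq₀ : IsCoprime q₀ a₀) (hq₁ : IsCoprime q₁ a₁)
    (hq₀p : 0 < q₀) (hq₁p : 0 < q₁) (hΔ : q₁ * a₀ - q₀ * a₁ ≠ 0) (A : ℕ) :
    ∃ C : ℝ, 0 < C ∧ ∀ (x B : ℕ) (X κ : ℝ), 3 ≤ x → (x : ℝ) ^ (1 / 2 : ℝ) ≤ X →
      X ≤ (x : ℝ) ^ (3 / 2 : ℝ) → 0 < κ → κ ≤ 1 →
      ((((Icc 1 x) ×ˢ ((Icc 1 B) ×ˢ (Icc 1 B))).filter fun c : ℕ × ℕ × ℕ =>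
        ((1 ≤ q₀ * c.1 + a₀ ∧ (c.2.1 : ℤ) ∣ q₀ * c.1 + a₀) ∧
          (1 ≤ q₁ * c.1 + a₁ ∧ (c.2.2 : ℤ) ∣ q₁ * c.1 + a₁)) ∧
        (X < (c.2.1 : ℝ) * c.2.2 ∧ (c.2.1 : ℝ) * c.2.2 ≤ X + κ * X)).card : ℝ) ≤
      C * (κ * x * Real.log x ^ (A + 3) + x / Real.log x ^ A) := by
  sorry

/-- (ASSUMED HERE — registered aux stub, being proved by a worker.) -/
theorem stub_pair_middle_smallm :
    ∀ (q₀ a₀ q₁ a₁ : ℤ) (σ₁ σ₂ θ η : ℝ) (x Xb M₀ : ℕ), 0 < q₀ → 0 < q₁ → 1 ≤ x →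
      |∑ d₀ ∈ Finset.Icc 1 Xb, ∑ d₁ ∈ Finset.Icc 1 Xb, ∑ m ∈ Finset.Icc 1 M₀,
          (if ((d₁ : ℤ) * m - a₁) % q₁ = 0 ∧
              (1 ≤ ((d₁ : ℤ) * m - a₁) / q₁ ∧ ((d₁ : ℤ) * m - a₁) / q₁ ≤ x) ∧
              (1 ≤ q₀ * (((d₁ : ℤ) * m - a₁) / q₁) + a₀ ∧ (d₀ : ℤ) ∣ q₀ * (((d₁ : ℤ) * m - a₁) / q₁) + a₀) ∧
              ((x : ℝ) ^ (1 - η) < (d₀ : ℝ) * d₁ ∧ (d₀ : ℝ) * d₁ ≤ (x : ℝ) ^ (1 + θ) ∧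
                ((x : ℝ) ^ σ₁ < (d₀ : ℝ) ∧ (d₀ : ℝ) ≤ (x : ℝ) ^ σ₂)) then
            ((ArithmeticFunction.moebius d₀ : ℝ) * Real.log d₀) *
              ((ArithmeticFunction.moebius d₁ : ℝ) * Real.log d₁) else 0)| ≤
      (1 + Real.log Xb) ^ 2 *
        ∑ n ∈ Finset.Icc 1 (⌊(M₀ : ℝ) * (x : ℝ) ^ (1 + θ - σ₁)⌋₊ + a₁.natAbs),
          ((((q₀ * n + a₀).toNat).divisors.card : ℕ) : ℝ) * ((((q₁ * n + a₁).toNat).divisors.card : ℕ) : ℝ) := by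
  sorry

namespace MiddleAssembly


/-- Sum over `Ioc (b 0) (b S)` as the sum over the consecutive blocks `Ioc (b s) (b (s+1))` of a
monotone sequence `b`. -/
theorem sum_Ioc_eq_sum_range_blocks {M : Type*} [AddCommMonoid M] (b : ℕ → ℕ) (hb : Monotone b)
    (g : ℕ → M) (S : ℕ) :
    ∑ d ∈ Ioc (b 0) (b S), g d = ∑ s ∈ range S, ∑ d ∈ Ioc (b s) (b (s + 1)), g d := by
  induction S with
  | zero => simp
  | succ S ih =>
      rw [sum_range_succ, ← ih]
      exact (sum_Ioc_consecutive g (hb (Nat.zero_le S)) (hb (Nat.le_succ S))).symm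

/-- The geometric grid: `min T ⌊B (1+κ)^s⌋₊` is monotone in `s` (for `κ ≥ 0`). -/
theorem grid_monotone (B T : ℕ) {κ : ℝ} (hκ : 0 ≤ κ) :
    Monotone (fun s : ℕ => min T ⌊(B : ℝ) * (1 + κ) ^ s⌋₊) := by
  intro s t hst
  refine min_le_min le_rfl (Nat.floor_le_floor ?_)
  exact mul_le_mul_of_nonneg_left (pow_le_pow_right₀ (by linarith) hst) (Nat.cast_nonneg B)

/-- The grid starts at `B` (when `B ≤ T`). -/
theorem grid_zero {B T : ℕ} (hBT : B ≤ T) (κ : ℝ) :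
    min T ⌊(B : ℝ) * (1 + κ) ^ 0⌋₊ = B := by
  simp [hBT]

/-- The grid reaches `T` after `S` steps as soon as `T ≤ B (1+κ)^S`. -/
theorem grid_top {B T S : ℕ} {κ : ℝ} (h : (T : ℝ) ≤ (B : ℝ) * (1 + κ) ^ S) :
    min T ⌊(B : ℝ) * (1 + κ) ^ S⌋₊ = T := by
  refine min_eq_left ?_
  exact Nat.le_floor h

/-- One grid step grows by a factor at most `1 + κ`, up to `+2`:
`b (s+1) ≤ (1+κ) · b s + 2`. -/
theorem grid_succ_le {B T : ℕ} {κ : ℝ} (hκ : 0 ≤ κ) (hκ1 : κ ≤ 1) (s : ℕ) :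
    ((min T ⌊(B : ℝ) * (1 + κ) ^ (s + 1)⌋₊ : ℕ) : ℝ) ≤
      (1 + κ) * ((min T ⌊(B : ℝ) * (1 + κ) ^ s⌋₊ : ℕ) : ℝ) + 2 := by
  have h1κ : (1 : ℝ) ≤ 1 + κ := by linarith
  have hy0 : 0 ≤ (B : ℝ) * (1 + κ) ^ s := by positivity
  by_cases hT : T ≤ ⌊(B : ℝ) * (1 + κ) ^ s⌋₊
  · -- already saturated at step `s`
    rw [min_eq_left hT]
    have : ((min T ⌊(B : ℝ) * (1 + κ) ^ (s + 1)⌋₊ : ℕ) : ℝ) ≤ T := by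
      exact_mod_cast min_le_left _ _
    have hT0 : (0 : ℝ) ≤ T := Nat.cast_nonneg T
    nlinarith
  · push Not at hT
    rw [min_eq_right hT.le]
    have hfl : (B : ℝ) * (1 + κ) ^ s < (⌊(B : ℝ) * (1 + κ) ^ s⌋₊ : ℝ) + 1 := Nat.lt_floor_add_one _
    calc ((min T ⌊(B : ℝ) * (1 + κ) ^ (s + 1)⌋₊ : ℕ) : ℝ)
        ≤ (⌊(B : ℝ) * (1 + κ) ^ (s + 1)⌋₊ : ℝ) := by exact_mod_cast min_le_right _ _
      _ ≤ (B : ℝ) * (1 + κ) ^ (s + 1) := Nat.floor_le (by positivity)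
      _ = (1 + κ) * ((B : ℝ) * (1 + κ) ^ s) := by ring
      _ ≤ (1 + κ) * ((⌊(B : ℝ) * (1 + κ) ^ s⌋₊ : ℝ) + 1) :=
          mul_le_mul_of_nonneg_left hfl.le (by linarith)
      _ ≤ (1 + κ) * (⌊(B : ℝ) * (1 + κ) ^ s⌋₊ : ℝ) + 2 := by nlinarith

/-- Number of steps needed: with `S = ⌈log (T/B) / log (1+κ)⌉₊` (and `1 ≤ B ≤ T`, `0 < κ`) one has
`T ≤ B (1+κ)^S`. -/
theorem le_grid_pow {B T : ℕ} (hB : 1 ≤ B) (hBT : B ≤ T) {κ : ℝ} (hκ : 0 < κ) :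
    (T : ℝ) ≤ (B : ℝ) * (1 + κ) ^ ⌈Real.log ((T : ℝ) / B) / Real.log (1 + κ)⌉₊ := by
  have hB0 : (0 : ℝ) < B := by exact_mod_cast hB
  have hT0 : (0 : ℝ) < T := by exact_mod_cast (hB.trans hBT)
  have hlog : 0 < Real.log (1 + κ) := Real.log_pos (by linarith)
  set S : ℕ := ⌈Real.log ((T : ℝ) / B) / Real.log (1 + κ)⌉₊ with hS
  have hS' : Real.log ((T : ℝ) / B) / Real.log (1 + κ) ≤ S := Nat.le_ceil _
  have h1 : Real.log ((T : ℝ) / B) ≤ S * Real.log (1 + κ) := by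
    rwa [div_le_iff₀ hlog] at hS'
  have h2 : (T : ℝ) / B ≤ (1 + κ) ^ S := by
    rw [← Real.log_le_log_iff (by positivity) (by positivity), Real.log_pow]
    exact h1
  rw [div_le_iff₀ hB0] at h2
  linarith [h2]

/-- Step count bound: `⌈log (T/B) / log (1+κ)⌉₊ ≤ 2 log T / κ + 1` for `1 ≤ B ≤ T`, `0 < κ ≤ 1`
(`log (1+κ) ≥ κ/2`). -/
theorem ceil_log_div_le {B T : ℕ} (hB : 1 ≤ B) (hBT : B ≤ T) {κ : ℝ} (hκ : 0 < κ) (hκ1 : κ ≤ 1) :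
    (⌈Real.log ((T : ℝ) / B) / Real.log (1 + κ)⌉₊ : ℝ) ≤ 2 * Real.log T / κ + 1 := by
  have hB0 : (0 : ℝ) < B := by exact_mod_cast hB
  have hB1 : (1 : ℝ) ≤ B := by exact_mod_cast hB
  have hT1 : (1 : ℝ) ≤ T := by exact_mod_cast (hB.trans hBT)
  have hlog : 0 < Real.log (1 + κ) := Real.log_pos (by linarith)
  -- `log (1+κ) ≥ κ/2` on `(0,1]`: from `log y ≥ 1 - 1/y` with `y = 1+κ`: `1 - 1/(1+κ) = κ/(1+κ) ≥ κ/2`.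
  have hlk : κ / 2 ≤ Real.log (1 + κ) := by
    have h := Real.one_sub_inv_le_log_of_pos (show (0 : ℝ) < 1 + κ by linarith)
    have h2 : κ / 2 ≤ 1 - (1 + κ)⁻¹ := by
      rw [div_le_iff₀ (by norm_num : (0 : ℝ) < 2)]
      field_simp
      nlinarith
    linarith
  have hnum : Real.log ((T : ℝ) / B) ≤ Real.log T := by
    rw [Real.log_div (by positivity) (by positivity)]
    linarith [Real.log_nonneg hB1]
  have hnum0 : 0 ≤ Real.log ((T : ℝ) / B) := Real.log_nonneg (by rw [le_div_iff₀ hB0]; simpa using (show (B:ℝ) ≤ T by exact_mod_cast hBT))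
  have hq : Real.log ((T : ℝ) / B) / Real.log (1 + κ) ≤ 2 * Real.log T / κ := by
    calc Real.log ((T : ℝ) / B) / Real.log (1 + κ) ≤ Real.log T / (κ / 2) :=
          div_le_div₀ (Real.log_nonneg hT1) hnum (by positivity) hlk
      _ = 2 * Real.log T / κ := by field_simp
  have hq0 : 0 ≤ Real.log ((T : ℝ) / B) / Real.log (1 + κ) := by positivity
  have hlt : (⌈Real.log ((T : ℝ) / B) / Real.log (1 + κ)⌉₊ : ℝ) <
      Real.log ((T : ℝ) / B) / Real.log (1 + κ) + 1 := Nat.ceil_lt_add_one hq0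
  linarith


/-- Sum over `Ioc (b 0) (b S)` as the sum over the consecutive blocks of a monotone sequence. -/
theorem sum_Ioc_eq_sum_range_blocks' {M : Type*} [AddCommMonoid M] (b : ℕ → ℕ) (hb : Monotone b)
    (g : ℕ → M) (S : ℕ) :
    ∑ d ∈ Ioc (b 0) (b S), g d = ∑ s ∈ range S, ∑ d ∈ Ioc (b s) (b (s + 1)), g d := by
  induction S with
  | zero => simp
  | succ S ih =>
      rw [sum_range_succ, ← ih]
      exact (sum_Ioc_consecutive g (hb (Nat.zero_le S)) (hb (Nat.le_succ S))).symm

/-- Splitting `[1, Xb]` at `M₀ ≤ Xb`: `Icc 1 Xb = Icc 1 M₀ ∪ Ioc M₀ Xb` for sums. -/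
theorem sum_Icc_one_eq_add {M : Type*} [AddCommMonoid M] {M₀ Xb : ℕ} (h : M₀ ≤ Xb) (g : ℕ → M) :
    ∑ m ∈ Icc 1 Xb, g m = ∑ m ∈ Icc 1 M₀, g m + ∑ m ∈ Ioc M₀ Xb, g m := by
  have h1 : Icc 1 Xb = Ioc 0 Xb := by ext m; simp [Nat.one_le_iff_ne_zero, Nat.pos_iff_ne_zero]
  have h2 : Icc 1 M₀ = Ioc 0 M₀ := by ext m; simp [Nat.one_le_iff_ne_zero, Nat.pos_iff_ne_zero]
  rw [h1, h2]
  exact (sum_Ioc_consecutive g (Nat.zero_le M₀) h).symm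

/-- Restricting the `d₀`-sum to `(BP, TP]` when the summand vanishes outside. -/
theorem sum_Icc_eq_sum_Ioc_of_vanish {BP TP Xb : ℕ} (hTP : TP ≤ Xb) (G : ℕ → ℝ)
    (hG : ∀ d₀ ∈ Icc 1 Xb, G d₀ ≠ 0 → BP < d₀ ∧ d₀ ≤ TP) :
    ∑ d₀ ∈ Icc 1 Xb, G d₀ = ∑ d₀ ∈ Ioc BP TP, G d₀ := by
  classical
  rw [← Finset.sum_filter_ne_zero (s := Icc 1 Xb), ← Finset.sum_filter_ne_zero (s := Ioc BP TP)]
  refine Finset.sum_congr ?_ fun _ _ => rfl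
  ext d₀
  simp only [Finset.mem_filter, Finset.mem_Icc, Finset.mem_Ioc]
  constructor
  · rintro ⟨hd, hne⟩
    exact ⟨hG d₀ (Finset.mem_Icc.mpr hd) hne, hne⟩
  · rintro ⟨⟨h1, h2⟩, hne⟩
    exact ⟨⟨by omega, h2.trans hTP⟩, hne⟩

/-- Capping the `m`-range: `Σ_{m ∈ Ioc M₀ Xb} G = Σ_{m ∈ Ioc M₀ TM}` when `G` vanishes above `TM ≤ Xb`. -/
theorem sum_Ioc_eq_sum_Ioc_of_vanish {M₀ TM Xb : ℕ} (hTM : TM ≤ Xb) (G : ℕ → ℝ)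
    (hG : ∀ m ∈ Ioc M₀ Xb, G m ≠ 0 → m ≤ TM) :
    ∑ m ∈ Ioc M₀ Xb, G m = ∑ m ∈ Ioc M₀ TM, G m := by
  classical
  rw [← Finset.sum_filter_ne_zero (s := Ioc M₀ Xb), ← Finset.sum_filter_ne_zero (s := Ioc M₀ TM)]
  refine Finset.sum_congr ?_ fun _ _ => rfl
  ext m
  simp only [Finset.mem_filter, Finset.mem_Ioc]
  constructor
  · rintro ⟨hm, hne⟩
    exact ⟨⟨hm.1, hG m (Finset.mem_Ioc.mpr hm) hne⟩, hne⟩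
  · rintro ⟨⟨h1, h2⟩, hne⟩
    exact ⟨⟨h1, h2.trans hTM⟩, hne⟩

/-- **Generic decomposition of the triple sum.**  `g` vanishes unless `BP < d₀ ≤ TP` and unless
`m ≤ TM`; `bP` is a monotone grid from `BP` to `TP ≤ Xb`, `bM` a monotone grid from `M₀` to `TM`
(`M₀ ≤ TM ≤ Xb`). -/
theorem tripleSum_decomp (g : ℕ → ℕ → ℕ → ℝ) {Xb M₀ TM BP TP SP SM : ℕ} (bP bM : ℕ → ℕ)
    (hbP : Monotone bP) (hbM : Monotone bM) (hP0 : bP 0 = BP) (hPS : bP SP = TP)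
    (hM0 : bM 0 = M₀) (hMS : bM SM = TM) (hTP : TP ≤ Xb) (hM₀ : M₀ ≤ TM) (hTMX : TM ≤ Xb)
    (hg : ∀ d₀ d₁ m, g d₀ d₁ m ≠ 0 → BP < d₀ ∧ d₀ ≤ TP)
    (hgm : ∀ d₀ d₁ m, g d₀ d₁ m ≠ 0 → m ≤ TM) :
    ∑ d₀ ∈ Icc 1 Xb, ∑ d₁ ∈ Icc 1 Xb, ∑ m ∈ Icc 1 Xb, g d₀ d₁ m =
      (∑ d₀ ∈ Icc 1 Xb, ∑ d₁ ∈ Icc 1 Xb, ∑ m ∈ Icc 1 M₀, g d₀ d₁ m) +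
      ∑ s ∈ range SP, ∑ j ∈ range SM,
        ∑ d₀ ∈ Ioc (bP s) (bP (s + 1)), ∑ d₁ ∈ Icc 1 Xb, ∑ m ∈ Ioc (bM j) (bM (j + 1)), g d₀ d₁ m := by
  -- split `m` at `M₀` and cap at `TM`
  have step1 : ∀ d₀ d₁, ∑ m ∈ Icc 1 Xb, g d₀ d₁ m =
      ∑ m ∈ Icc 1 M₀, g d₀ d₁ m + ∑ m ∈ Ioc M₀ TM, g d₀ d₁ m := by
    intro d₀ d₁
    rw [sum_Icc_one_eq_add (hM₀.trans hTMX), sum_Ioc_eq_sum_Ioc_of_vanish hTMX _ (fun m _ hne => hgm d₀ d₁ m hne)]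
  simp_rw [step1, Finset.sum_add_distrib]
  congr 1
  -- restrict `d₀` to `(BP, TP]`
  have step2 : ∑ d₀ ∈ Icc 1 Xb, ∑ d₁ ∈ Icc 1 Xb, ∑ m ∈ Ioc M₀ TM, g d₀ d₁ m =
      ∑ d₀ ∈ Ioc BP TP, ∑ d₁ ∈ Icc 1 Xb, ∑ m ∈ Ioc M₀ TM, g d₀ d₁ m := by
    refine sum_Icc_eq_sum_Ioc_of_vanish hTP _ fun d₀ _ hne => ?_
    obtain ⟨d₁, _, hd₁⟩ := Finset.exists_ne_zero_of_sum_ne_zero hne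
    obtain ⟨m, _, hm⟩ := Finset.exists_ne_zero_of_sum_ne_zero hd₁
    exact hg d₀ d₁ m hm
  rw [step2, ← hP0, ← hPS, sum_Ioc_eq_sum_range_blocks' bP hbP _ SP]
  refine Finset.sum_congr rfl fun s _ => ?_
  -- blocks in `m`, then exchange the order of summation
  have step3 : ∀ d₀ d₁, ∑ m ∈ Ioc M₀ TM, g d₀ d₁ m =
      ∑ j ∈ range SM, ∑ m ∈ Ioc (bM j) (bM (j + 1)), g d₀ d₁ m := by
    intro d₀ d₁
    rw [← hM0, ← hMS]
    exact sum_Ioc_eq_sum_range_blocks' bM hbM _ SM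
  simp_rw [step3]
  rw [Finset.sum_congr rfl fun d₀ _ => Finset.sum_comm]
  exact Finset.sum_comm

/-- Iterated triple sum over a product box as a sum over the product finset. -/
theorem sum_sum_sum_eq_sum_prod (A B C : Finset ℕ) (g : ℕ → ℕ → ℕ → ℝ) :
    ∑ a ∈ A, ∑ b ∈ B, ∑ c ∈ C, g a b c = ∑ p ∈ (A ×ˢ B) ×ˢ C, g p.1.1 p.1.2 p.2 := by
  rw [Finset.sum_product, Finset.sum_product]


/-- **Injection bound.** For predicates `Φ` on `(d₀,d₁,m)` and `Ψ` on `(n,d₀,d₁)` with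
`Core ∧ Φ ⟹ Ψ(n, d₀, d₁)` (`n = (d₁m − a₁)/q₁`), the number of `(d₀,d₁,m) ∈ A × [1,Xb] × Mset`
(`A ⊆ [1,Xb]`, `Mset ⊆ [1, ∞)`) satisfying the core conditions C1, C3, C2⁺, C2 and `Φ` is at most
the number of `(n,d₀,d₁) ∈ [1,x] × [1,Xb]²` with `d₀ ∣ q₀n + a₀ ≥ 1`, `d₁ ∣ q₁n + a₁ ≥ 1` and `Ψ`. -/
theorem card_core_filter_le {q₀ a₀ q₁ a₁ : ℤ} {x Xb : ℕ} {A Mset : Finset ℕ}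
    (hA : A ⊆ Icc 1 Xb) (hM : ∀ m ∈ Mset, 1 ≤ m)
    (Φ : ℕ × ℕ → ℕ → Prop) [DecidablePred (fun c : (ℕ × ℕ) × ℕ => Φ c.1 c.2)]
    (Ψ : ℕ → ℕ × ℕ → Prop) [DecidablePred (fun e : ℕ × (ℕ × ℕ) => Ψ e.1 e.2)]
    (hΦΨ : ∀ (d₀ d₁ m : ℕ), d₁ ∈ Icc 1 Xb → m ∈ Mset →
      ((d₁ : ℤ) * m - a₁) % q₁ = 0 →
      (1 ≤ ((d₁ : ℤ) * m - a₁) / q₁ ∧ ((d₁ : ℤ) * m - a₁) / q₁ ≤ x) →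
      Φ (d₀, d₁) m → Ψ ((((d₁ : ℤ) * m - a₁) / q₁).toNat) (d₀, d₁)) :
    (((A ×ˢ Icc 1 Xb) ×ˢ Mset).filter (fun c : (ℕ × ℕ) × ℕ =>
        ((((c.1.2 : ℤ) * c.2 - a₁) % q₁ = 0 ∧
          (1 ≤ ((c.1.2 : ℤ) * c.2 - a₁) / q₁ ∧ ((c.1.2 : ℤ) * c.2 - a₁) / q₁ ≤ x) ∧
          (1 ≤ q₀ * (((c.1.2 : ℤ) * c.2 - a₁) / q₁) + a₀ ∧
            (c.1.1 : ℤ) ∣ q₀ * (((c.1.2 : ℤ) * c.2 - a₁) / q₁) + a₀)) ∧ Φ c.1 c.2))).card ≤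
    (((Icc 1 x) ×ˢ ((Icc 1 Xb) ×ˢ (Icc 1 Xb))).filter (fun e : ℕ × (ℕ × ℕ) =>
        ((1 ≤ q₀ * e.1 + a₀ ∧ (e.2.1 : ℤ) ∣ q₀ * e.1 + a₀) ∧
          (1 ≤ q₁ * e.1 + a₁ ∧ (e.2.2 : ℤ) ∣ q₁ * e.1 + a₁)) ∧ Ψ e.1 e.2)).card := by
  -- the map
  refine Finset.card_le_card_of_injOn
    (fun c : (ℕ × ℕ) × ℕ => (((((c.1.2 : ℤ) * c.2 - a₁) / q₁).toNat), c.1)) ?_ ?_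
  · -- maps into
    intro c hc
    rw [Finset.mem_coe, Finset.mem_filter] at hc
    obtain ⟨hmem, ⟨hC1, ⟨hn1, hnx⟩, hC2p, hC2⟩, hΦ⟩ := hc
    rw [Finset.mem_product, Finset.mem_product] at hmem
    obtain ⟨⟨hd₀, hd₁⟩, hm⟩ := hmem
    set nn : ℤ := ((c.1.2 : ℤ) * c.2 - a₁) / q₁ with hnn
    have hq : q₁ * nn = (c.1.2 : ℤ) * c.2 - a₁ := Int.mul_ediv_cancel' (Int.dvd_of_emod_eq_zero hC1)
    have hnn0 : 0 ≤ nn := by omega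
    have hcast : ((nn.toNat : ℕ) : ℤ) = nn := Int.toNat_of_nonneg hnn0
    rw [Finset.mem_coe, Finset.mem_filter, Finset.mem_product, Finset.mem_product]
    refine ⟨⟨?_, hA hd₀, hd₁⟩, ⟨⟨?_, ?_⟩, ?_, ?_⟩, ?_⟩
    · rw [Finset.mem_Icc]
      constructor
      · have : (1 : ℤ) ≤ nn.toNat := by rw [hcast]; exact hn1
        exact_mod_cast this
      · have : (nn.toNat : ℤ) ≤ x := by rw [hcast]; exact hnx
        exact_mod_cast this
    · simp only []
      rw [hcast]; exact hC2p
    · simp only []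
      rw [hcast]; exact hC2
    · simp only []
      rw [hcast, show q₁ * nn + a₁ = (c.1.2 : ℤ) * c.2 by rw [hq]; ring]
      have h1 : (1 : ℤ) ≤ c.1.2 := by exact_mod_cast (Finset.mem_Icc.mp hd₁).1
      have h2 : (1 : ℤ) ≤ c.2 := by exact_mod_cast hM _ hm
      nlinarith
    · simp only []
      rw [hcast, show q₁ * nn + a₁ = (c.1.2 : ℤ) * c.2 by rw [hq]; ring]
      exact ⟨c.2, rfl⟩
    · exact hΦΨ c.1.1 c.1.2 c.2 hd₁ hm hC1 ⟨hn1, hnx⟩ hΦ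
  · -- injective
    intro c hc c' hc' heq
    rw [Finset.mem_coe, Finset.mem_filter] at hc hc'
    simp only [Prod.mk.injEq] at heq
    obtain ⟨hn, h1⟩ := heq
    obtain ⟨hmem, ⟨hC1, ⟨hn1, -⟩, -, -⟩, -⟩ := hc
    obtain ⟨hmem', ⟨hC1', ⟨hn1', -⟩, -, -⟩, -⟩ := hc'
    rw [Finset.mem_product, Finset.mem_product] at hmem hmem'
    have hd₁ : 1 ≤ c.1.2 := (Finset.mem_Icc.mp hmem.1.2).1
    set nn : ℤ := ((c.1.2 : ℤ) * c.2 - a₁) / q₁ with hnn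
    set nn' : ℤ := ((c'.1.2 : ℤ) * c'.2 - a₁) / q₁ with hnn'
    have hq : q₁ * nn = (c.1.2 : ℤ) * c.2 - a₁ := Int.mul_ediv_cancel' (Int.dvd_of_emod_eq_zero hC1)
    have hq' : q₁ * nn' = (c'.1.2 : ℤ) * c'.2 - a₁ := Int.mul_ediv_cancel' (Int.dvd_of_emod_eq_zero hC1')
    have he : nn = nn' := by
      have h0 : 0 ≤ nn := by omega
      have h0' : 0 ≤ nn' := by omega
      have := congrArg (fun k : ℕ => (k : ℤ)) hn
      simp only [Int.toNat_of_nonneg h0, Int.toNat_of_nonneg h0'] at this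
      exact this
    have hprod : (c.1.2 : ℤ) * c.2 = (c'.1.2 : ℤ) * c'.2 := by
      have := congrArg (fun k => q₁ * k) he
      simp only [hq, hq'] at this
      linarith
    rw [← h1] at hprod
    have hm : (c.2 : ℤ) = c'.2 := by
      have hd : (0 : ℤ) < c.1.2 := by exact_mod_cast hd₁
      exact mul_left_cancel₀ hd.ne' hprod
    have hm' : c.2 = c'.2 := by exact_mod_cast hm
    exact Prod.ext h1 hm'


/-- **Divisor-pair configurations over an `n`-set are counted by `τ·τ`.**  For any finset `S` of
naturals: `#{(n,d₀,d₁) ∈ S × [1,Xb]² : d₀ ∣ q₀n+a₀ ≥ 1, d₁ ∣ q₁n+a₁ ≥ 1, Ψ} ≤ Σ_{n∈S} τ((q₀n+a₀)⁺) τ((q₁n+a₁)⁺)`. -/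
theorem card_core'_filter_le_sum_tau (q₀ a₀ q₁ a₁ : ℤ) (S : Finset ℕ) (Xb : ℕ)
    (Ψ : ℕ → ℕ × ℕ → Prop) [DecidablePred (fun e : ℕ × (ℕ × ℕ) => Ψ e.1 e.2)] :
    (((S ×ˢ ((Icc 1 Xb) ×ˢ (Icc 1 Xb))).filter (fun e : ℕ × (ℕ × ℕ) =>
        ((1 ≤ q₀ * e.1 + a₀ ∧ (e.2.1 : ℤ) ∣ q₀ * e.1 + a₀) ∧
          (1 ≤ q₁ * e.1 + a₁ ∧ (e.2.2 : ℤ) ∣ q₁ * e.1 + a₁)) ∧ Ψ e.1 e.2)).card : ℝ) ≤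
    ∑ n ∈ S, ((((q₀ * n + a₀).toNat).divisors.card : ℕ) : ℝ) *
      ((((q₁ * n + a₁).toNat).divisors.card : ℕ) : ℝ) := by
  classical
  set Tset : Finset ((_ : ℕ) × (ℕ × ℕ)) :=
    S.sigma (fun n => ((q₀ * n + a₀).toNat).divisors ×ˢ ((q₁ * n + a₁).toNat).divisors) with hT
  have h1 : ((S ×ˢ ((Icc 1 Xb) ×ˢ (Icc 1 Xb))).filter (fun e : ℕ × (ℕ × ℕ) =>
        ((1 ≤ q₀ * e.1 + a₀ ∧ (e.2.1 : ℤ) ∣ q₀ * e.1 + a₀) ∧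
          (1 ≤ q₁ * e.1 + a₁ ∧ (e.2.2 : ℤ) ∣ q₁ * e.1 + a₁)) ∧ Ψ e.1 e.2)) ⊆
      Tset.image (fun z => (z.1, z.2)) := by
    intro e he
    rw [Finset.mem_filter, Finset.mem_product] at he
    obtain ⟨⟨hn, -⟩, ⟨⟨h0, hd0⟩, ⟨h1, hd1⟩⟩, -⟩ := he
    rw [Finset.mem_image]
    refine ⟨⟨e.1, e.2⟩, ?_, rfl⟩
    rw [hT, Finset.mem_sigma, Finset.mem_product]
    refine ⟨hn, ?_, ?_⟩
    · rw [Nat.mem_divisors]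
      have hv : ((q₀ * e.1 + a₀).toNat : ℤ) = q₀ * e.1 + a₀ := Int.toNat_of_nonneg (by omega)
      refine ⟨?_, ?_⟩
      · have : ((e.2.1 : ℕ) : ℤ) ∣ ((q₀ * e.1 + a₀).toNat : ℤ) := by rw [hv]; exact hd0
        exact_mod_cast this
      · have : (0 : ℤ) < (q₀ * e.1 + a₀).toNat := by rw [hv]; omega
        have : 0 < (q₀ * e.1 + a₀).toNat := by exact_mod_cast this
        exact this.ne'
    · rw [Nat.mem_divisors]
      have hv : ((q₁ * e.1 + a₁).toNat : ℤ) = q₁ * e.1 + a₁ := Int.toNat_of_nonneg (by omega)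
      refine ⟨?_, ?_⟩
      · have : ((e.2.2 : ℕ) : ℤ) ∣ ((q₁ * e.1 + a₁).toNat : ℤ) := by rw [hv]; exact hd1
        exact_mod_cast this
      · have : (0 : ℤ) < (q₁ * e.1 + a₁).toNat := by rw [hv]; omega
        have : 0 < (q₁ * e.1 + a₁).toNat := by exact_mod_cast this
        exact this.ne'
  calc ((((S ×ˢ ((Icc 1 Xb) ×ˢ (Icc 1 Xb))).filter (fun e : ℕ × (ℕ × ℕ) =>
        ((1 ≤ q₀ * e.1 + a₀ ∧ (e.2.1 : ℤ) ∣ q₀ * e.1 + a₀) ∧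
          (1 ≤ q₁ * e.1 + a₁ ∧ (e.2.2 : ℤ) ∣ q₁ * e.1 + a₁)) ∧ Ψ e.1 e.2)).card : ℕ) : ℝ)
      ≤ ((Tset.image (fun z => (z.1, z.2))).card : ℝ) := by exact_mod_cast Finset.card_le_card h1
    _ ≤ (Tset.card : ℝ) := by exact_mod_cast Finset.card_image_le
    _ = ∑ n ∈ S, ((((q₀ * n + a₀).toNat).divisors.card : ℕ) : ℝ) *
          ((((q₁ * n + a₁).toNat).divisors.card : ℕ) : ℝ) := by
        rw [hT, Finset.card_sigma]; push_cast
        refine Finset.sum_congr rfl fun n _ => ?_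
        rw [Finset.card_product]; push_cast; ring


/-- Powers of `1 + log x` are eventually below any positive power of `x` (natural `x`), with any
constant: `C (1 + log x)^k ≤ x^s` for `x ≥ X₀`. -/
theorem eventually_mul_log_pow_le_rpow (C : ℝ) (k : ℕ) {s : ℝ} (hs : 0 < s) :
    ∀ᶠ x : ℕ in atTop, C * (1 + Real.log x) ^ k ≤ (x : ℝ) ^ s := by
  -- on `ℝ`: `(log x)^k = o(x^s)`, and `1 + log x ≤ 2 log x` for `log x ≥ 1`
  have h1 : (fun x : ℝ => Real.log x ^ (k : ℝ)) =o[atTop] fun x => x ^ s :=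
    isLittleO_log_rpow_rpow_atTop (k : ℝ) hs
  have hc : 0 < 1 / (|C| * 2 ^ k + 1) := by positivity
  have h2 := h1.def hc
  have h3 : ∀ᶠ x : ℝ in atTop, 1 ≤ Real.log x := Real.tendsto_log_atTop.eventually_ge_atTop 1
  have h4 : ∀ᶠ x : ℝ in atTop, C * (1 + Real.log x) ^ k ≤ x ^ s := by
    filter_upwards [h2, h3, eventually_ge_atTop (1 : ℝ)] with x hx hlog hx1
    have hlog0 : 0 ≤ Real.log x := by linarith
    rw [Real.norm_of_nonneg (by positivity), Real.norm_of_nonneg (by positivity), Real.rpow_natCast] at hx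
    have hxs : 0 ≤ x ^ s := by positivity
    -- `(1 + log x)^k ≤ (2 log x)^k`
    have h5 : (1 + Real.log x) ^ k ≤ (2 * Real.log x) ^ k :=
      pow_le_pow_left₀ (by linarith) (by linarith) k
    rw [mul_pow] at h5
    have h6 : C * (1 + Real.log x) ^ k ≤ |C| * (2 ^ k * Real.log x ^ k) := by
      calc C * (1 + Real.log x) ^ k ≤ |C| * (1 + Real.log x) ^ k :=
            mul_le_mul_of_nonneg_right (le_abs_self C) (by positivity)
        _ ≤ |C| * (2 ^ k * Real.log x ^ k) := mul_le_mul_of_nonneg_left h5 (abs_nonneg C)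
    have h7 : |C| * (2 ^ k * Real.log x ^ k) ≤ x ^ s := by
      have h8 : Real.log x ^ k ≤ 1 / (|C| * 2 ^ k + 1) * x ^ s := hx
      have h9 : |C| * 2 ^ k * (1 / (|C| * 2 ^ k + 1)) ≤ 1 := by
        rw [← mul_div_assoc, mul_one, div_le_one (by positivity)]; linarith
      calc |C| * (2 ^ k * Real.log x ^ k) = (|C| * 2 ^ k) * Real.log x ^ k := by ring
        _ ≤ (|C| * 2 ^ k) * (1 / (|C| * 2 ^ k + 1) * x ^ s) :=
            mul_le_mul_of_nonneg_left h8 (by positivity)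
        _ = (|C| * 2 ^ k * (1 / (|C| * 2 ^ k + 1))) * x ^ s := by ring
        _ ≤ 1 * x ^ s := mul_le_mul_of_nonneg_right h9 hxs
        _ = x ^ s := one_mul _
    linarith
  exact h4.natCast_atTop (p := fun y : ℝ => C * (1 + Real.log y) ^ k ≤ y ^ s)

/-- A natural number is eventually larger than any real constant. -/
theorem eventually_const_le_natCast (R : ℝ) : ∀ᶠ x : ℕ in atTop, R ≤ (x : ℝ) :=
  tendsto_natCast_atTop_atTop.eventually_ge_atTop R

/-- Positive powers of naturals are eventually larger than any constant. -/
theorem eventually_const_le_rpow (R : ℝ) {s : ℝ} (hs : 0 < s) : ∀ᶠ x : ℕ in atTop, R ≤ (x : ℝ) ^ s :=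
  ((tendsto_rpow_atTop hs).comp tendsto_natCast_atTop_atTop).eventually_ge_atTop R

/-- **Cards of filters as indicator sums** over a product finset. -/
theorem card_filter_eq_sum_ite {α : Type*} (s : Finset α) (p : α → Prop) [DecidablePred p] :
    ((s.filter p).card : ℝ) = ∑ a ∈ s, if p a then (1 : ℝ) else 0 := by
  rw [Finset.card_filter]; push_cast
  rfl

/-- **Sum of the per-box shell counts.**  With `P'/P ≤ 1+2κ` on the `d₀`-grid and
`Mb' ≤ (1+2κ)(Mb+1)` on the `m`-grid, the per-box shell configurations (as in
`stub_pair_middle_box_reduction2`) add up to at most the three UNIFORM shell counts: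
`d₀d₁ ∈ (x^{1-η}, x^{1-η}(1+2κ)]`, `d₀d₁ ∈ (x^{1+θ}/(1+2κ), x^{1+θ}]` (counted over `(n,d₀,d₁)`), and
`n > x − ⌈2κ(x+|a₁|)⌉₊` (counted by `τ·τ`). -/
theorem shell_cards_sum_le {q₀ a₀ q₁ a₁ : ℤ} (hq₁ : 0 < q₁) {x Xb BP TP M₀ TM SP SM : ℕ}
    (bP bM : ℕ → ℕ) (hbP : Monotone bP) (hbM : Monotone bM) (hP0 : bP 0 = BP) (hPS : bP SP = TP)
    (hM0 : bM 0 = M₀) (hMS : bM SM = TM) (hTP : TP ≤ Xb) (hM₀ : M₀ ≤ TM) (hTMX : TM ≤ Xb)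
    (hBP : 1 ≤ BP) {κ θ η : ℝ} (hκ : 0 < κ) (hax : (a₁.natAbs : ℕ) ≤ x)
    (hratP : ∀ s, ((bP (s + 1) : ℕ) : ℝ) ≤ (1 + 2 * κ) * bP s)
    (hratM : ∀ j, ((bM (j + 1) : ℕ) : ℝ) ≤ (1 + 2 * κ) * ((bM j : ℝ) + 1)) :
    (∑ s ∈ range SP, ∑ j ∈ range SM,
      ((((Finset.Ioc (bP s) (bP (s + 1)) ×ˢ Finset.Icc 1 Xb) ×ˢ Finset.Ioc (bM j) (bM (j + 1))).filter
        (fun c : (ℕ × ℕ) × ℕ =>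
          (((c.1.2 : ℤ) * c.2 - a₁) % q₁ = 0 ∧
            (1 ≤ ((c.1.2 : ℤ) * c.2 - a₁) / q₁ ∧ ((c.1.2 : ℤ) * c.2 - a₁) / q₁ ≤ x) ∧
            (1 ≤ q₀ * (((c.1.2 : ℤ) * c.2 - a₁) / q₁) + a₀ ∧
              (c.1.1 : ℤ) ∣ q₀ * (((c.1.2 : ℤ) * c.2 - a₁) / q₁) + a₀)) ∧
          (((x : ℝ) ^ (1 - η) < (c.1.1 : ℝ) * c.1.2 ∧
              (c.1.1 : ℝ) * c.1.2 ≤ (x : ℝ) ^ (1 - η) * (bP (s + 1) : ℕ) / (bP s : ℕ)) ∨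
           ((x : ℝ) ^ (1 + θ) * (bP s : ℕ) / (bP (s + 1) : ℕ) < (c.1.1 : ℝ) * c.1.2 ∧
              (c.1.1 : ℝ) * c.1.2 ≤ (x : ℝ) ^ (1 + θ)) ∨
           (((q₁ : ℝ) * x + a₁) * ((bM j : ℕ) + 1) / (bM (j + 1) : ℕ) < (c.1.2 : ℝ) * c.2)))).card : ℝ)) ≤
    ((((Icc 1 x) ×ˢ ((Icc 1 Xb) ×ˢ (Icc 1 Xb))).filter fun e : ℕ × ℕ × ℕ =>
        ((1 ≤ q₀ * e.1 + a₀ ∧ (e.2.1 : ℤ) ∣ q₀ * e.1 + a₀) ∧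
          (1 ≤ q₁ * e.1 + a₁ ∧ (e.2.2 : ℤ) ∣ q₁ * e.1 + a₁)) ∧
        ((x : ℝ) ^ (1 - η) < (e.2.1 : ℝ) * e.2.2 ∧
          (e.2.1 : ℝ) * e.2.2 ≤ (x : ℝ) ^ (1 - η) + (2 * κ) * (x : ℝ) ^ (1 - η))).card : ℝ) +
    ((((Icc 1 x) ×ˢ ((Icc 1 Xb) ×ˢ (Icc 1 Xb))).filter fun e : ℕ × ℕ × ℕ =>
        ((1 ≤ q₀ * e.1 + a₀ ∧ (e.2.1 : ℤ) ∣ q₀ * e.1 + a₀) ∧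
          (1 ≤ q₁ * e.1 + a₁ ∧ (e.2.2 : ℤ) ∣ q₁ * e.1 + a₁)) ∧
        ((x : ℝ) ^ (1 + θ) / (1 + 2 * κ) < (e.2.1 : ℝ) * e.2.2 ∧
          (e.2.1 : ℝ) * e.2.2 ≤ (x : ℝ) ^ (1 + θ) / (1 + 2 * κ) + (2 * κ) * ((x : ℝ) ^ (1 + θ) / (1 + 2 * κ)))).card : ℝ) +
    ∑ n ∈ Ioc (x - ⌈2 * κ * ((x : ℝ) + a₁.natAbs)⌉₊) x,
      ((((q₀ * n + a₀).toNat).divisors.card : ℕ) : ℝ) * ((((q₁ * n + a₁).toNat).divisors.card : ℕ) : ℝ) := by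
  classical
  -- notation for the three uniform shells (predicates on `(d₀,d₁,m)`)
  set y : ℕ := ⌈2 * κ * ((x : ℝ) + a₁.natAbs)⌉₊ with hy
  -- Core predicate
  let Core : (ℕ × ℕ) × ℕ → Prop := fun c =>
    ((c.1.2 : ℤ) * c.2 - a₁) % q₁ = 0 ∧
      (1 ≤ ((c.1.2 : ℤ) * c.2 - a₁) / q₁ ∧ ((c.1.2 : ℤ) * c.2 - a₁) / q₁ ≤ x) ∧
      (1 ≤ q₀ * (((c.1.2 : ℤ) * c.2 - a₁) / q₁) + a₀ ∧
        (c.1.1 : ℤ) ∣ q₀ * (((c.1.2 : ℤ) * c.2 - a₁) / q₁) + a₀)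
  let U₁ : (ℕ × ℕ) × ℕ → Prop := fun c =>
    (x : ℝ) ^ (1 - η) < (c.1.1 : ℝ) * c.1.2 ∧ (c.1.1 : ℝ) * c.1.2 ≤ (x : ℝ) ^ (1 - η) + (2 * κ) * (x : ℝ) ^ (1 - η)
  let U₂ : (ℕ × ℕ) × ℕ → Prop := fun c =>
    (x : ℝ) ^ (1 + θ) / (1 + 2 * κ) < (c.1.1 : ℝ) * c.1.2 ∧
      (c.1.1 : ℝ) * c.1.2 ≤ (x : ℝ) ^ (1 + θ) / (1 + 2 * κ) + (2 * κ) * ((x : ℝ) ^ (1 + θ) / (1 + 2 * κ))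
  let U₃ : (ℕ × ℕ) × ℕ → Prop := fun c => ((x : ℝ) - y < (((c.1.2 : ℤ) * c.2 - a₁) / q₁ : ℤ))
  let U : (ℕ × ℕ) × ℕ → Prop := fun c => U₁ c ∨ U₂ c ∨ U₃ c
  -- basic facts on the grids
  have hbP_pos : ∀ s, 0 < bP s := fun s => by
    have : bP 0 ≤ bP s := hbP (Nat.zero_le s)
    rw [hP0] at this; omega
  have hbP_le_TP : ∀ s, s < SP → bP (s + 1) ≤ TP := fun s hs => by
    rw [← hPS]; exact hbP (Nat.succ_le_of_lt hs)
  have hbP_ge_BP : ∀ s, BP ≤ bP s := fun s => by rw [← hP0]; exact hbP (Nat.zero_le s)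
  have hbM_le_TM : ∀ j, j < SM → bM (j + 1) ≤ TM := fun j hj => by
    rw [← hMS]; exact hbM (Nat.succ_le_of_lt hj)
  have hx1η : 0 ≤ (x : ℝ) ^ (1 - η) := by positivity
  have hx1θ : 0 ≤ (x : ℝ) ^ (1 + θ) := by positivity
  have h12κ : 0 < 1 + 2 * κ := by linarith
  have hqxa : 0 ≤ (q₁ : ℝ) * x + a₁ := by
    have h1 : (1 : ℝ) ≤ q₁ := by exact_mod_cast hq₁
    have h2 : ((a₁.natAbs : ℕ) : ℝ) ≤ x := by exact_mod_cast hax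
    have h3 : -(a₁ : ℝ) ≤ ((a₁.natAbs : ℕ) : ℝ) := by
      rw [Nat.cast_natAbs, Int.cast_abs]; exact neg_le_abs _
    have hx0 : (0 : ℝ) ≤ x := Nat.cast_nonneg x
    nlinarith
  -- Step 1: per box, the box shells imply the uniform shells
  have step1 : ∀ s ∈ range SP, ∀ j ∈ range SM,
      ((((Finset.Ioc (bP s) (bP (s + 1)) ×ˢ Finset.Icc 1 Xb) ×ˢ Finset.Ioc (bM j) (bM (j + 1))).filter
        (fun c : (ℕ × ℕ) × ℕ => Core c ∧
          (((x : ℝ) ^ (1 - η) < (c.1.1 : ℝ) * c.1.2 ∧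
              (c.1.1 : ℝ) * c.1.2 ≤ (x : ℝ) ^ (1 - η) * (bP (s + 1) : ℕ) / (bP s : ℕ)) ∨
           ((x : ℝ) ^ (1 + θ) * (bP s : ℕ) / (bP (s + 1) : ℕ) < (c.1.1 : ℝ) * c.1.2 ∧
              (c.1.1 : ℝ) * c.1.2 ≤ (x : ℝ) ^ (1 + θ)) ∨
           (((q₁ : ℝ) * x + a₁) * ((bM j : ℕ) + 1) / (bM (j + 1) : ℕ) < (c.1.2 : ℝ) * c.2)))).card : ℝ) ≤
      ∑ d₀ ∈ Finset.Ioc (bP s) (bP (s + 1)), ∑ d₁ ∈ Finset.Icc 1 Xb, ∑ m ∈ Finset.Ioc (bM j) (bM (j + 1)),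
        (if (Core ((d₀, d₁), m) ∧ U ((d₀, d₁), m)) ∧ (BP < d₀ ∧ d₀ ≤ TP) ∧ m ≤ TM then (1 : ℝ) else 0) := by
    intro s hs j hj
    rw [Finset.mem_range] at hs hj
    rw [card_filter_eq_sum_ite, sum_sum_sum_eq_sum_prod]
    refine Finset.sum_le_sum fun c hc => ?_
    rw [Finset.mem_product, Finset.mem_product, Finset.mem_Ioc, Finset.mem_Icc, Finset.mem_Ioc] at hc
    obtain ⟨⟨⟨hd₀l, hd₀u⟩, hd₁1, hd₁X⟩, hml, hmu⟩ := hc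
    have hP0r : (0 : ℝ) < (bP s : ℕ) := by exact_mod_cast hbP_pos s
    have hP'0r : (0 : ℝ) < (bP (s + 1) : ℕ) := by exact_mod_cast hbP_pos (s + 1)
    have hMb'0 : (0 : ℝ) < (bM (j + 1) : ℕ) := by exact_mod_cast (show 0 < bM (j + 1) by omega)
    split_ifs with h1 h2
    · exact le_rfl
    · exfalso
      refine h2 ⟨⟨h1.1, ?_⟩, ⟨lt_of_le_of_lt (hbP_ge_BP s) hd₀l, hd₀u.trans (hbP_le_TP s hs)⟩,
        hmu.trans (hbM_le_TM j hj)⟩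
      obtain ⟨hcore, hsh⟩ := h1
      rcases hsh with ⟨hlo, hhi⟩ | ⟨hlo, hhi⟩ | h3
      · refine Or.inl ⟨hlo, hhi.trans ?_⟩
        rw [div_le_iff₀ hP0r]
        have := hratP s
        nlinarith
      · refine Or.inr (Or.inl ⟨lt_of_le_of_lt ?_ hlo, ?_⟩)
        · rw [div_le_div_iff₀ h12κ hP'0r]
          have := hratP s
          nlinarith
        · have : (x : ℝ) ^ (1 + θ) / (1 + 2 * κ) + 2 * κ * ((x : ℝ) ^ (1 + θ) / (1 + 2 * κ)) =
              (x : ℝ) ^ (1 + θ) := by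
            rw [show (x : ℝ) ^ (1 + θ) / (1 + 2 * κ) + 2 * κ * ((x : ℝ) ^ (1 + θ) / (1 + 2 * κ)) =
              (1 + 2 * κ) * ((x : ℝ) ^ (1 + θ) / (1 + 2 * κ)) by ring, mul_div_cancel₀ _ h12κ.ne']
          rw [this]; exact hhi
      · -- shell₃ ⟹ `n > x - y`
        refine Or.inr (Or.inr ?_)
        obtain ⟨hC1, ⟨hn1, hnx⟩, -, -⟩ := hcore
        set nn : ℤ := ((c.1.2 : ℤ) * c.2 - a₁) / q₁ with hnn
        have hq : q₁ * nn = (c.1.2 : ℤ) * c.2 - a₁ := Int.mul_ediv_cancel' (Int.dvd_of_emod_eq_zero hC1)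
        have hqR : (q₁ : ℝ) * nn = (c.1.2 : ℝ) * c.2 - a₁ := by exact_mod_cast hq
        show (x : ℝ) - y < (nn : ℝ)
        have hM := hratM j
        -- `(q₁x+a₁)(Mb+1)/Mb' ≥ (q₁ x + a₁)/(1+2κ)`
        have hlow : ((q₁ : ℝ) * x + a₁) / (1 + 2 * κ) ≤
            ((q₁ : ℝ) * x + a₁) * ((bM j : ℕ) + 1) / (bM (j + 1) : ℕ) := by
          rw [div_le_div_iff₀ h12κ hMb'0]
          have h0 : 0 ≤ ((bM j : ℕ) : ℝ) + 1 := by positivity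
          nlinarith [mul_nonneg hqxa h0]
        have hlt : ((q₁ : ℝ) * x + a₁) / (1 + 2 * κ) < (q₁ : ℝ) * nn + a₁ := by
          rw [hqR]; linarith
        -- hence `q₁ nn > (q₁ x - 2κ a₁)/(1+2κ)` and `nn > x - 2κ(x+|a₁|)`
        have hq₁R : (0 : ℝ) < q₁ := by exact_mod_cast hq₁
        have hq₁1 : (1 : ℝ) ≤ q₁ := by exact_mod_cast hq₁
        have habs : |(a₁ : ℝ)| = ((a₁.natAbs : ℕ) : ℝ) := by
          rw [Nat.cast_natAbs, Int.cast_abs]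
        have hy' : 2 * κ * ((x : ℝ) + a₁.natAbs) ≤ y := Nat.le_ceil _
        have hineq : (x : ℝ) - 2 * κ * ((x : ℝ) + a₁.natAbs) < nn := by
          rw [div_lt_iff₀ h12κ] at hlt
          -- `q₁ x + a₁ < (q₁ nn + a₁)(1+2κ)` ⟹ `q₁ (x - nn - 2κ nn) < 2κ a₁ ≤ 2κ|a₁| q₁`
          have h5 : (q₁ : ℝ) * (x - nn - 2 * κ * nn) < 2 * κ * a₁ := by linarith
          have h6 : (a₁ : ℝ) ≤ a₁.natAbs := by rw [← habs]; exact le_abs_self _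
          have hA0 : 0 ≤ 2 * κ * (a₁.natAbs : ℝ) := by positivity
          have h6' : 2 * κ * (a₁ : ℝ) ≤ 2 * κ * a₁.natAbs := by
            exact mul_le_mul_of_nonneg_left h6 (by positivity)
          have h6'' : 2 * κ * (a₁.natAbs : ℝ) ≤ q₁ * (2 * κ * a₁.natAbs) := by
            have := mul_le_mul_of_nonneg_right hq₁1 hA0
            linarith
          have h7 : (q₁ : ℝ) * (x - nn - 2 * κ * nn) < q₁ * (2 * κ * a₁.natAbs) := by linarith
          have h8 : (x : ℝ) - nn - 2 * κ * nn < 2 * κ * a₁.natAbs := lt_of_mul_lt_mul_left h7 hq₁R.le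
          have hnnx : (nn : ℝ) ≤ x := by exact_mod_cast hnx
          have h9 : 2 * κ * (nn : ℝ) ≤ 2 * κ * x := mul_le_mul_of_nonneg_left hnnx (by positivity)
          linarith
        linarith
    · positivity
    · exact le_rfl
  -- Step 2: the indicator `g'` and its decomposition over the grid
  set g' : ℕ → ℕ → ℕ → ℝ := fun d₀ d₁ m =>
    if (Core ((d₀, d₁), m) ∧ U ((d₀, d₁), m)) ∧ (BP < d₀ ∧ d₀ ≤ TP) ∧ m ≤ TM then (1 : ℝ) else 0 with hg'
  have hg'0 : ∀ d₀ d₁ m, g' d₀ d₁ m ≠ 0 → BP < d₀ ∧ d₀ ≤ TP := by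
    intro d₀ d₁ m h
    by_contra hc
    exact h (if_neg fun hh => hc hh.2.1)
  have hg'm : ∀ d₀ d₁ m, g' d₀ d₁ m ≠ 0 → m ≤ TM := by
    intro d₀ d₁ m h
    by_contra hc
    exact h (if_neg fun hh => hc hh.2.2)
  have hg'nn : ∀ d₀ d₁ m, 0 ≤ g' d₀ d₁ m := by
    intro d₀ d₁ m; simp only [hg']; split_ifs <;> norm_num
  have hg'le : ∀ d₀ d₁ m, g' d₀ d₁ m ≤ (if Core ((d₀, d₁), m) ∧ U ((d₀, d₁), m) then (1 : ℝ) else 0) := by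
    intro d₀ d₁ m; simp only [hg']
    split_ifs with h1 h2
    · exact le_rfl
    · exact absurd h1.1 h2
    · norm_num
    · exact le_rfl
  have hdec := tripleSum_decomp g' bP bM hbP hbM hP0 hPS hM0 hMS hTP hM₀ hTMX hg'0 hg'm
  have hsmall0 : 0 ≤ ∑ d₀ ∈ Icc 1 Xb, ∑ d₁ ∈ Icc 1 Xb, ∑ m ∈ Icc 1 M₀, g' d₀ d₁ m :=
    Finset.sum_nonneg fun _ _ => Finset.sum_nonneg fun _ _ => Finset.sum_nonneg fun _ _ => hg'nn _ _ _
  -- Step 3: the full sum of `g'` is at most the card of `Core ∧ U` on the cube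
  set cube : Finset ((ℕ × ℕ) × ℕ) := (Icc 1 Xb ×ˢ Icc 1 Xb) ×ˢ Icc 1 Xb with hcube
  have hfull : ∑ d₀ ∈ Icc 1 Xb, ∑ d₁ ∈ Icc 1 Xb, ∑ m ∈ Icc 1 Xb, g' d₀ d₁ m ≤
      ((cube.filter (fun c => Core c ∧ U c)).card : ℝ) := by
    rw [card_filter_eq_sum_ite, hcube, sum_sum_sum_eq_sum_prod]
    exact Finset.sum_le_sum fun p _ => hg'le p.1.1 p.1.2 p.2
  -- Step 4: split `U` into the three shells
  have hsplit : ((cube.filter (fun c => Core c ∧ U c)).card : ℝ) ≤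
      ((cube.filter (fun c => Core c ∧ U₁ c)).card : ℝ) + ((cube.filter (fun c => Core c ∧ U₂ c)).card : ℝ) +
        ((cube.filter (fun c => Core c ∧ U₃ c)).card : ℝ) := by
    have hsub : cube.filter (fun c => Core c ∧ U c) ⊆
        cube.filter (fun c => Core c ∧ U₁ c) ∪ cube.filter (fun c => Core c ∧ U₂ c) ∪
          cube.filter (fun c => Core c ∧ U₃ c) := by
      intro c hc
      rw [Finset.mem_filter] at hc
      rw [Finset.mem_union, Finset.mem_union, Finset.mem_filter, Finset.mem_filter, Finset.mem_filter]
      rcases hc.2.2 with h | h | h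
      · exact Or.inl (Or.inl ⟨hc.1, hc.2.1, h⟩)
      · exact Or.inl (Or.inr ⟨hc.1, hc.2.1, h⟩)
      · exact Or.inr ⟨hc.1, hc.2.1, h⟩
    have h1 := Finset.card_le_card hsub
    have h2 := Finset.card_union_le (cube.filter (fun c => Core c ∧ U₁ c) ∪ cube.filter (fun c => Core c ∧ U₂ c))
      (cube.filter (fun c => Core c ∧ U₃ c))
    have h3 := Finset.card_union_le (cube.filter (fun c => Core c ∧ U₁ c)) (cube.filter (fun c => Core c ∧ U₂ c))
    have : (cube.filter (fun c => Core c ∧ U c)).card ≤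
        (cube.filter (fun c => Core c ∧ U₁ c)).card + (cube.filter (fun c => Core c ∧ U₂ c)).card +
          (cube.filter (fun c => Core c ∧ U₃ c)).card := by omega
    exact_mod_cast this
  -- Step 5: the three injections
  have hMset : ∀ m ∈ Icc 1 Xb, 1 ≤ m := fun m hm => (Finset.mem_Icc.mp hm).1
  have hI₁ : (cube.filter (fun c => Core c ∧ U₁ c)).card ≤
      (((Icc 1 x) ×ˢ ((Icc 1 Xb) ×ˢ (Icc 1 Xb))).filter fun e : ℕ × ℕ × ℕ =>
        ((1 ≤ q₀ * e.1 + a₀ ∧ (e.2.1 : ℤ) ∣ q₀ * e.1 + a₀) ∧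
          (1 ≤ q₁ * e.1 + a₁ ∧ (e.2.2 : ℤ) ∣ q₁ * e.1 + a₁)) ∧
        ((x : ℝ) ^ (1 - η) < (e.2.1 : ℝ) * e.2.2 ∧
          (e.2.1 : ℝ) * e.2.2 ≤ (x : ℝ) ^ (1 - η) + (2 * κ) * (x : ℝ) ^ (1 - η))).card :=
    card_core_filter_le (q₀ := q₀) (a₀ := a₀) (Finset.Subset.refl _) hMset
      (fun p _ => (x : ℝ) ^ (1 - η) < (p.1 : ℝ) * p.2 ∧ (p.1 : ℝ) * p.2 ≤ (x : ℝ) ^ (1 - η) + (2 * κ) * (x : ℝ) ^ (1 - η))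
      (fun _ p => (x : ℝ) ^ (1 - η) < (p.1 : ℝ) * p.2 ∧ (p.1 : ℝ) * p.2 ≤ (x : ℝ) ^ (1 - η) + (2 * κ) * (x : ℝ) ^ (1 - η))
      (fun _ _ _ _ _ _ _ h => h)
  have hI₂ : (cube.filter (fun c => Core c ∧ U₂ c)).card ≤
      (((Icc 1 x) ×ˢ ((Icc 1 Xb) ×ˢ (Icc 1 Xb))).filter fun e : ℕ × ℕ × ℕ =>
        ((1 ≤ q₀ * e.1 + a₀ ∧ (e.2.1 : ℤ) ∣ q₀ * e.1 + a₀) ∧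
          (1 ≤ q₁ * e.1 + a₁ ∧ (e.2.2 : ℤ) ∣ q₁ * e.1 + a₁)) ∧
        ((x : ℝ) ^ (1 + θ) / (1 + 2 * κ) < (e.2.1 : ℝ) * e.2.2 ∧
          (e.2.1 : ℝ) * e.2.2 ≤ (x : ℝ) ^ (1 + θ) / (1 + 2 * κ) + (2 * κ) * ((x : ℝ) ^ (1 + θ) / (1 + 2 * κ)))).card :=
    card_core_filter_le (q₀ := q₀) (a₀ := a₀) (Finset.Subset.refl _) hMset
      (fun p _ => (x : ℝ) ^ (1 + θ) / (1 + 2 * κ) < (p.1 : ℝ) * p.2 ∧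
        (p.1 : ℝ) * p.2 ≤ (x : ℝ) ^ (1 + θ) / (1 + 2 * κ) + (2 * κ) * ((x : ℝ) ^ (1 + θ) / (1 + 2 * κ)))
      (fun _ p => (x : ℝ) ^ (1 + θ) / (1 + 2 * κ) < (p.1 : ℝ) * p.2 ∧
        (p.1 : ℝ) * p.2 ≤ (x : ℝ) ^ (1 + θ) / (1 + 2 * κ) + (2 * κ) * ((x : ℝ) ^ (1 + θ) / (1 + 2 * κ)))
      (fun _ _ _ _ _ _ _ h => h)
  have hI₃ : (cube.filter (fun c => Core c ∧ U₃ c)).card ≤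
      (((Icc 1 x) ×ˢ ((Icc 1 Xb) ×ˢ (Icc 1 Xb))).filter fun e : ℕ × ℕ × ℕ =>
        ((1 ≤ q₀ * e.1 + a₀ ∧ (e.2.1 : ℤ) ∣ q₀ * e.1 + a₀) ∧
          (1 ≤ q₁ * e.1 + a₁ ∧ (e.2.2 : ℤ) ∣ q₁ * e.1 + a₁)) ∧ ((x : ℝ) - y < e.1)).card := by
    refine card_core_filter_le (q₀ := q₀) (a₀ := a₀) (Finset.Subset.refl _) hMset
      (fun p m => ((x : ℝ) - y < (((p.2 : ℤ) * m - a₁) / q₁ : ℤ))) (fun n _ => (x : ℝ) - y < n) ?_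
    intro d₀ d₁ m _ _ _ hn h
    have h0 : (0 : ℤ) ≤ ((d₁ : ℤ) * m - a₁) / q₁ := by omega
    have : ((((((d₁ : ℤ) * m - a₁) / q₁).toNat : ℕ) : ℤ) : ℝ) = ((((d₁ : ℤ) * m - a₁) / q₁ : ℤ) : ℝ) := by
      rw [Int.toNat_of_nonneg h0]
    rw [Int.cast_natCast] at this
    rw [this]; exact h
  -- Step 6: the third count is a `τ·τ` sum over `n ∈ (x - y, x]`
  have hI₃' : ((((Icc 1 x) ×ˢ ((Icc 1 Xb) ×ˢ (Icc 1 Xb))).filter fun e : ℕ × ℕ × ℕ =>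
        ((1 ≤ q₀ * e.1 + a₀ ∧ (e.2.1 : ℤ) ∣ q₀ * e.1 + a₀) ∧
          (1 ≤ q₁ * e.1 + a₁ ∧ (e.2.2 : ℤ) ∣ q₁ * e.1 + a₁)) ∧ ((x : ℝ) - y < e.1)).card : ℝ) ≤
      ∑ n ∈ Ioc (x - y) x,
        ((((q₀ * n + a₀).toNat).divisors.card : ℕ) : ℝ) * ((((q₁ * n + a₁).toNat).divisors.card : ℕ) : ℝ) := by
    have hsub : (((Icc 1 x) ×ˢ ((Icc 1 Xb) ×ˢ (Icc 1 Xb))).filter fun e : ℕ × ℕ × ℕ =>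
        ((1 ≤ q₀ * e.1 + a₀ ∧ (e.2.1 : ℤ) ∣ q₀ * e.1 + a₀) ∧
          (1 ≤ q₁ * e.1 + a₁ ∧ (e.2.2 : ℤ) ∣ q₁ * e.1 + a₁)) ∧ ((x : ℝ) - y < e.1)) ⊆
        ((Ioc (x - y) x) ×ˢ ((Icc 1 Xb) ×ˢ (Icc 1 Xb))).filter (fun e : ℕ × (ℕ × ℕ) =>
          ((1 ≤ q₀ * e.1 + a₀ ∧ (e.2.1 : ℤ) ∣ q₀ * e.1 + a₀) ∧
            (1 ≤ q₁ * e.1 + a₁ ∧ (e.2.2 : ℤ) ∣ q₁ * e.1 + a₁)) ∧ True) := by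
      intro e he
      rw [Finset.mem_filter, Finset.mem_product] at he ⊢
      obtain ⟨⟨hn, hd⟩, hcore, hlt⟩ := he
      refine ⟨⟨?_, hd⟩, hcore, trivial⟩
      rw [Finset.mem_Icc] at hn
      rw [Finset.mem_Ioc]
      refine ⟨?_, hn.2⟩
      -- `x - y < e.1` in `ℕ` from the real inequality
      by_contra hcon
      push Not at hcon
      rcases le_total y x with hyx | hyx
      · have h1 : ((x - y : ℕ) : ℝ) = (x : ℝ) - y := by rw [Nat.cast_sub hyx]
        have h2 : ((x - y : ℕ) : ℝ) ≥ e.1 := by exact_mod_cast hcon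
        linarith
      · rw [Nat.sub_eq_zero_of_le hyx] at hcon
        omega
    calc ((((Icc 1 x) ×ˢ ((Icc 1 Xb) ×ˢ (Icc 1 Xb))).filter fun e : ℕ × ℕ × ℕ =>
        ((1 ≤ q₀ * e.1 + a₀ ∧ (e.2.1 : ℤ) ∣ q₀ * e.1 + a₀) ∧
          (1 ≤ q₁ * e.1 + a₁ ∧ (e.2.2 : ℤ) ∣ q₁ * e.1 + a₁)) ∧ ((x : ℝ) - y < e.1)).card : ℝ)
        ≤ ((((Ioc (x - y) x) ×ˢ ((Icc 1 Xb) ×ˢ (Icc 1 Xb))).filter (fun e : ℕ × (ℕ × ℕ) =>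
          ((1 ≤ q₀ * e.1 + a₀ ∧ (e.2.1 : ℤ) ∣ q₀ * e.1 + a₀) ∧
            (1 ≤ q₁ * e.1 + a₁ ∧ (e.2.2 : ℤ) ∣ q₁ * e.1 + a₁)) ∧ True)).card : ℝ) := by
          exact_mod_cast Finset.card_le_card hsub
      _ ≤ _ := card_core'_filter_le_sum_tau q₀ a₀ q₁ a₁ (Ioc (x - y) x) Xb (fun _ _ => True)
  -- Assembly of the steps
  calc (∑ s ∈ range SP, ∑ j ∈ range SM, ((((Finset.Ioc (bP s) (bP (s + 1)) ×ˢ Finset.Icc 1 Xb) ×ˢ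
          Finset.Ioc (bM j) (bM (j + 1))).filter (fun c : (ℕ × ℕ) × ℕ =>
          (((c.1.2 : ℤ) * c.2 - a₁) % q₁ = 0 ∧
            (1 ≤ ((c.1.2 : ℤ) * c.2 - a₁) / q₁ ∧ ((c.1.2 : ℤ) * c.2 - a₁) / q₁ ≤ x) ∧
            (1 ≤ q₀ * (((c.1.2 : ℤ) * c.2 - a₁) / q₁) + a₀ ∧
              (c.1.1 : ℤ) ∣ q₀ * (((c.1.2 : ℤ) * c.2 - a₁) / q₁) + a₀)) ∧
          (((x : ℝ) ^ (1 - η) < (c.1.1 : ℝ) * c.1.2 ∧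
              (c.1.1 : ℝ) * c.1.2 ≤ (x : ℝ) ^ (1 - η) * (bP (s + 1) : ℕ) / (bP s : ℕ)) ∨
           ((x : ℝ) ^ (1 + θ) * (bP s : ℕ) / (bP (s + 1) : ℕ) < (c.1.1 : ℝ) * c.1.2 ∧
              (c.1.1 : ℝ) * c.1.2 ≤ (x : ℝ) ^ (1 + θ)) ∨
           (((q₁ : ℝ) * x + a₁) * ((bM j : ℕ) + 1) / (bM (j + 1) : ℕ) < (c.1.2 : ℝ) * c.2)))).card : ℝ))
      ≤ ∑ s ∈ range SP, ∑ j ∈ range SM,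
          ∑ d₀ ∈ Finset.Ioc (bP s) (bP (s + 1)), ∑ d₁ ∈ Finset.Icc 1 Xb, ∑ m ∈ Finset.Ioc (bM j) (bM (j + 1)),
            g' d₀ d₁ m := Finset.sum_le_sum fun s hs => Finset.sum_le_sum fun j hj => step1 s hs j hj
    _ = (∑ d₀ ∈ Icc 1 Xb, ∑ d₁ ∈ Icc 1 Xb, ∑ m ∈ Icc 1 Xb, g' d₀ d₁ m) -
          ∑ d₀ ∈ Icc 1 Xb, ∑ d₁ ∈ Icc 1 Xb, ∑ m ∈ Icc 1 M₀, g' d₀ d₁ m := by linarith [hdec]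
    _ ≤ ((cube.filter (fun c => Core c ∧ U c)).card : ℝ) := by linarith [hfull, hsmall0]
    _ ≤ _ := hsplit
    _ ≤ _ := add_le_add (add_le_add (by exact_mod_cast hI₁) (by exact_mod_cast hI₂))
        ((show ((cube.filter (fun c => Core c ∧ U₃ c)).card : ℝ) ≤ _ by exact_mod_cast hI₃).trans hI₃')



/-- `√(ab) = √a √b` and monotonicity facts are used via `Real.sqrt`; we phrase `t ^ (1/2)` as `√t`. -/
theorem rpow_half_eq_sqrt (t : ℝ) : t ^ (1 / 2 : ℝ) = Real.sqrt t := by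
  rw [Real.sqrt_eq_rpow]

/-- **Uniform per-box bound for the dispersion terms.**  With `L ≥ 1`, `0 < κ ≤ 1`, `x ≥ 1`,
`0 < M₀r ≤ Mb'`, `Mb' − Mb + 1 ≤ 4 κ Mb'`, `x^{σ₁/2} ≤ 2 M₀r`, `Mb' ≤ 2 q x^{σ₂+η}`, `0 < P' ≤ x^{σ₂}`
and the exponent bookkeeping `ν ≤ σ₁/4`, `ν ≤ δ ≤ 1/16`, `η ≤ 1/16`, `σ₂ < 1/2`,
`δ + (1+θ)/2 + σ₂ ≤ 1 − ν`, the four terms of `stub_pair_middle_boxdisp` are at most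
`3 L⁴ x^{1−ν} + 4κ x / L^{Ad} + (4 √(2q) + 1) x^{1−ν}`. -/
theorem disp_terms_le {L κ x M₀r Mb Mb' P' q σ₁ σ₂ θ η δ ν Ad : ℝ} (hL : 1 ≤ L) (hκ0 : 0 < κ)
    (hκ1 : κ ≤ 1) (hx : 1 ≤ x) (hM₀r : 0 < M₀r) (hMb' : M₀r ≤ Mb') (hMb : Mb ≤ Mb')
    (hlen : Mb' - Mb + 1 ≤ 4 * κ * Mb') (hM₀x : x ^ (σ₁ / 2) ≤ 2 * M₀r) (hq : 1 ≤ q)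
    (hTM : Mb' ≤ 2 * q * x ^ (σ₂ + η)) (hP'0 : 0 < P') (hP' : P' ≤ x ^ σ₂)
    (hνσ : ν ≤ σ₁ / 4) (hνδ : ν ≤ δ) (hδ16 : δ ≤ 1 / 16) (hη16 : η ≤ 1 / 16)
    (hσ₂ : σ₂ < 1 / 2) (hexp4 : δ + (1 + θ) / 2 + σ₂ ≤ 1 - ν) (hν0 : 0 < ν) :
    L ^ 4 * (x / Mb') * (Mb' - Mb + 1) ^ (1 / 2 : ℝ) +
      (x / Mb') * (Mb' - Mb + 1) / L ^ Ad +
      x ^ δ * (x / Mb') ^ (1 / 2 : ℝ) * (Mb' - Mb + 1) +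
      x ^ δ * (x ^ (1 + θ) / P') ^ (1 / 2 : ℝ) * P' ^ (3 / 2 : ℝ) ≤
    3 * L ^ 4 * x ^ (1 - ν) + 4 * κ * x / L ^ Ad + (4 * Real.sqrt (2 * q) + 1) * x ^ (1 - ν) := by
  have hx0 : 0 < x := by linarith
  have hMb'0 : 0 < Mb' := lt_of_lt_of_le hM₀r hMb'
  have hlen0 : 0 ≤ Mb' - Mb + 1 := by linarith
  have hL0 : 0 < L := by linarith
  have hLA : 0 < L ^ Ad := Real.rpow_pos_of_pos hL0 Ad |> fun h => by
    -- `L ^ Ad` with natural-looking exponent: here `Ad : ℝ`, so this is `rpow`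
    exact h
  -- useful: `x^{1-ν} ≥ x^{1 - σ₁/4}` etc.
  have hx1ν : x ^ (1 - σ₁ / 4) ≤ x ^ (1 - ν) := Real.rpow_le_rpow_of_exponent_le hx (by linarith)
  have hxν0 : 0 < x ^ (1 - ν) := Real.rpow_pos_of_pos hx0 _
  -- (T1): `L⁴ (x/Mb') (Mb'-Mb+1)^{1/2} ≤ L⁴ · x · 2 (κ/Mb')^{1/2} ≤ 2 L⁴ x / √M₀r ≤ 2√2 L⁴ x^{1-σ₁/4}`
  have hT1 : L ^ 4 * (x / Mb') * (Mb' - Mb + 1) ^ (1 / 2 : ℝ) ≤ 3 * L ^ 4 * x ^ (1 - ν) := by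
    have h1 : (Mb' - Mb + 1) ^ (1 / 2 : ℝ) ≤ (4 * κ * Mb') ^ (1 / 2 : ℝ) :=
      Real.rpow_le_rpow hlen0 hlen (by norm_num)
    have h2 : (4 * κ * Mb') ^ (1 / 2 : ℝ) ≤ (4 * Mb') ^ (1 / 2 : ℝ) := by
      refine Real.rpow_le_rpow (by positivity) ?_ (by norm_num)
      nlinarith
    have h3 : (4 * Mb') ^ (1 / 2 : ℝ) = 2 * Real.sqrt Mb' := by
      rw [rpow_half_eq_sqrt, Real.sqrt_mul (by norm_num), show (4 : ℝ) = 2 ^ 2 by norm_num,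
        Real.sqrt_sq (by norm_num)]
    have h4 : x / Mb' * (2 * Real.sqrt Mb') = 2 * x / Real.sqrt Mb' := by
      have hs : 0 < Real.sqrt Mb' := Real.sqrt_pos.mpr hMb'0
      field_simp
      rw [Real.sq_sqrt hMb'0.le]
    -- `1/√Mb' ≤ 1/√M₀r ≤ √2 · x^{-σ₁/4}`
    have h5 : 2 * x / Real.sqrt Mb' ≤ 2 * x / Real.sqrt M₀r := by
      refine div_le_div_of_nonneg_left (by positivity) (Real.sqrt_pos.mpr hM₀r) (Real.sqrt_le_sqrt hMb')
    have h6 : Real.sqrt (x ^ (σ₁ / 2)) ≤ Real.sqrt (2 * M₀r) := Real.sqrt_le_sqrt hM₀x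
    have h7 : Real.sqrt (x ^ (σ₁ / 2)) = x ^ (σ₁ / 4) := by
      rw [Real.sqrt_eq_rpow, ← Real.rpow_mul hx0.le]; ring_nf
    have h8 : Real.sqrt (2 * M₀r) = Real.sqrt 2 * Real.sqrt M₀r := Real.sqrt_mul (by norm_num) _
    have h9 : x ^ (σ₁ / 4) ≤ Real.sqrt 2 * Real.sqrt M₀r := by rw [← h7, ← h8]; exact h6
    have h10 : 2 * x / Real.sqrt M₀r ≤ 2 * Real.sqrt 2 * x ^ (1 - σ₁ / 4) := by
      rw [div_le_iff₀ (Real.sqrt_pos.mpr hM₀r)]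
      have : x = x ^ (1 - σ₁ / 4) * x ^ (σ₁ / 4) := by
        rw [← Real.rpow_add hx0]; ring_nf; exact (Real.rpow_one x).symm
      have hxp : 0 ≤ x ^ (1 - σ₁ / 4) := by positivity
      calc 2 * x = 2 * x ^ (1 - σ₁ / 4) * x ^ (σ₁ / 4) := by rw [mul_assoc, ← this]
        _ ≤ 2 * x ^ (1 - σ₁ / 4) * (Real.sqrt 2 * Real.sqrt M₀r) := by
            exact mul_le_mul_of_nonneg_left h9 (by positivity)
        _ = 2 * Real.sqrt 2 * x ^ (1 - σ₁ / 4) * Real.sqrt M₀r := by ring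
    have hs2 : Real.sqrt 2 ≤ 3 / 2 := by
      rw [Real.sqrt_le_left (by norm_num)]; norm_num
    have hL4 : 0 ≤ L ^ 4 := by positivity
    calc L ^ 4 * (x / Mb') * (Mb' - Mb + 1) ^ (1 / 2 : ℝ)
        ≤ L ^ 4 * (x / Mb') * (2 * Real.sqrt Mb') := by
          rw [← h3]; exact mul_le_mul_of_nonneg_left (h1.trans h2) (by positivity)
      _ = L ^ 4 * (2 * x / Real.sqrt Mb') := by rw [mul_assoc, h4]
      _ ≤ L ^ 4 * (2 * Real.sqrt 2 * x ^ (1 - σ₁ / 4)) := mul_le_mul_of_nonneg_left (h5.trans h10) hL4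
      _ ≤ L ^ 4 * (3 * x ^ (1 - ν)) := by
          refine mul_le_mul_of_nonneg_left ?_ hL4
          have hxp : 0 ≤ x ^ (1 - σ₁ / 4) := by positivity
          nlinarith
      _ = 3 * L ^ 4 * x ^ (1 - ν) := by ring
  -- (T2): `(x/Mb')(Mb'-Mb+1)/L^Ad ≤ 4κ x / L^Ad`
  have hT2 : (x / Mb') * (Mb' - Mb + 1) / L ^ Ad ≤ 4 * κ * x / L ^ Ad := by
    refine div_le_div_of_nonneg_right ?_ hLA.le
    calc x / Mb' * (Mb' - Mb + 1) ≤ x / Mb' * (4 * κ * Mb') :=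
          mul_le_mul_of_nonneg_left hlen (by positivity)
      _ = 4 * κ * x := by field_simp
  -- (T3): `x^δ (x/Mb')^{1/2} (Mb'-Mb+1) ≤ 4κ x^{δ+1/2} √Mb' ≤ 4 √(2q) x^{δ + 1/2 + (σ₂+η)/2} ≤ 4√(2q) x^{1-ν}`
  have hT3 : x ^ δ * (x / Mb') ^ (1 / 2 : ℝ) * (Mb' - Mb + 1) ≤ 4 * Real.sqrt (2 * q) * x ^ (1 - ν) := by
    have h1 : (x / Mb') ^ (1 / 2 : ℝ) = Real.sqrt x / Real.sqrt Mb' := by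
      rw [rpow_half_eq_sqrt, Real.sqrt_div hx0.le]
    have hsM : 0 < Real.sqrt Mb' := Real.sqrt_pos.mpr hMb'0
    have h2 : x ^ δ * (x / Mb') ^ (1 / 2 : ℝ) * (Mb' - Mb + 1) ≤
        x ^ δ * (Real.sqrt x / Real.sqrt Mb') * (4 * κ * Mb') := by
      rw [h1]; exact mul_le_mul_of_nonneg_left hlen (by positivity)
    have h3 : x ^ δ * (Real.sqrt x / Real.sqrt Mb') * (4 * κ * Mb') = 4 * κ * x ^ δ * Real.sqrt x * Real.sqrt Mb' := by
      field_simp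
      rw [Real.sq_sqrt hMb'0.le]
    have h4 : Real.sqrt Mb' ≤ Real.sqrt (2 * q) * x ^ ((σ₂ + η) / 2) := by
      calc Real.sqrt Mb' ≤ Real.sqrt (2 * q * x ^ (σ₂ + η)) := Real.sqrt_le_sqrt hTM
        _ = Real.sqrt (2 * q) * Real.sqrt (x ^ (σ₂ + η)) := Real.sqrt_mul (by positivity) _
        _ = Real.sqrt (2 * q) * x ^ ((σ₂ + η) / 2) := by
            rw [Real.sqrt_eq_rpow (x ^ (σ₂ + η)), ← Real.rpow_mul hx0.le]; ring_nf
    have h5 : x ^ δ * Real.sqrt x * x ^ ((σ₂ + η) / 2) = x ^ (δ + 1 / 2 + (σ₂ + η) / 2) := by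
      rw [Real.sqrt_eq_rpow, ← Real.rpow_add hx0, ← Real.rpow_add hx0]
    have h6 : x ^ (δ + 1 / 2 + (σ₂ + η) / 2) ≤ x ^ (1 - ν) :=
      Real.rpow_le_rpow_of_exponent_le hx (by linarith)
    calc x ^ δ * (x / Mb') ^ (1 / 2 : ℝ) * (Mb' - Mb + 1)
        ≤ 4 * κ * x ^ δ * Real.sqrt x * Real.sqrt Mb' := h2.trans_eq h3
      _ ≤ 4 * 1 * x ^ δ * Real.sqrt x * (Real.sqrt (2 * q) * x ^ ((σ₂ + η) / 2)) := by
          have ha : 0 ≤ x ^ δ * Real.sqrt x := by positivity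
          have := mul_le_mul (mul_le_mul_of_nonneg_left hκ1 (by norm_num : (0:ℝ) ≤ 4)) h4 hsM.le (by positivity)
          nlinarith [this]
      _ = 4 * Real.sqrt (2 * q) * (x ^ δ * Real.sqrt x * x ^ ((σ₂ + η) / 2)) := by ring
      _ = 4 * Real.sqrt (2 * q) * x ^ (δ + 1 / 2 + (σ₂ + η) / 2) := by rw [h5]
      _ ≤ 4 * Real.sqrt (2 * q) * x ^ (1 - ν) := mul_le_mul_of_nonneg_left h6 (by positivity)
  -- (T4): `x^δ (x^{1+θ}/P')^{1/2} P'^{3/2} = x^{δ + (1+θ)/2} P' ≤ x^{δ + (1+θ)/2 + σ₂} ≤ x^{1-ν}`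
  have hT4 : x ^ δ * (x ^ (1 + θ) / P') ^ (1 / 2 : ℝ) * P' ^ (3 / 2 : ℝ) ≤ x ^ (1 - ν) := by
    have h1 : (x ^ (1 + θ) / P') ^ (1 / 2 : ℝ) * P' ^ (3 / 2 : ℝ) = x ^ ((1 + θ) / 2) * P' := by
      rw [Real.div_rpow (by positivity) hP'0.le, ← Real.rpow_mul hx0.le]
      have : P' ^ (3 / 2 : ℝ) = P' ^ (1 / 2 : ℝ) * P' := by
        rw [show (3 / 2 : ℝ) = 1 / 2 + 1 by norm_num, Real.rpow_add hP'0, Real.rpow_one]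
      rw [this]
      have hP12 : 0 < P' ^ (1 / 2 : ℝ) := Real.rpow_pos_of_pos hP'0 _
      field_simp
    rw [mul_assoc, h1]
    calc x ^ δ * (x ^ ((1 + θ) / 2) * P') ≤ x ^ δ * (x ^ ((1 + θ) / 2) * x ^ σ₂) := by
          exact mul_le_mul_of_nonneg_left (mul_le_mul_of_nonneg_left hP' (by positivity)) (by positivity)
      _ = x ^ (δ + (1 + θ) / 2 + σ₂) := by
          rw [← Real.rpow_add hx0, ← Real.rpow_add hx0]; ring_nf
      _ ≤ x ^ (1 - ν) := Real.rpow_le_rpow_of_exponent_le hx hexp4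
  have : (4 * Real.sqrt (2 * q) + 1) * x ^ (1 - ν) = 4 * Real.sqrt (2 * q) * x ^ (1 - ν) + x ^ (1 - ν) := by ring
  rw [this]
  linarith


set_option maxHeartbeats 1600000 in
/-- **The boxes part of the one-sided middle triple sum** (`m > M₀ = ⌊x^{σ₁/2}⌋₊`): shells + dispersion
over the fine `(d₀, m)`-grid. -/
theorem boxes_part_le {q₀ a₀ q₁ a₁ : ℤ} (hq₀ : 0 < q₀) (hq₁ : 0 < q₁) (hc₀ : IsCoprime q₀ a₀)
    (hc₁ : IsCoprime q₁ a₁) (hΔ : q₁ * a₀ - q₀ * a₁ ≠ 0) {σ₁ σ₂ : ℝ} (hσ₁ : 0 < σ₁) (h12 : σ₁ < σ₂)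
    (hσ₂ : σ₂ < 1 / 2) :
    ∃ C : ℝ, 0 < C ∧ ∃ e : ℕ, ∃ ν : ℝ, 0 < ν ∧ ∃ X₀ : ℕ, ∀ (x : ℕ) (θ η : ℝ), X₀ ≤ x →
      0 < θ → θ ≤ min (σ₁ / 4) (min ((1 / 2 - σ₂) / 4) (1 / 16)) →
      0 < η → η ≤ min (σ₁ / 4) (min ((1 / 2 - σ₂) / 4) (1 / 16)) →
      |∑ d₀ ∈ Icc 1 ((q₀.toNat + q₁.toNat) * x + a₀.natAbs + a₁.natAbs),
        ∑ d₁ ∈ Icc 1 ((q₀.toNat + q₁.toNat) * x + a₀.natAbs + a₁.natAbs),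
          ∑ m ∈ Ioc ⌊(x : ℝ) ^ (σ₁ / 2)⌋₊ ((q₀.toNat + q₁.toNat) * x + a₀.natAbs + a₁.natAbs),
          (if ((d₁ : ℤ) * m - a₁) % q₁ = 0 ∧
              (1 ≤ ((d₁ : ℤ) * m - a₁) / q₁ ∧ ((d₁ : ℤ) * m - a₁) / q₁ ≤ x) ∧
              (1 ≤ q₀ * (((d₁ : ℤ) * m - a₁) / q₁) + a₀ ∧ (d₀ : ℤ) ∣ q₀ * (((d₁ : ℤ) * m - a₁) / q₁) + a₀) ∧
              ((x : ℝ) ^ (1 - η) < (d₀ : ℝ) * d₁ ∧ (d₀ : ℝ) * d₁ ≤ (x : ℝ) ^ (1 + θ) ∧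
                ((x : ℝ) ^ σ₁ < (d₀ : ℝ) ∧ (d₀ : ℝ) ≤ (x : ℝ) ^ σ₂)) then
            ((ArithmeticFunction.moebius d₀ : ℝ) * Real.log d₀) *
              ((ArithmeticFunction.moebius d₁ : ℝ) * Real.log d₁) else 0)| ≤
      C * ((x : ℝ) / (1 + Real.log x) + (1 + Real.log x) ^ e * (x : ℝ) ^ (1 - ν)) := by
  classical
  /- (0) constants -/
  obtain ⟨Csh, hCsh, hsh⟩ := shell_card_le hc₀ hc₁ hq₀ hq₁ hΔ 3
  obtain ⟨Cτ, hCτ, c, hτ⟩ :=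
    Literature.NumberTheory.Sieve.LinearPairShells.sum_Ioc_card_divisors_mul_le hq₀ hq₁ a₀ a₁
  set kκ : ℕ := c + 9 with hkκ
  set c₄ : ℝ := (1 / 2 - σ₂) / 4 with hc₄
  have hc₄0 : 0 < c₄ := by rw [hc₄]; linarith
  set δ : ℝ := min c₄ (1 / 16) with hδ
  have hδ0 : 0 < δ := lt_min hc₄0 (by norm_num)
  have hδc₄ : δ ≤ c₄ := min_le_left _ _
  have hδ16 : δ ≤ 1 / 16 := min_le_right _ _
  set Ad : ℝ := ((2 * kκ + 4 : ℕ) : ℝ) with hAd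
  obtain ⟨K, hK, x₀, hdisp⟩ := stub_pair_middle_boxdisp q₀ a₀ q₁ a₁ σ₁ σ₂ δ Ad hq₀ hq₁ hΔ hσ₁ h12
    (by linarith) hδ0
  set ν : ℝ := min (σ₁ / 4) δ with hν
  have hν0 : 0 < ν := lt_min (by linarith) hδ0
  have hνσ : ν ≤ σ₁ / 4 := min_le_left _ _
  have hνδ : ν ≤ δ := min_le_right _ _
  -- pair constants
  have hq₀'Z : ((q₀.toNat : ℕ) : ℤ) = q₀ := Int.toNat_of_nonneg hq₀.le
  have hq₁'Z : ((q₁.toNat : ℕ) : ℤ) = q₁ := Int.toNat_of_nonneg hq₁.le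
  have hq₁'pos : 0 < q₁.toNat := by omega
  set L₀ : ℕ := q₁.toNat + a₁.natAbs + q₁.toNat * (a₀.natAbs + 1) + 2 with hL₀
  set Bq : ℕ := q₀.toNat + q₁.toNat + a₀.natAbs + a₁.natAbs + 2 with hBq
  /- (1) the threshold `X₀` -/
  have e1 := eventually_ge_atTop x₀
  have e2 := eventually_ge_atTop 3
  have e3 := eventually_const_le_natCast (Bq : ℝ)
  have e4 : ∀ᶠ x : ℕ in atTop, (4 : ℝ) ≤ 1 + Real.log x := by
    have := (Real.tendsto_log_atTop.comp tendsto_natCast_atTop_atTop).eventually_ge_atTop (3 : ℝ)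
    filter_upwards [this] with x hx
    simp only [Function.comp] at hx
    linarith
  have e5 := eventually_mul_log_pow_le_rpow 6 kκ (s := σ₁ / 2) (by linarith)
  have e6 := eventually_const_le_rpow 32 (s := σ₁ / 2) (by linarith)
  have e7 := eventually_const_le_rpow (L₀ : ℝ) (s := 1 / 4) (by norm_num)
  obtain ⟨X₀, hX₀⟩ := Filter.eventually_atTop.mp (e1.and (e2.and (e3.and (e4.and (e5.and (e6.and e7))))))
  /- the constants of the conclusion -/
  refine ⟨180 * Csh + 36 * Cτ + 100 * K + 18 * Cτ + 25 * K * (4 + 4 * Real.sqrt (2 * q₁)), by positivity,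
    2 * kκ + 6, ν, hν0, X₀, ?_⟩
  intro x θ η hxX hθ0 hθ hη0 hη
  obtain ⟨hxx₀, hx3, hxB, hL4, hxM6, hx32, hxL₀⟩ := hX₀ x hxX
  -- unpack the bounds on `θ, η`
  have hθσ : θ ≤ σ₁ / 4 := hθ.trans (min_le_left _ _)
  have hθc₄ : θ ≤ c₄ := hθ.trans ((min_le_right _ _).trans (min_le_left _ _))
  have hθ16 : θ ≤ 1 / 16 := hθ.trans ((min_le_right _ _).trans (min_le_right _ _))
  have hηc₄ : η ≤ c₄ := hη.trans ((min_le_right _ _).trans (min_le_left _ _))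
  have hη16 : η ≤ 1 / 16 := hη.trans ((min_le_right _ _).trans (min_le_right _ _))
  have hc₄' : c₄ < 1 / 8 := by rw [hc₄]; linarith only [h12, hσ₁]
  /- (2) basic quantities at `x` -/
  have hx1 : 1 ≤ x := le_trans (by norm_num) hx3
  have hx1R : (1 : ℝ) ≤ x := by exact_mod_cast hx1
  have hx0R : (0 : ℝ) < x := by linarith
  have hx3R : (3 : ℝ) ≤ x := by exact_mod_cast hx3
  set L : ℝ := 1 + Real.log x with hL
  have hlog1 : 1 ≤ Real.log x := by
    rw [Real.le_log_iff_exp_le hx0R]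
    exact (Real.exp_one_lt_d9.le.trans (by norm_num)).trans hx3R
  have hlogL : Real.log x ≤ L := by rw [hL]; linarith only
  have hL1 : 1 ≤ L := by rw [hL]; linarith only [hlog1]
  have hL0 : 0 < L := by linarith only [hL1]
  have hLlog : L ≤ 2 * Real.log x := by rw [hL]; linarith only [hlog1]
  set κ : ℝ := (L ^ kκ)⁻¹ with hκdef
  have hLk1 : 1 ≤ L ^ kκ := one_le_pow₀ hL1
  have hκ0 : 0 < κ := by positivity
  have hκ1 : κ ≤ 1 := inv_le_one_of_one_le₀ hLk1
  have hκL : κ * L ^ kκ = 1 := inv_mul_cancel₀ (by positivity)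
  have hLk8 : (8 : ℝ) ≤ L ^ kκ := by
    calc (8 : ℝ) ≤ 4 ^ 2 := by norm_num
      _ ≤ L ^ 2 := pow_le_pow_left₀ (by norm_num) hL4 2
      _ ≤ L ^ kκ := pow_le_pow_right₀ hL1 (by omega)
  have hκ8 : κ ≤ 1 / 8 := by
    rw [hκdef]; exact (inv_anti₀ (by norm_num) hLk8).trans (by norm_num)
  have hκ4 : κ ≤ 1 / 4 := hκ8.trans (by norm_num)
  -- `Xb`
  set Xb : ℕ := (q₀.toNat + q₁.toNat) * x + a₀.natAbs + a₁.natAbs with hXb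
  have hXb1 : 1 ≤ Xb := by
    have : 1 ≤ (q₀.toNat + q₁.toNat) * x := Nat.one_le_iff_ne_zero.mpr (Nat.mul_ne_zero (by omega) (by omega))
    omega
  have hxXb : x ≤ Xb := by
    have : x ≤ (q₀.toNat + q₁.toNat) * x := Nat.le_mul_of_pos_left x (by omega)
    omega
  have hBqR : (Bq : ℝ) = (q₀.toNat : ℝ) + q₁.toNat + a₀.natAbs + a₁.natAbs + 2 := by rw [hBq]; push_cast; ring
  have hXbR : (Xb : ℝ) = ((q₀.toNat : ℝ) + q₁.toNat) * x + a₀.natAbs + a₁.natAbs := by rw [hXb]; push_cast; ring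
  have hXbx2 : (Xb : ℝ) ≤ (x : ℝ) ^ (2 : ℝ) := by
    rw [Real.rpow_two, hXbR]
    have hB : (Bq : ℝ) ≤ x := hxB
    rw [hBqR] at hB
    have ha : (0 : ℝ) ≤ a₀.natAbs := Nat.cast_nonneg _
    have hb : (0 : ℝ) ≤ a₁.natAbs := Nat.cast_nonneg _
    have h1 : ((q₀.toNat : ℝ) + q₁.toNat) * x ≤ ((x : ℝ) - a₀.natAbs - a₁.natAbs - 2) * x :=
      mul_le_mul_of_nonneg_right (by linarith only [hB]) hx0R.le
    nlinarith only [h1, ha, hb, hx1R]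
  have haxR : (a₁.natAbs : ℝ) ≤ x := by
    have := hxB; rw [hBqR] at this
    have ha : (0 : ℝ) ≤ a₀.natAbs := Nat.cast_nonneg _
    have hq : (0 : ℝ) ≤ (q₀.toNat : ℝ) + q₁.toNat := by positivity
    linarith only [this, ha, hq]
  have hax : a₁.natAbs ≤ x := by exact_mod_cast haxR
  have hLXb : 1 + Real.log Xb ≤ 3 * L := by
    have h1 : Real.log Xb ≤ Real.log ((x : ℝ) ^ (2 : ℝ)) :=
      Real.log_le_log (by exact_mod_cast hXb1) hXbx2
    rw [Real.log_rpow hx0R] at h1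
    rw [hL]; linarith only [h1, hlog1]
  have hLXb0 : 0 ≤ 1 + Real.log Xb := by
    have : 0 ≤ Real.log Xb := Real.log_nonneg (by exact_mod_cast hXb1); linarith only [this]
  -- the `d₀`-grid endpoints
  set BP : ℕ := ⌊(x : ℝ) ^ σ₁⌋₊ with hBP
  set TP : ℕ := ⌊(x : ℝ) ^ σ₂⌋₊ with hTP
  have hxσ₁2 : (32 : ℝ) ≤ (x : ℝ) ^ (σ₁ / 2) := hx32
  have hxσ₁ : (x : ℝ) ^ (σ₁ / 2) ≤ (x : ℝ) ^ σ₁ := Real.rpow_le_rpow_of_exponent_le hx1R (by linarith)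
  have hxσ₁σ₂ : (x : ℝ) ^ σ₁ ≤ (x : ℝ) ^ σ₂ := Real.rpow_le_rpow_of_exponent_le hx1R h12.le
  have hxσ₂x : (x : ℝ) ^ σ₂ ≤ x := by
    calc (x : ℝ) ^ σ₂ ≤ (x : ℝ) ^ (1 : ℝ) := Real.rpow_le_rpow_of_exponent_le hx1R (by linarith)
      _ = x := Real.rpow_one _
  have hBPTP : BP ≤ TP := Nat.floor_le_floor hxσ₁σ₂
  have hBPge : (x : ℝ) ^ σ₁ - 1 ≤ BP := by
    have := Nat.lt_floor_add_one ((x : ℝ) ^ σ₁); rw [← hBP] at this; linarith only [this]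
  have hBP16 : (16 : ℝ) ≤ BP := by linarith only [hBPge, hxσ₁2, hxσ₁]
  have hBP1 : 1 ≤ BP := by exact_mod_cast (show (1 : ℝ) ≤ BP by linarith only [hBP16])
  have hTPle : (TP : ℝ) ≤ (x : ℝ) ^ σ₂ := Nat.floor_le (by positivity)
  have hTPx : TP ≤ x := by
    have : (TP : ℝ) ≤ x := hTPle.trans hxσ₂x
    exact_mod_cast this
  have hTPXb : TP ≤ Xb := hTPx.trans hxXb
  -- the `m`-grid endpoints
  set M₀ : ℕ := ⌊(x : ℝ) ^ (σ₁ / 2)⌋₊ with hM₀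
  have hM₀ge : (x : ℝ) ^ (σ₁ / 2) - 1 ≤ M₀ := by
    have := Nat.lt_floor_add_one ((x : ℝ) ^ (σ₁ / 2)); rw [← hM₀] at this; linarith only [this]
  have hM₀le : (M₀ : ℝ) ≤ (x : ℝ) ^ (σ₁ / 2) := Nat.floor_le (by positivity)
  have hM₀κ : 3 * L ^ kκ + 15 ≤ (M₀ : ℝ) := by
    have h6 : 6 * L ^ kκ ≤ (x : ℝ) ^ (σ₁ / 2) := hxM6
    linarith only [h6, hx32, hM₀ge]
  have hM₀1 : 1 ≤ M₀ := by
    have h0 : (0 : ℝ) ≤ 3 * L ^ kκ := by positivity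
    exact_mod_cast (show (1 : ℝ) ≤ M₀ by linarith only [hM₀κ, h0])
  set TMr : ℝ := 2 * q₁ * (x : ℝ) ^ (σ₂ + η) with hTMr
  set TM : ℕ := min Xb ⌊TMr⌋₊ with hTM
  have hTMXb : TM ≤ Xb := min_le_left _ _
  have hq₁R : (1 : ℝ) ≤ q₁ := by exact_mod_cast hq₁
  have hM₀TM : M₀ ≤ TM := by
    refine le_min ?_ (Nat.floor_le_floor ?_)
    · -- `M₀ ≤ x^{σ₁/2} ≤ x ≤ Xb`
      have : (M₀ : ℝ) ≤ x := hM₀le.trans (hxσ₁.trans (hxσ₁σ₂.trans hxσ₂x))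
      exact le_trans (by exact_mod_cast this) hxXb
    · have hle : σ₁ / 2 ≤ σ₂ + η := by linarith only [h12, hη0, hσ₁]
      have h1 : (x : ℝ) ^ (σ₁ / 2) ≤ (x : ℝ) ^ (σ₂ + η) := Real.rpow_le_rpow_of_exponent_le hx1R hle
      have h0 : 0 ≤ (x : ℝ) ^ (σ₂ + η) := by positivity
      have h2 : (x : ℝ) ^ (σ₂ + η) ≤ (2 * q₁) * (x : ℝ) ^ (σ₂ + η) :=
        le_mul_of_one_le_left h0 (by linarith only [hq₁R])
      exact h1.trans (by linarith only [h2])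
  
  /- (3) step counts and grids -/
  set SP : ℕ := ⌈Real.log ((TP : ℝ) / BP) / Real.log (1 + κ)⌉₊ with hSPdef
  set SM : ℕ := ⌈Real.log ((TM : ℝ) / M₀) / Real.log (1 + κ)⌉₊ with hSMdef
  set bP : ℕ → ℕ := fun s => min TP ⌊(BP : ℝ) * (1 + κ) ^ s⌋₊ with hbP
  set bM : ℕ → ℕ := fun j => min TM ⌊(M₀ : ℝ) * (1 + κ) ^ j⌋₊ with hbM
  have hbPmono : Monotone bP := by rw [hbP]; exact grid_monotone BP TP hκ0.le
  have hbMmono : Monotone bM := by rw [hbM]; exact grid_monotone M₀ TM hκ0.le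
  have hbP0 : bP 0 = BP := grid_zero hBPTP κ
  have hbM0 : bM 0 = M₀ := grid_zero hM₀TM κ
  have hbPS : bP SP = TP := grid_top (le_grid_pow hBP1 hBPTP hκ0)
  have hbMS : bM SM = TM := grid_top (le_grid_pow hM₀1 hM₀TM hκ0)
  have hTM1 : 1 ≤ TM := hM₀1.trans hM₀TM
  have hSPle : (SP : ℝ) ≤ 5 * L ^ (kκ + 1) := by
    have h1 := ceil_log_div_le hBP1 hBPTP hκ0 hκ1
    have h2 : Real.log TP ≤ L := by
      have hTP1 : (1 : ℝ) ≤ TP := by exact_mod_cast hBP1.trans hBPTP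
      have : Real.log TP ≤ Real.log x := Real.log_le_log (by linarith only [hTP1]) (by exact_mod_cast hTPx)
      linarith only [this, hlogL]
    have h3 : 2 * Real.log TP / κ ≤ 2 * L * L ^ kκ := by
      rw [hκdef, div_inv_eq_mul]
      exact mul_le_mul_of_nonneg_right (by linarith only [h2]) (by positivity)
    calc (SP : ℝ) ≤ 2 * Real.log TP / κ + 1 := h1
      _ ≤ 2 * L * L ^ kκ + 1 := by linarith only [h3]
      _ ≤ 5 * L ^ (kκ + 1) := by
          rw [show L ^ (kκ + 1) = L ^ kκ * L from pow_succ L kκ]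
          have hp := one_le_mul_of_one_le_of_one_le hLk1 hL1; linarith only [hp]
  have hSMle : (SM : ℝ) ≤ 5 * L ^ (kκ + 1) := by
    have h1 := ceil_log_div_le hM₀1 hM₀TM hκ0 hκ1
    have h2 : Real.log TM ≤ 2 * L := by
      have hTM1R : (1 : ℝ) ≤ TM := by exact_mod_cast hTM1
      have h4 : Real.log TM ≤ Real.log Xb := Real.log_le_log (by linarith only [hTM1R]) (by exact_mod_cast hTMXb)
      have h3 : Real.log Xb ≤ 2 * Real.log x := by
        have := Real.log_le_log (by exact_mod_cast hXb1) hXbx2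
        rwa [Real.log_rpow hx0R] at this
      linarith only [h4, h3, hlogL]
    have h3 : 2 * Real.log TM / κ ≤ 4 * L * L ^ kκ := by
      rw [hκdef, div_inv_eq_mul]
      exact mul_le_mul_of_nonneg_right (by linarith only [h2]) (by positivity)
    calc (SM : ℝ) ≤ 2 * Real.log TM / κ + 1 := h1
      _ ≤ 4 * L * L ^ kκ + 1 := by linarith only [h3]
      _ ≤ 5 * L ^ (kκ + 1) := by
          rw [show L ^ (kκ + 1) = L ^ kκ * L from pow_succ L kκ]
          have hp := one_le_mul_of_one_le_of_one_le hLk1 hL1; linarith only [hp]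
  -- ratio facts of the grids
  have hbPge : ∀ s, (BP : ℝ) ≤ bP s := fun s => by
    have : bP 0 ≤ bP s := hbPmono (Nat.zero_le s)
    rw [hbP0] at this; exact_mod_cast this
  have hbMge : ∀ j, (M₀ : ℝ) ≤ bM j := fun j => by
    have : bM 0 ≤ bM j := hbMmono (Nat.zero_le j)
    rw [hbM0] at this; exact_mod_cast this
  have hκBP : 2 ≤ κ * BP := by
    -- `BP ≥ x^{σ₁} - 1 ≥ 6 L^kκ - 1`, `κ L^kκ = 1`
    have h1 : 6 * L ^ kκ - 1 ≤ (BP : ℝ) := by linarith only [hxM6, hxσ₁, hBPge]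
    have h2 : κ * (6 * L ^ kκ - 1) ≤ κ * BP := mul_le_mul_of_nonneg_left h1 hκ0.le
    have h3 : κ * (6 * L ^ kκ - 1) = 6 - κ := by linear_combination 6 * hκL
    linarith only [h2, h3, hκ1]
  have hκM₀ : 3 ≤ κ * M₀ := by
    have h2 : κ * (3 * L ^ kκ + 15) ≤ κ * M₀ := mul_le_mul_of_nonneg_left hM₀κ hκ0.le
    have h3 : κ * (3 * L ^ kκ + 15) = 3 + 15 * κ := by linear_combination 3 * hκL
    linarith only [h2, h3, hκ0]
  have hsuccP : ∀ s, ((bP (s + 1) : ℕ) : ℝ) ≤ (1 + κ) * bP s + 2 := fun s => grid_succ_le hκ0.le hκ1 s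
  have hsuccM : ∀ j, ((bM (j + 1) : ℕ) : ℝ) ≤ (1 + κ) * bM j + 2 := fun j => grid_succ_le hκ0.le hκ1 j
  have hratP : ∀ s, ((bP (s + 1) : ℕ) : ℝ) ≤ (1 + 2 * κ) * bP s := fun s => by
    have h1 := hsuccP s
    have h2 : 2 ≤ κ * bP s := hκBP.trans (mul_le_mul_of_nonneg_left (hbPge s) hκ0.le)
    linarith only [h1, h2]
  have hratM : ∀ j, ((bM (j + 1) : ℕ) : ℝ) ≤ (1 + 2 * κ) * ((bM j : ℝ) + 1) := fun j => by
    have h1 := hsuccM j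
    have h2 : 3 ≤ κ * bM j := hκM₀.trans (mul_le_mul_of_nonneg_left (hbMge j) hκ0.le)
    linarith only [h1, h2, hκ0]
  /- (4) the summand and its vanishing -/
  set g : ℕ → ℕ → ℕ → ℝ := fun d₀ d₁ m =>
    (if ((d₁ : ℤ) * m - a₁) % q₁ = 0 ∧
        (1 ≤ ((d₁ : ℤ) * m - a₁) / q₁ ∧ ((d₁ : ℤ) * m - a₁) / q₁ ≤ x) ∧
        (1 ≤ q₀ * (((d₁ : ℤ) * m - a₁) / q₁) + a₀ ∧ (d₀ : ℤ) ∣ q₀ * (((d₁ : ℤ) * m - a₁) / q₁) + a₀) ∧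
        ((x : ℝ) ^ (1 - η) < (d₀ : ℝ) * d₁ ∧ (d₀ : ℝ) * d₁ ≤ (x : ℝ) ^ (1 + θ) ∧
          ((x : ℝ) ^ σ₁ < (d₀ : ℝ) ∧ (d₀ : ℝ) ≤ (x : ℝ) ^ σ₂)) then
      ((ArithmeticFunction.moebius d₀ : ℝ) * Real.log d₀) *
        ((ArithmeticFunction.moebius d₁ : ℝ) * Real.log d₁) else 0) with hg
  have hgcond : ∀ d₀ d₁ m, g d₀ d₁ m ≠ 0 →
      (((d₁ : ℤ) * m - a₁) % q₁ = 0 ∧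
        (1 ≤ ((d₁ : ℤ) * m - a₁) / q₁ ∧ ((d₁ : ℤ) * m - a₁) / q₁ ≤ x) ∧
        (1 ≤ q₀ * (((d₁ : ℤ) * m - a₁) / q₁) + a₀ ∧ (d₀ : ℤ) ∣ q₀ * (((d₁ : ℤ) * m - a₁) / q₁) + a₀) ∧
        ((x : ℝ) ^ (1 - η) < (d₀ : ℝ) * d₁ ∧ (d₀ : ℝ) * d₁ ≤ (x : ℝ) ^ (1 + θ) ∧
          ((x : ℝ) ^ σ₁ < (d₀ : ℝ) ∧ (d₀ : ℝ) ≤ (x : ℝ) ^ σ₂))) := by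
    intro d₀ d₁ m h
    by_contra hc
    exact h (if_neg hc)
  have hg0 : ∀ d₀ d₁ m, g d₀ d₁ m ≠ 0 → BP < d₀ ∧ d₀ ≤ TP := by
    intro d₀ d₁ m h
    obtain ⟨-, -, -, -, -, h5, h6⟩ := hgcond d₀ d₁ m h
    exact ⟨(Nat.floor_lt (by positivity)).mpr h5, Nat.le_floor h6⟩
  have hgm : ∀ d₀ d₁ m, g d₀ d₁ m ≠ 0 → m ≤ TM := by
    intro d₀ d₁ m h
    obtain ⟨hC1, ⟨hn1, hnx⟩, -, hWlo, -, hd₀l, hd₀u⟩ := hgcond d₀ d₁ m h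
    set nn : ℤ := ((d₁ : ℤ) * m - a₁) / q₁ with hnn
    have hq : q₁ * nn = (d₁ : ℤ) * m - a₁ := Int.mul_ediv_cancel' (Int.dvd_of_emod_eq_zero hC1)
    -- `d₁ ≥ 1` (else the window condition fails) and `d₁ m = q₁ nn + a₁ ≤ q₁ x + |a₁|`
    have hd₁pos : 0 < d₁ := by
      rcases Nat.eq_zero_or_pos d₁ with h0 | h0
      · rw [h0] at hWlo; simp at hWlo; linarith only [hWlo, Real.rpow_pos_of_pos hx0R (1 - η)]
      · exact h0
    have hprodZ : (d₁ : ℤ) * m ≤ q₁ * x + |a₁| := by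
      have h1 : (d₁ : ℤ) * m = q₁ * nn + a₁ := by linarith only [hq]
      have h2 : q₁ * nn ≤ q₁ * x := mul_le_mul_of_nonneg_left hnx hq₁.le
      have h3 : a₁ ≤ |a₁| := le_abs_self _
      linarith only [h1, h2, h3]
    have habsR : ((a₁.natAbs : ℕ) : ℝ) = |(a₁ : ℝ)| := by rw [Nat.cast_natAbs, Int.cast_abs]
    have hmZ : (m : ℤ) ≤ (d₁ : ℤ) * m := by
      have h1 : (1 : ℤ) ≤ d₁ := by exact_mod_cast hd₁pos
      have h2 : (0 : ℤ) ≤ m := by positivity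
      nlinarith only [h1, h2]
    refine le_min ?_ ?_
    · -- `m ≤ Xb`
      have : (m : ℤ) ≤ Xb := by
        have hX : (Xb : ℤ) = ((q₀.toNat : ℤ) + q₁.toNat) * x + a₀.natAbs + a₁.natAbs := by
          rw [hXb]; push_cast; ring
        rw [hX, hq₀'Z, hq₁'Z]
        have h1 : (0 : ℤ) ≤ q₀ * x := by positivity
        have h2 : (0 : ℤ) ≤ a₀.natAbs := by positivity
        have h3 : |a₁| = (a₁.natAbs : ℤ) := (Int.natCast_natAbs a₁).symm
        linarith only [hmZ, hprodZ, h1, h2, h3]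
      exact_mod_cast this
    · -- `m ≤ ⌊2 q₁ x^{σ₂+η}⌋₊`
      refine Nat.le_floor ?_
      have hprodR : (d₁ : ℝ) * m ≤ q₁ * x + |(a₁ : ℝ)| := by
        have := (Int.cast_le (R := ℝ)).mpr hprodZ
        push_cast at this
        exact this
      have h2 : (q₁ : ℝ) * x + |(a₁ : ℝ)| ≤ 2 * q₁ * x := by
        have h4 : (x : ℝ) ≤ q₁ * x := le_mul_of_one_le_left hx0R.le hq₁R
        have h5 : |(a₁ : ℝ)| ≤ x := habsR ▸ haxR
        linarith only [h5, h4]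
      -- `d₁ > x^{1-η}/x^{σ₂} = x^{1-η-σ₂}`
      have hd₀pos : (0 : ℝ) < d₀ := lt_of_le_of_lt (by positivity) hd₀l
      have hd₁low : (x : ℝ) ^ (1 - η - σ₂) < d₁ := by
        have h3 : (x : ℝ) ^ (1 - η) < (x : ℝ) ^ σ₂ * d₁ := by
          calc (x : ℝ) ^ (1 - η) < (d₀ : ℝ) * d₁ := hWlo
            _ ≤ (x : ℝ) ^ σ₂ * d₁ := mul_le_mul_of_nonneg_right hd₀u (Nat.cast_nonneg _)
        have h4 : (x : ℝ) ^ (1 - η - σ₂) * (x : ℝ) ^ σ₂ = (x : ℝ) ^ (1 - η) := by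
          rw [← Real.rpow_add hx0R]; ring_nf
        by_contra hcon
        push Not at hcon
        have : (x : ℝ) ^ σ₂ * d₁ ≤ (x : ℝ) ^ (1 - η) := by
          rw [← h4]; rw [mul_comm]; exact mul_le_mul_of_nonneg_right hcon (by positivity)
        linarith only [this, h3]
      have hxsplit : (2 : ℝ) * q₁ * x = 2 * q₁ * (x : ℝ) ^ (σ₂ + η) * (x : ℝ) ^ (1 - η - σ₂) := by
        rw [mul_assoc (2 * (q₁ : ℝ)) _ _, ← Real.rpow_add hx0R]; ring_nf; rw [Real.rpow_one]
      have hmle : (m : ℝ) * (x : ℝ) ^ (1 - η - σ₂) ≤ (d₁ : ℝ) * m := by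
        rw [mul_comm]; exact mul_le_mul_of_nonneg_right hd₁low.le (Nat.cast_nonneg _)
      have hpos : (0 : ℝ) < (x : ℝ) ^ (1 - η - σ₂) := by positivity
      have : (m : ℝ) * (x : ℝ) ^ (1 - η - σ₂) ≤ 2 * q₁ * (x : ℝ) ^ (σ₂ + η) * (x : ℝ) ^ (1 - η - σ₂) := by
        rw [← hxsplit]; linarith only [hmle, hprodR, h2]
      exact le_of_mul_le_mul_right this hpos
  /- (5) the decomposition -/
  have hM₀Xb : M₀ ≤ Xb := hM₀TM.trans hTMXb
  have hdec := tripleSum_decomp g bP bM hbPmono hbMmono hbP0 hbPS hbM0 hbMS hTPXb hM₀TM hTMXb hg0 hgm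
  have hboxes : ∑ d₀ ∈ Icc 1 Xb, ∑ d₁ ∈ Icc 1 Xb, ∑ m ∈ Ioc M₀ Xb, g d₀ d₁ m =
      ∑ s ∈ range SP, ∑ j ∈ range SM,
        ∑ d₀ ∈ Ioc (bP s) (bP (s + 1)), ∑ d₁ ∈ Icc 1 Xb, ∑ m ∈ Ioc (bM j) (bM (j + 1)), g d₀ d₁ m := by
    have hsplit : ∑ d₀ ∈ Icc 1 Xb, ∑ d₁ ∈ Icc 1 Xb, ∑ m ∈ Icc 1 Xb, g d₀ d₁ m =
        (∑ d₀ ∈ Icc 1 Xb, ∑ d₁ ∈ Icc 1 Xb, ∑ m ∈ Icc 1 M₀, g d₀ d₁ m) +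
        ∑ d₀ ∈ Icc 1 Xb, ∑ d₁ ∈ Icc 1 Xb, ∑ m ∈ Ioc M₀ Xb, g d₀ d₁ m := by
      rw [← Finset.sum_add_distrib]
      refine Finset.sum_congr rfl fun d₀ _ => ?_
      rw [← Finset.sum_add_distrib]
      refine Finset.sum_congr rfl fun d₁ _ => ?_
      exact sum_Icc_one_eq_add hM₀Xb _
    linarith only [hsplit, hdec]
  show |∑ d₀ ∈ Icc 1 Xb, ∑ d₁ ∈ Icc 1 Xb, ∑ m ∈ Ioc M₀ Xb, g d₀ d₁ m| ≤ _
  rw [hboxes]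
  /- (6) per-box bounds -/
  set Dunif : ℝ := 3 * L ^ 4 * (x : ℝ) ^ (1 - ν) + 4 * κ * x / L ^ Ad +
    (4 * Real.sqrt (2 * q₁) + 1) * (x : ℝ) ^ (1 - ν) with hDunif
  have hLAd : L ^ Ad = L ^ (2 * kκ + 4) := by rw [hAd, Real.rpow_natCast]
  have hLA0 : 0 < L ^ Ad := by rw [hLAd]; positivity
  have hDunif0 : 0 ≤ Dunif := by rw [hDunif]; positivity
  have hperbox : ∀ s ∈ range SP, ∀ j ∈ range SM,
      |∑ d₀ ∈ Ioc (bP s) (bP (s + 1)), ∑ d₁ ∈ Icc 1 Xb, ∑ m ∈ Ioc (bM j) (bM (j + 1)), g d₀ d₁ m| ≤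
      (1 + Real.log Xb) ^ 2 *
        ((((Finset.Ioc (bP s) (bP (s + 1)) ×ˢ Finset.Icc 1 Xb) ×ˢ Finset.Ioc (bM j) (bM (j + 1))).filter
          (fun c : (ℕ × ℕ) × ℕ =>
            (((c.1.2 : ℤ) * c.2 - a₁) % q₁ = 0 ∧
              (1 ≤ ((c.1.2 : ℤ) * c.2 - a₁) / q₁ ∧ ((c.1.2 : ℤ) * c.2 - a₁) / q₁ ≤ x) ∧
              (1 ≤ q₀ * (((c.1.2 : ℤ) * c.2 - a₁) / q₁) + a₀ ∧
                (c.1.1 : ℤ) ∣ q₀ * (((c.1.2 : ℤ) * c.2 - a₁) / q₁) + a₀)) ∧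
            (((x : ℝ) ^ (1 - η) < (c.1.1 : ℝ) * c.1.2 ∧
                (c.1.1 : ℝ) * c.1.2 ≤ (x : ℝ) ^ (1 - η) * (bP (s + 1) : ℕ) / (bP s : ℕ)) ∨
             ((x : ℝ) ^ (1 + θ) * (bP s : ℕ) / (bP (s + 1) : ℕ) < (c.1.1 : ℝ) * c.1.2 ∧
                (c.1.1 : ℝ) * c.1.2 ≤ (x : ℝ) ^ (1 + θ)) ∨
             (((q₁ : ℝ) * x + a₁) * ((bM j : ℕ) + 1) / (bM (j + 1) : ℕ) < (c.1.2 : ℝ) * c.2)))).card : ℝ) +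
      K * Dunif := by
    intro s hs j hj
    rw [Finset.mem_range] at hs hj
    by_cases hP : bP s < bP (s + 1)
    swap
    · -- empty `d₀`-block
      have h0 : ∑ d₀ ∈ Ioc (bP s) (bP (s + 1)), ∑ d₁ ∈ Icc 1 Xb, ∑ m ∈ Ioc (bM j) (bM (j + 1)), g d₀ d₁ m = 0 := by
        rw [Finset.Ioc_eq_empty hP, Finset.sum_empty]
      rw [h0, abs_zero]
      exact add_nonneg (mul_nonneg (pow_nonneg hLXb0 2) (Nat.cast_nonneg _)) (mul_nonneg hK.le hDunif0)
    by_cases hMj : bM j < bM (j + 1)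
    swap
    · have h0 : ∑ d₀ ∈ Ioc (bP s) (bP (s + 1)), ∑ d₁ ∈ Icc 1 Xb, ∑ m ∈ Ioc (bM j) (bM (j + 1)), g d₀ d₁ m = 0 := by
        refine Finset.sum_eq_zero fun _ _ => Finset.sum_eq_zero fun _ _ => ?_
        rw [Finset.Ioc_eq_empty hMj, Finset.sum_empty]
      rw [h0, abs_zero]
      exact add_nonneg (mul_nonneg (pow_nonneg hLXb0 2) (Nat.cast_nonneg _)) (mul_nonneg hK.le hDunif0)
    -- the box data
    have hPpos : 0 < bP s := by
      have := hbPge s; exact_mod_cast (show (0:ℝ) < bP s by linarith only [this, hBP16])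
    have hP'TP : bP (s + 1) ≤ TP := by rw [← hbPS]; exact hbPmono (Nat.succ_le_of_lt hs)
    have hP'Xb : bP (s + 1) ≤ Xb := hP'TP.trans hTPXb
    have hMb'TM : bM (j + 1) ≤ TM := by rw [← hbMS]; exact hbMmono (Nat.succ_le_of_lt hj)
    have hMb'Xb : bM (j + 1) ≤ Xb := hMb'TM.trans hTMXb
    have hPR : (BP : ℝ) ≤ bP s := hbPge s
    have hP'R : ((bP (s + 1) : ℕ) : ℝ) ≤ (x : ℝ) ^ σ₂ := le_trans (by exact_mod_cast hP'TP) hTPle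
    -- BX2 hypothesis `L₀ ≤ x^{1-η}/P`
    have hL₀P : (L₀ : ℝ) ≤ (x : ℝ) ^ (1 - η) / (bP s : ℕ) := by
      have hPσ : ((bP s : ℕ) : ℝ) ≤ (x : ℝ) ^ σ₂ := le_trans (by exact_mod_cast (hbPmono (Nat.le_succ s)).trans hP'TP) hTPle
      have hP0 : (0 : ℝ) < (bP s : ℕ) := by exact_mod_cast hPpos
      rw [le_div_iff₀ hP0]
      have h1 : (L₀ : ℝ) * (bP s : ℕ) ≤ (x : ℝ) ^ (1 / 4 : ℝ) * (x : ℝ) ^ σ₂ :=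
        mul_le_mul hxL₀ hPσ hP0.le (by positivity)
      have h2 : (x : ℝ) ^ (1 / 4 : ℝ) * (x : ℝ) ^ σ₂ ≤ (x : ℝ) ^ (1 - η) := by
        rw [← Real.rpow_add hx0R]
        exact Real.rpow_le_rpow_of_exponent_le hx1R (by linarith only [hη16, hσ₂])
      linarith only [h1, h2]
    have hBX := stub_pair_middle_box_reduction2 q₀ a₀ q₁ a₁ σ₁ σ₂ θ η x Xb (bP s) (bP (s + 1)) (bM j) (bM (j + 1))
      hq₀ hq₁ hPpos hP hP'Xb hMj hL₀P
    -- BOXDISP hypotheses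
    have hd1 : (x : ℝ) ^ σ₁ / 2 ≤ (bP s : ℕ) := by
      linarith only [hBPge, hPR, hxσ₁2, hxσ₁]
    have hd3 : 2 * bP (s + 1) ≤ 3 * bP s := by
      have h1 := hsuccP s
      have h2 : (16 : ℝ) ≤ bP s := hBP16.trans hPR
      have hκP : κ * (bP s : ℕ) ≤ (1 / 4) * (bP s : ℕ) := mul_le_mul_of_nonneg_right hκ4 (by positivity)
      have : (2 : ℝ) * (bP (s + 1) : ℕ) ≤ 3 * (bP s : ℕ) := by linarith only [h1, h2, hκP]
      exact_mod_cast this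
    have hd4 : ((bP (s + 1) : ℕ) : ℝ) ≤ 2 * (x : ℝ) ^ σ₂ := by
      linarith only [hP'R, Real.rpow_nonneg hx0R.le σ₂]
    have hBD := hdisp x hxx₀ θ η Xb (bP s) (bP (s + 1)) (bM j) (bM (j + 1)) hd1 hP hd3 hd4 hMj hMb'Xb hP'Xb hXbx2
    -- the dispersion terms are at most `Dunif`
    have hMbR : ((bM j : ℕ) : ℝ) ≤ (bM (j + 1) : ℕ) := by exact_mod_cast hMj.le
    have hMb'M₀ : (M₀ : ℝ) ≤ (bM (j + 1) : ℕ) := hbMge (j + 1)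
    have hlen : ((bM (j + 1) : ℕ) : ℝ) - (bM j : ℕ) + 1 ≤ 4 * κ * (bM (j + 1) : ℕ) := by
      have h1 := hsuccM j
      have h2 : 3 ≤ κ * bM j := hκM₀.trans (mul_le_mul_of_nonneg_left (hbMge j) hκ0.le)
      have h3 : κ * (bM j : ℕ) ≤ κ * (bM (j + 1) : ℕ) := mul_le_mul_of_nonneg_left hMbR hκ0.le
      have h4 : 0 ≤ κ * (bM (j + 1) : ℕ) := by positivity
      linarith only [h1, h2, h3, h4]
    have hM₀x : (x : ℝ) ^ (σ₁ / 2) ≤ 2 * (M₀ : ℝ) := by linarith only [hM₀ge, hxσ₁2]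
    have hMb'TMr : ((bM (j + 1) : ℕ) : ℝ) ≤ 2 * q₁ * (x : ℝ) ^ (σ₂ + η) := by
      have h1 : ((bM (j + 1) : ℕ) : ℝ) ≤ (⌊TMr⌋₊ : ℝ) := by exact_mod_cast hMb'TM.trans (min_le_right _ _)
      exact h1.trans (Nat.floor_le (by positivity))
    have hP'pos : (0 : ℝ) < (bP (s + 1) : ℕ) := by exact_mod_cast hPpos.trans hP
    have hM₀pos : (0 : ℝ) < M₀ := by exact_mod_cast hM₀1
    have hexp4 : δ + (1 + θ) / 2 + σ₂ ≤ 1 - ν := by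
      have hνc₄ : ν ≤ c₄ := hνδ.trans hδc₄
      have hc₄v : c₄ = (1 / 2 - σ₂) / 4 := hc₄
      linarith only [hδc₄, hθc₄, hνc₄, hc₄v, hc₄0]
    have hT := disp_terms_le (Ad := Ad) hL1 hκ0 hκ1 hx1R hM₀pos hMb'M₀ hMbR hlen hM₀x hq₁R hMb'TMr hP'pos hP'R
      hνσ hνδ hδ16 hη16 hσ₂ hexp4 hν0
    -- combine
    have habs := abs_sub_abs_le_abs_sub
      (∑ d₀ ∈ Ioc (bP s) (bP (s + 1)), ∑ d₁ ∈ Icc 1 Xb, ∑ m ∈ Ioc (bM j) (bM (j + 1)), g d₀ d₁ m)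
      (∑ d₀ ∈ Finset.Ioc (bP s) (bP (s + 1)), ∑ d₁ ∈ Finset.Icc 1 Xb, ∑ m ∈ Finset.Ioc (bM j) (bM (j + 1)),
          if ((d₁ : ℤ) * m - a₁) % q₁ = 0 ∧
              (q₁ * (d₀ : ℤ) ∣ q₀ * ((d₁ : ℤ) * m) + (q₁ * a₀ - q₀ * a₁)) ∧
              ((x : ℝ) ^ (1 - η) / (bP s : ℕ) < (d₁ : ℝ) ∧ (d₁ : ℝ) ≤ (x : ℝ) ^ (1 + θ) / (bP (s + 1) : ℕ) ∧
                (d₁ : ℝ) ≤ ((q₁ : ℝ) * x + a₁) / (bM (j + 1) : ℕ)) ∧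
              ((x : ℝ) ^ σ₁ < (d₀ : ℝ) ∧ (d₀ : ℝ) ≤ (x : ℝ) ^ σ₂) then
            ((ArithmeticFunction.moebius d₀ : ℝ) * Real.log d₀) *
              ((ArithmeticFunction.moebius d₁ : ℝ) * Real.log d₁) else 0)
    have hKT : K * ((1 + Real.log x) ^ 4 * ((x : ℝ) / (bM (j + 1) : ℕ)) * (((bM (j + 1) : ℕ) : ℝ) - (bM j : ℕ) + 1) ^ (1 / 2 : ℝ) +
        ((x : ℝ) / (bM (j + 1) : ℕ)) * (((bM (j + 1) : ℕ) : ℝ) - (bM j : ℕ) + 1) / (1 + Real.log x) ^ Ad +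
        (x : ℝ) ^ δ * ((x : ℝ) / (bM (j + 1) : ℕ)) ^ (1 / 2 : ℝ) * (((bM (j + 1) : ℕ) : ℝ) - (bM j : ℕ) + 1) +
        (x : ℝ) ^ δ * ((x : ℝ) ^ (1 + θ) / (bP (s + 1) : ℕ)) ^ (1 / 2 : ℝ) * ((bP (s + 1) : ℕ) : ℝ) ^ (3 / 2 : ℝ)) ≤
        K * Dunif := mul_le_mul_of_nonneg_left hT hK.le
    linarith only [hBX, hBD, hKT, habs]
  
  /- (7) summation over the boxes -/
  have hshellsum := shell_cards_sum_le (q₀ := q₀) (a₀ := a₀) (θ := θ) (η := η) hq₁ bP bM hbPmono hbMmono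
    hbP0 hbPS hbM0 hbMS hTPXb hM₀TM hTMXb hBP1 hκ0 hax hratP hratM
  -- the three uniform counts
  have hxhalf : (x : ℝ) ^ (1 / 2 : ℝ) ≤ (x : ℝ) ^ (1 - η) :=
    Real.rpow_le_rpow_of_exponent_le hx1R (by linarith only [hη16])
  have hx32' : (x : ℝ) ^ (1 - η) ≤ (x : ℝ) ^ (3 / 2 : ℝ) :=
    Real.rpow_le_rpow_of_exponent_le hx1R (by linarith only [hη0])
  have h2κ0 : 0 < 2 * κ := by linarith only [hκ0]
  have h2κ1 : 2 * κ ≤ 1 := by linarith only [hκ4]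
  have hcard₁ := hsh x Xb ((x : ℝ) ^ (1 - η)) (2 * κ) hx3 hxhalf hx32' h2κ0 h2κ1
  have h12κ : (1 : ℝ) ≤ 1 + 2 * κ := by linarith only [hκ0]
  have hX₂lo : (x : ℝ) ^ (1 / 2 : ℝ) ≤ (x : ℝ) ^ (1 + θ) / (1 + 2 * κ) := by
    rw [le_div_iff₀ (by linarith only [hκ0])]
    have h1 : (x : ℝ) ^ (1 / 2 : ℝ) * (1 + 2 * κ) ≤ (x : ℝ) ^ (1 / 2 : ℝ) * (3 / 2) :=
      mul_le_mul_of_nonneg_left (by linarith only [hκ4]) (by positivity)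
    have h2 : (x : ℝ) ^ (1 / 2 : ℝ) * (3 / 2) ≤ (x : ℝ) ^ (1 / 2 : ℝ) * (x : ℝ) ^ (1 / 2 : ℝ) := by
      refine mul_le_mul_of_nonneg_left ?_ (by positivity)
      have : (3 : ℝ) ^ (1 / 2 : ℝ) ≤ (x : ℝ) ^ (1 / 2 : ℝ) := Real.rpow_le_rpow (by norm_num) hx3R (by norm_num)
      have h3 : (3 / 2 : ℝ) ≤ (3 : ℝ) ^ (1 / 2 : ℝ) := by
        rw [show (3 : ℝ) ^ (1 / 2 : ℝ) = Real.sqrt 3 by rw [Real.sqrt_eq_rpow]]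
        rw [Real.le_sqrt' (by norm_num)]; norm_num
      linarith only [this, h3]
    have h3 : (x : ℝ) ^ (1 / 2 : ℝ) * (x : ℝ) ^ (1 / 2 : ℝ) = (x : ℝ) ^ (1 : ℝ) := by
      rw [← Real.rpow_add hx0R]; norm_num
    have h4 : (x : ℝ) ^ (1 : ℝ) ≤ (x : ℝ) ^ (1 + θ) := Real.rpow_le_rpow_of_exponent_le hx1R (by linarith only [hθ0])
    linarith only [h1, h2, h3.le, h3.ge, h4]
  have hX₂hi : (x : ℝ) ^ (1 + θ) / (1 + 2 * κ) ≤ (x : ℝ) ^ (3 / 2 : ℝ) := by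
    rw [div_le_iff₀ (by linarith only [hκ0])]
    have h1 : (x : ℝ) ^ (1 + θ) ≤ (x : ℝ) ^ (3 / 2 : ℝ) := Real.rpow_le_rpow_of_exponent_le hx1R (by linarith only [hθ16])
    have h2 : (x : ℝ) ^ (3 / 2 : ℝ) ≤ (x : ℝ) ^ (3 / 2 : ℝ) * (1 + 2 * κ) := le_mul_of_one_le_right (by positivity) h12κ
    linarith only [h1, h2]
  have hcard₂ := hsh x Xb ((x : ℝ) ^ (1 + θ) / (1 + 2 * κ)) (2 * κ) hx3 hX₂lo hX₂hi h2κ0 h2κ1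
  -- the short `n`-interval
  set y : ℕ := ⌈2 * κ * ((x : ℝ) + a₁.natAbs)⌉₊ with hy
  have hyle : (y : ℝ) ≤ 4 * κ * x + 1 := by
    have h1 : (y : ℝ) < 2 * κ * ((x : ℝ) + a₁.natAbs) + 1 := Nat.ceil_lt_add_one (by positivity)
    have h2 : 2 * κ * ((x : ℝ) + a₁.natAbs) ≤ 2 * κ * (x + x) := mul_le_mul_of_nonneg_left (by linarith only [haxR]) (by positivity)
    linarith only [h1, h2]
  have hyx : y ≤ x := by
    have : (y : ℝ) ≤ x := by
      have hκx : κ * x ≤ (1 / 8) * x := mul_le_mul_of_nonneg_right hκ8 hx0R.le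
      linarith only [hyle, hκx, hx3R]
    exact_mod_cast this
  have hx2 : 2 ≤ x := le_trans (by norm_num) hx3
  have hcard₃ := hτ x y hx2 hyx
  -- logarithms: `log x ≤ L`, `L ≤ 2 log x`
  have hlog0 : 0 ≤ Real.log x := by linarith only [hlog1]
  have hlogpow6 : Real.log x ^ (3 + 3) ≤ L ^ 6 := by
    rw [show 3 + 3 = 6 by norm_num]; exact pow_le_pow_left₀ hlog0 hlogL 6
  have hlogpow3 : L ^ 3 ≤ 8 * Real.log x ^ 3 := by
    have : L ^ 3 ≤ (2 * Real.log x) ^ 3 := pow_le_pow_left₀ hL0.le hLlog 3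
    nlinarith only [this]
  have hlogpowc : Real.log x ^ c ≤ L ^ c := pow_le_pow_left₀ hlog0 hlogL c
  have hlog3pos : 0 < Real.log x ^ 3 := by positivity
  -- `κ L^6 ≤ 1/L³`, `κ L^c ≤ 1/L⁹ ≤ 1/L³` (from `κ L^kκ = 1`, `kκ = c + 9`)
  have hL3 : 0 < L ^ 3 := by positivity
  have hL9 : L ^ 3 ≤ L ^ 9 := pow_le_pow_right₀ hL1 (by norm_num)
  have hκL6 : κ * L ^ 6 * L ^ 3 ≤ 1 := by
    have h1 : L ^ 6 * L ^ 3 = L ^ 9 := by rw [← pow_add]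
    have h2 : L ^ 9 ≤ L ^ kκ := pow_le_pow_right₀ hL1 (by omega)
    calc κ * L ^ 6 * L ^ 3 = κ * L ^ 9 := by rw [mul_assoc, h1]
      _ ≤ κ * L ^ kκ := mul_le_mul_of_nonneg_left h2 hκ0.le
      _ = 1 := hκL
  have hκLc : κ * L ^ c * L ^ 3 ≤ 1 := by
    have h1 : L ^ c * L ^ 9 = L ^ kκ := by rw [← pow_add, hkκ]
    calc κ * L ^ c * L ^ 3 ≤ κ * L ^ c * L ^ 9 := mul_le_mul_of_nonneg_left hL9 (by positivity)
      _ = κ * L ^ kκ := by rw [mul_assoc, h1]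
      _ = 1 := hκL
  -- bound for `card₁`, `card₂`: `≤ 10 Csh x / L³`
  have hsh_bound : ∀ X : ℝ, Csh * (2 * κ * x * Real.log x ^ (3 + 3) + x / Real.log x ^ 3) ≤ 10 * Csh * x / L ^ 3 := by
    intro X
    have h1 : 2 * κ * x * Real.log x ^ (3 + 3) ≤ 2 * x / L ^ 3 := by
      rw [le_div_iff₀ hL3]
      have h2 : 2 * κ * x * Real.log x ^ (3 + 3) * L ^ 3 ≤ 2 * κ * x * L ^ 6 * L ^ 3 := by
        have : 0 ≤ 2 * κ * x := by positivity
        exact mul_le_mul_of_nonneg_right (mul_le_mul_of_nonneg_left hlogpow6 this) hL3.le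
      have h3 : 2 * κ * x * L ^ 6 * L ^ 3 = 2 * x * (κ * L ^ 6 * L ^ 3) := by ring
      rw [h3] at h2
      have h4 : 2 * x * (κ * L ^ 6 * L ^ 3) ≤ 2 * x * 1 := mul_le_mul_of_nonneg_left hκL6 (by positivity)
      linarith only [h2, h4]
    have h2 : x / Real.log x ^ 3 ≤ 8 * x / L ^ 3 := by
      rw [div_le_div_iff₀ hlog3pos hL3]
      have := mul_le_mul_of_nonneg_left hlogpow3 hx0R.le
      linarith only [this]
    have h3 : Csh * (2 * κ * x * Real.log x ^ (3 + 3) + x / Real.log x ^ 3) ≤ Csh * (2 * x / L ^ 3 + 8 * x / L ^ 3) :=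
      mul_le_mul_of_nonneg_left (add_le_add h1 h2) hCsh.le
    have h4 : Csh * (2 * x / L ^ 3 + 8 * x / L ^ 3) = 10 * Csh * x / L ^ 3 := by ring
    linarith only [h3, h4.le]
  -- bound for the `τ·τ` sum: `≤ Cτ (4x/L³ + L^c + x^{3/4})`
  have hτ_bound : Cτ * ((y : ℝ) * Real.log x ^ c + (x : ℝ) ^ (3 / 4 : ℝ)) ≤
      Cτ * (4 * x / L ^ 3 + L ^ c + (x : ℝ) ^ (3 / 4 : ℝ)) := by
    refine mul_le_mul_of_nonneg_left (add_le_add ?_ le_rfl) hCτ.le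
    have h1 : (y : ℝ) * Real.log x ^ c ≤ (4 * κ * x + 1) * L ^ c := mul_le_mul hyle hlogpowc (by positivity) (by positivity)
    have h2 : 4 * κ * x * L ^ c ≤ 4 * x / L ^ 3 := by
      rw [le_div_iff₀ hL3]
      have h3 : 4 * κ * x * L ^ c * L ^ 3 = 4 * x * (κ * L ^ c * L ^ 3) := by ring
      rw [h3]
      have := mul_le_mul_of_nonneg_left hκLc (show 0 ≤ 4 * (x : ℝ) by positivity)
      linarith only [this]
    nlinarith only [h1, h2]
  -- the shell total
  have hLXb2 : (1 + Real.log Xb) ^ 2 ≤ 9 * L ^ 2 := by nlinarith only [hLXb, hLXb0]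
  have hshell_total : (1 + Real.log Xb) ^ 2 * (∑ s ∈ range SP, ∑ j ∈ range SM,
      ((((Finset.Ioc (bP s) (bP (s + 1)) ×ˢ Finset.Icc 1 Xb) ×ˢ Finset.Ioc (bM j) (bM (j + 1))).filter
        (fun c : (ℕ × ℕ) × ℕ =>
          (((c.1.2 : ℤ) * c.2 - a₁) % q₁ = 0 ∧
            (1 ≤ ((c.1.2 : ℤ) * c.2 - a₁) / q₁ ∧ ((c.1.2 : ℤ) * c.2 - a₁) / q₁ ≤ x) ∧
            (1 ≤ q₀ * (((c.1.2 : ℤ) * c.2 - a₁) / q₁) + a₀ ∧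
              (c.1.1 : ℤ) ∣ q₀ * (((c.1.2 : ℤ) * c.2 - a₁) / q₁) + a₀)) ∧
          (((x : ℝ) ^ (1 - η) < (c.1.1 : ℝ) * c.1.2 ∧
              (c.1.1 : ℝ) * c.1.2 ≤ (x : ℝ) ^ (1 - η) * (bP (s + 1) : ℕ) / (bP s : ℕ)) ∨
           ((x : ℝ) ^ (1 + θ) * (bP s : ℕ) / (bP (s + 1) : ℕ) < (c.1.1 : ℝ) * c.1.2 ∧
              (c.1.1 : ℝ) * c.1.2 ≤ (x : ℝ) ^ (1 + θ)) ∨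
           (((q₁ : ℝ) * x + a₁) * ((bM j : ℕ) + 1) / (bM (j + 1) : ℕ) < (c.1.2 : ℝ) * c.2)))).card : ℝ)) ≤
      (180 * Csh + 36 * Cτ) * (x / L) + 18 * Cτ * (L ^ (2 * kκ + 6) * (x : ℝ) ^ (1 - ν)) := by
    have hS := hshellsum
    have hsum_le : (∑ s ∈ range SP, ∑ j ∈ range SM,
      ((((Finset.Ioc (bP s) (bP (s + 1)) ×ˢ Finset.Icc 1 Xb) ×ˢ Finset.Ioc (bM j) (bM (j + 1))).filter
        (fun c : (ℕ × ℕ) × ℕ =>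
          (((c.1.2 : ℤ) * c.2 - a₁) % q₁ = 0 ∧
            (1 ≤ ((c.1.2 : ℤ) * c.2 - a₁) / q₁ ∧ ((c.1.2 : ℤ) * c.2 - a₁) / q₁ ≤ x) ∧
            (1 ≤ q₀ * (((c.1.2 : ℤ) * c.2 - a₁) / q₁) + a₀ ∧
              (c.1.1 : ℤ) ∣ q₀ * (((c.1.2 : ℤ) * c.2 - a₁) / q₁) + a₀)) ∧
          (((x : ℝ) ^ (1 - η) < (c.1.1 : ℝ) * c.1.2 ∧
              (c.1.1 : ℝ) * c.1.2 ≤ (x : ℝ) ^ (1 - η) * (bP (s + 1) : ℕ) / (bP s : ℕ)) ∨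
           ((x : ℝ) ^ (1 + θ) * (bP s : ℕ) / (bP (s + 1) : ℕ) < (c.1.1 : ℝ) * c.1.2 ∧
              (c.1.1 : ℝ) * c.1.2 ≤ (x : ℝ) ^ (1 + θ)) ∨
           (((q₁ : ℝ) * x + a₁) * ((bM j : ℕ) + 1) / (bM (j + 1) : ℕ) < (c.1.2 : ℝ) * c.2)))).card : ℝ)) ≤
        10 * Csh * x / L ^ 3 + 10 * Csh * x / L ^ 3 + Cτ * (4 * x / L ^ 3 + L ^ c + (x : ℝ) ^ (3 / 4 : ℝ)) := by
      refine hS.trans (add_le_add (add_le_add (hcard₁.trans (hsh_bound 0)) (hcard₂.trans (hsh_bound 0)))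
        (hcard₃.trans hτ_bound))
    -- multiply by `(1 + log Xb)² ≤ 9 L²`
    have hnonneg : 0 ≤ 10 * Csh * x / L ^ 3 + 10 * Csh * x / L ^ 3 + Cτ * (4 * x / L ^ 3 + L ^ c + (x : ℝ) ^ (3 / 4 : ℝ)) := by
      positivity
    have h1 := mul_le_mul hLXb2 hsum_le
      (Finset.sum_nonneg fun _ _ => Finset.sum_nonneg fun _ _ => Nat.cast_nonneg _) (by positivity)
    refine h1.trans ?_
    -- `9L² · (20 Csh x/L³ + 4Cτ x/L³) = (180 Csh + 36 Cτ) x / L`, and the rest is absorbed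
    have hxν1 : 1 ≤ (x : ℝ) ^ (1 - ν) := Real.one_le_rpow hx1R (by linarith only [hνσ, hσ₁, h12, hσ₂])
    have hx34 : (x : ℝ) ^ (3 / 4 : ℝ) ≤ (x : ℝ) ^ (1 - ν) :=
      Real.rpow_le_rpow_of_exponent_le hx1R (by linarith only [hνδ, hδ16])
    have hLc2 : L ^ 2 * L ^ c ≤ L ^ (2 * kκ + 6) := by
      rw [← pow_add]; exact pow_le_pow_right₀ hL1 (by omega)
    have hL2 : L ^ 2 ≤ L ^ (2 * kκ + 6) := pow_le_pow_right₀ hL1 (by omega)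
    have hLx : 9 * L ^ 2 * (10 * Csh * x / L ^ 3 + 10 * Csh * x / L ^ 3 + Cτ * (4 * x / L ^ 3)) =
        (180 * Csh + 36 * Cτ) * (x / L) := by
      field_simp
      ring
    have hrest : 9 * L ^ 2 * (Cτ * (L ^ c + (x : ℝ) ^ (3 / 4 : ℝ))) ≤ 18 * Cτ * (L ^ (2 * kκ + 6) * (x : ℝ) ^ (1 - ν)) := by
      have h2 : L ^ 2 * L ^ c ≤ L ^ (2 * kκ + 6) * (x : ℝ) ^ (1 - ν) := by
        calc L ^ 2 * L ^ c ≤ L ^ (2 * kκ + 6) := hLc2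
          _ = L ^ (2 * kκ + 6) * 1 := (mul_one _).symm
          _ ≤ L ^ (2 * kκ + 6) * (x : ℝ) ^ (1 - ν) := mul_le_mul_of_nonneg_left hxν1 (by positivity)
      have h3 : L ^ 2 * (x : ℝ) ^ (3 / 4 : ℝ) ≤ L ^ (2 * kκ + 6) * (x : ℝ) ^ (1 - ν) :=
        mul_le_mul hL2 hx34 (by positivity) (by positivity)
      nlinarith only [h2, h3, hCτ]
    have hsplit : 9 * L ^ 2 * (10 * Csh * x / L ^ 3 + 10 * Csh * x / L ^ 3 + Cτ * (4 * x / L ^ 3 + L ^ c + (x : ℝ) ^ (3 / 4 : ℝ))) =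
        9 * L ^ 2 * (10 * Csh * x / L ^ 3 + 10 * Csh * x / L ^ 3 + Cτ * (4 * x / L ^ 3)) +
        9 * L ^ 2 * (Cτ * (L ^ c + (x : ℝ) ^ (3 / 4 : ℝ))) := by ring
    rw [hsplit, hLx]
    linarith only [hrest]
  -- the dispersion total: `SP · SM · K · Dunif`
  have hdisp_total : (SP : ℝ) * ((SM : ℝ) * (K * Dunif)) ≤
      100 * K * (x / L) + (25 * K * (4 + 4 * Real.sqrt (2 * q₁))) * (L ^ (2 * kκ + 6) * (x : ℝ) ^ (1 - ν)) := by
    have hSS : (SP : ℝ) * (SM : ℝ) ≤ 25 * L ^ (2 * kκ + 2) := by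
      have := mul_le_mul hSPle hSMle (Nat.cast_nonneg _) (by positivity)
      have h2 : 5 * L ^ (kκ + 1) * (5 * L ^ (kκ + 1)) = 25 * L ^ (2 * kκ + 2) := by
        rw [show 2 * kκ + 2 = (kκ + 1) + (kκ + 1) by ring, pow_add]; ring
      linarith only [this, h2.le, h2.ge]
    have h1 : (SP : ℝ) * ((SM : ℝ) * (K * Dunif)) = ((SP : ℝ) * SM) * (K * Dunif) := by ring
    rw [h1]
    have h2 : ((SP : ℝ) * SM) * (K * Dunif) ≤ 25 * L ^ (2 * kκ + 2) * (K * Dunif) :=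
      mul_le_mul_of_nonneg_right hSS (by positivity)
    refine h2.trans ?_
    -- expand `Dunif`
    have hA : 25 * L ^ (2 * kκ + 2) * (K * (3 * L ^ 4 * (x : ℝ) ^ (1 - ν))) =
        75 * K * (L ^ (2 * kκ + 6) * (x : ℝ) ^ (1 - ν)) := by
      rw [show 2 * kκ + 6 = (2 * kκ + 2) + 4 by ring, pow_add]; ring
    have hB : 25 * L ^ (2 * kκ + 2) * (K * (4 * κ * x / L ^ Ad)) ≤ 100 * K * (x / L) := by
      have hsplit4 : L ^ (2 * kκ + 4) = L ^ (2 * kκ + 2) * L ^ 2 := by rw [← pow_add]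
      have hL22 : 0 < L ^ (2 * kκ + 2) := by positivity
      have hκL1 : κ ≤ 1 := hκ1
      -- `25 L^{2k+2} K · 4κx / (L^{2k+2} L²) = 100 K κ x / L² ≤ 100 K x / L`
      have h3 : 25 * L ^ (2 * kκ + 2) * (K * (4 * κ * x / L ^ Ad)) = 100 * K * κ * x / L ^ 2 := by
        rw [hLAd, hsplit4]
        field_simp
        ring
      rw [h3, div_le_iff₀ (by positivity)]
      have h4 : 100 * K * (x / L) * L ^ 2 = 100 * K * x * L := by field_simp
      rw [h4]
      have h5 : κ * x ≤ 1 * x := mul_le_mul_of_nonneg_right hκL1 hx0R.le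
      have h6 : (x : ℝ) ≤ x * L := le_mul_of_one_le_right hx0R.le hL1
      nlinarith only [h5, h6, hK]
    have hC : 25 * L ^ (2 * kκ + 2) * (K * ((4 * Real.sqrt (2 * q₁) + 1) * (x : ℝ) ^ (1 - ν))) ≤
        25 * K * (4 * Real.sqrt (2 * q₁) + 1) * (L ^ (2 * kκ + 6) * (x : ℝ) ^ (1 - ν)) := by
      have h3 : L ^ (2 * kκ + 2) ≤ L ^ (2 * kκ + 6) := pow_le_pow_right₀ hL1 (by omega)
      have h4 : 0 ≤ K * ((4 * Real.sqrt (2 * q₁) + 1) * (x : ℝ) ^ (1 - ν)) := by positivity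
      nlinarith only [h3, h4]
    have hexpand : 25 * L ^ (2 * kκ + 2) * (K * Dunif) =
        25 * L ^ (2 * kκ + 2) * (K * (3 * L ^ 4 * (x : ℝ) ^ (1 - ν))) +
        25 * L ^ (2 * kκ + 2) * (K * (4 * κ * x / L ^ Ad)) +
        25 * L ^ (2 * kκ + 2) * (K * ((4 * Real.sqrt (2 * q₁) + 1) * (x : ℝ) ^ (1 - ν))) := by
      rw [hDunif]; ring
    rw [hexpand, hA]
    have hpos : 0 ≤ L ^ (2 * kκ + 6) * (x : ℝ) ^ (1 - ν) := by positivity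
    nlinarith only [hB, hC, hpos, hK]
  /- (8) conclusion -/
  have habs1 : |∑ s ∈ range SP, ∑ j ∈ range SM,
      ∑ d₀ ∈ Ioc (bP s) (bP (s + 1)), ∑ d₁ ∈ Icc 1 Xb, ∑ m ∈ Ioc (bM j) (bM (j + 1)), g d₀ d₁ m| ≤
      ∑ s ∈ range SP, ∑ j ∈ range SM,
        |∑ d₀ ∈ Ioc (bP s) (bP (s + 1)), ∑ d₁ ∈ Icc 1 Xb, ∑ m ∈ Ioc (bM j) (bM (j + 1)), g d₀ d₁ m| := by
    refine (Finset.abs_sum_le_sum_abs _ _).trans (Finset.sum_le_sum fun s _ => Finset.abs_sum_le_sum_abs _ _)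
  refine habs1.trans ?_
  refine (Finset.sum_le_sum fun s hs => Finset.sum_le_sum fun j hj => hperbox s hs j hj).trans ?_
  rw [Finset.sum_congr rfl fun s _ => Finset.sum_add_distrib, Finset.sum_add_distrib]
  rw [Finset.sum_congr rfl fun s _ => (Finset.mul_sum _ _ _).symm, ← Finset.mul_sum]
  simp only [Finset.sum_const, Finset.card_range, nsmul_eq_mul]
  -- now: `LXb² · ΣΣ card + SP * (SM * (K * Dunif)) ≤ C · (x/L + L^e x^{1-ν})`
  have hP0 : 0 ≤ x / L := by positivity
  have hQ0 : 0 ≤ L ^ (2 * kκ + 6) * (x : ℝ) ^ (1 - ν) := by positivity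
  have hs0 : 0 ≤ Real.sqrt (2 * (q₁ : ℝ)) := Real.sqrt_nonneg _
  set P : ℝ := x / L with hPdef
  set Q : ℝ := L ^ (2 * kκ + 6) * (x : ℝ) ^ (1 - ν) with hQdef
  set sq : ℝ := Real.sqrt (2 * (q₁ : ℝ)) with hsq
  have e1 : 0 ≤ Csh * P := mul_nonneg hCsh.le hP0
  have e2 : 0 ≤ Cτ * P := mul_nonneg hCτ.le hP0
  have e3 : 0 ≤ K * P := mul_nonneg hK.le hP0
  have e4 : 0 ≤ K * (sq * P) := mul_nonneg hK.le (mul_nonneg hs0 hP0)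
  have e5 : 0 ≤ Csh * Q := mul_nonneg hCsh.le hQ0
  have e6 : 0 ≤ Cτ * Q := mul_nonneg hCτ.le hQ0
  have e7 : 0 ≤ K * Q := mul_nonneg hK.le hQ0
  linarith only [hshell_total, hdisp_total, e1, e2, e3, e4, e5, e6, e7]


/-- `1 + log Xb ≤ 3 (1 + log x)` when `1 ≤ Xb ≤ x²` … in the form used below: for `Xb ≤ x ^ 2`,
`0 < x`, `1 ≤ Xb`. -/
theorem one_add_log_le_three_mul {x Xb : ℕ} (hx : 1 ≤ x) (hXb1 : 1 ≤ Xb) (hXb : (Xb : ℝ) ≤ (x : ℝ) ^ 2) :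
    1 + Real.log Xb ≤ 3 * (1 + Real.log x) := by
  have hx0 : (0 : ℝ) < x := by exact_mod_cast hx
  have hXb0 : (0 : ℝ) < Xb := by exact_mod_cast hXb1
  have h1 : Real.log Xb ≤ Real.log ((x : ℝ) ^ 2) := Real.log_le_log hXb0 hXb
  rw [Real.log_pow] at h1
  have h2 : 0 ≤ Real.log x := Real.log_nonneg (by exact_mod_cast hx)
  push_cast at h1
  linarith

/-- **Small-cofactor part.**  For pair data `qᵢ ≥ 1`, `0 < σ₁`, `θ ≤ σ₁/4`, there are `C` and `c`
such that for all `x ≥ X₀` (with `Xb = (q₀+q₁)x + |a₀| + |a₁|` … any `Xb` with `1 ≤ Xb ≤ x²`) the part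
`m ≤ ⌊x^{σ₁/2}⌋₊` of the triple sum is at most `C (1 + log x)^{c+2} x^{1 − σ₁/4}`. -/
theorem small_part_le {q₀ a₀ q₁ a₁ : ℤ} (hq₀ : 0 < q₀) (hq₁ : 0 < q₁) {σ₁ : ℝ} (hσ₁ : 0 < σ₁)
    (hσ₁' : σ₁ < 1) :
    ∃ C : ℝ, 0 < C ∧ ∃ c : ℕ, ∃ X₀ : ℕ, ∀ (x Xb : ℕ) (σ₂ θ η : ℝ), X₀ ≤ x → θ ≤ σ₁ / 4 →
      1 ≤ Xb → (Xb : ℝ) ≤ (x : ℝ) ^ 2 →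
      |∑ d₀ ∈ Finset.Icc 1 Xb, ∑ d₁ ∈ Finset.Icc 1 Xb, ∑ m ∈ Finset.Icc 1 ⌊(x : ℝ) ^ (σ₁ / 2)⌋₊,
          (if ((d₁ : ℤ) * m - a₁) % q₁ = 0 ∧
              (1 ≤ ((d₁ : ℤ) * m - a₁) / q₁ ∧ ((d₁ : ℤ) * m - a₁) / q₁ ≤ x) ∧
              (1 ≤ q₀ * (((d₁ : ℤ) * m - a₁) / q₁) + a₀ ∧ (d₀ : ℤ) ∣ q₀ * (((d₁ : ℤ) * m - a₁) / q₁) + a₀) ∧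
              ((x : ℝ) ^ (1 - η) < (d₀ : ℝ) * d₁ ∧ (d₀ : ℝ) * d₁ ≤ (x : ℝ) ^ (1 + θ) ∧
                ((x : ℝ) ^ σ₁ < (d₀ : ℝ) ∧ (d₀ : ℝ) ≤ (x : ℝ) ^ σ₂)) then
            ((ArithmeticFunction.moebius d₀ : ℝ) * Real.log d₀) *
              ((ArithmeticFunction.moebius d₁ : ℝ) * Real.log d₁) else 0)| ≤
      C * (1 + Real.log x) ^ (c + 2) * (x : ℝ) ^ (1 - σ₁ / 4) := by
  obtain ⟨Cτ, hCτ, c, hτ⟩ :=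
    Literature.NumberTheory.Sieve.LinearPairShells.sum_Ioc_card_divisors_mul_le hq₀ hq₁ a₀ a₁
  -- choice of `X₀`
  have hpos1 : 0 < 1 - σ₁ / 4 := by linarith
  have hpos2 : 0 < σ₁ / 4 := by linarith
  have ht1 : Filter.Tendsto (fun x : ℕ => (x : ℝ) ^ (1 - σ₁ / 4)) Filter.atTop Filter.atTop :=
    (tendsto_rpow_atTop hpos1).comp tendsto_natCast_atTop_atTop
  have ht2 : Filter.Tendsto (fun x : ℕ => (x : ℝ) ^ (σ₁ / 4)) Filter.atTop Filter.atTop :=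
    (tendsto_rpow_atTop hpos2).comp tendsto_natCast_atTop_atTop
  have hev : ∀ᶠ x : ℕ in Filter.atTop, 2 ≤ x ∧ (a₁.natAbs : ℝ) ≤ (x : ℝ) ^ (1 - σ₁ / 4) ∧
      (2 : ℝ) ≤ (x : ℝ) ^ (σ₁ / 4) :=
    (Filter.eventually_ge_atTop 2).and ((ht1.eventually_ge_atTop _).and (ht2.eventually_ge_atTop _))
  obtain ⟨X₀, hX₀⟩ := Filter.eventually_atTop.mp hev
  refine ⟨36 * Cτ, by positivity, c, X₀, ?_⟩
  intro x Xb σ₂ θ η hx hθ hXb1 hXb2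
  obtain ⟨hx2, ha₁, hx4⟩ := hX₀ x hx
  have hx1 : 1 ≤ x := le_trans (by norm_num) hx2
  have hx1R : (1 : ℝ) ≤ x := by exact_mod_cast hx1
  have hx0R : (0 : ℝ) < x := by linarith
  set L : ℝ := 1 + Real.log x with hL
  have hlog0 : 0 ≤ Real.log x := Real.log_nonneg hx1R
  have hL1 : 1 ≤ L := by linarith
  set M₀ : ℕ := ⌊(x : ℝ) ^ (σ₁ / 2)⌋₊ with hM₀
  set N : ℕ := ⌊(M₀ : ℝ) * (x : ℝ) ^ (1 + θ - σ₁)⌋₊ + a₁.natAbs with hN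
  -- Step 1: the counting stub
  have h1 := stub_pair_middle_smallm q₀ a₀ q₁ a₁ σ₁ σ₂ θ η x Xb M₀ hq₀ hq₁ hx1
  refine h1.trans ?_
  -- Step 2: `N ≤ x^{1-σ₁/4} + |a₁| ≤ 2 x^{1-σ₁/4}` and `N' = max N 2`
  have hY : (x : ℝ) ^ (1 - σ₁ / 4) ≤ x := by
    calc (x : ℝ) ^ (1 - σ₁ / 4) ≤ (x : ℝ) ^ (1 : ℝ) := Real.rpow_le_rpow_of_exponent_le hx1R (by linarith)
      _ = x := Real.rpow_one _
  have hM₀le : (M₀ : ℝ) ≤ (x : ℝ) ^ (σ₁ / 2) := Nat.floor_le (by positivity)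
  have hNle : (N : ℝ) ≤ 2 * (x : ℝ) ^ (1 - σ₁ / 4) := by
    have h2 : (⌊(M₀ : ℝ) * (x : ℝ) ^ (1 + θ - σ₁)⌋₊ : ℝ) ≤ (M₀ : ℝ) * (x : ℝ) ^ (1 + θ - σ₁) :=
      Nat.floor_le (by positivity)
    have h3 : (M₀ : ℝ) * (x : ℝ) ^ (1 + θ - σ₁) ≤ (x : ℝ) ^ (σ₁ / 2) * (x : ℝ) ^ (1 + θ - σ₁) :=
      mul_le_mul_of_nonneg_right hM₀le (by positivity)
    have h4 : (x : ℝ) ^ (σ₁ / 2) * (x : ℝ) ^ (1 + θ - σ₁) = (x : ℝ) ^ (1 + θ - σ₁ / 2) := by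
      rw [← Real.rpow_add hx0R]; ring_nf
    have h5 : (x : ℝ) ^ (1 + θ - σ₁ / 2) ≤ (x : ℝ) ^ (1 - σ₁ / 4) :=
      Real.rpow_le_rpow_of_exponent_le hx1R (by linarith)
    have : (N : ℝ) = (⌊(M₀ : ℝ) * (x : ℝ) ^ (1 + θ - σ₁)⌋₊ : ℝ) + a₁.natAbs := by
      rw [hN]; push_cast; ring
    rw [this]; linarith
  set N' : ℕ := max N 2 with hN'
  have hN'2 : 2 ≤ N' := le_max_right _ _
  have hxp1 : (1 : ℝ) ≤ (x : ℝ) ^ (1 - σ₁ / 4) := Real.one_le_rpow hx1R hpos1.le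
  have hN'le : (N' : ℝ) ≤ 2 * (x : ℝ) ^ (1 - σ₁ / 4) := by
    rcases le_total N 2 with h | h
    · rw [hN', max_eq_right h]; push_cast; linarith
    · rw [hN', max_eq_left h]; exact hNle
  have hN'x : (N' : ℝ) ≤ x := by
    -- `2 x^{1-σ₁/4} ≤ x^{σ₁/4} x^{1-σ₁/4} = x`
    have : (x : ℝ) ^ (σ₁ / 4) * (x : ℝ) ^ (1 - σ₁ / 4) = x := by
      rw [← Real.rpow_add hx0R]; ring_nf; exact Real.rpow_one _
    nlinarith [Real.rpow_nonneg hx0R.le (1 - σ₁ / 4)]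
  -- Step 3: enlarge the `n`-range to `Icc 1 N' = Ioc (N' - N') N'` and apply TAU
  have hmono : ∑ n ∈ Finset.Icc 1 N,
      ((((q₀ * n + a₀).toNat).divisors.card : ℕ) : ℝ) * ((((q₁ * n + a₁).toNat).divisors.card : ℕ) : ℝ) ≤
      ∑ n ∈ Finset.Ioc (N' - N') N',
      ((((q₀ * n + a₀).toNat).divisors.card : ℕ) : ℝ) * ((((q₁ * n + a₁).toNat).divisors.card : ℕ) : ℝ) := by
    refine Finset.sum_le_sum_of_subset_of_nonneg ?_ (fun _ _ _ => by positivity)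
    intro n hn
    rw [Finset.mem_Icc] at hn
    rw [Finset.mem_Ioc]
    refine ⟨by omega, hn.2.trans (le_max_left _ _)⟩
  have hτ' := hτ N' N' hN'2 le_rfl
  have hlogN' : Real.log N' ≤ Real.log x :=
    Real.log_le_log (by exact_mod_cast (show 0 < N' by omega)) hN'x
  have hlogN'0 : 0 ≤ Real.log N' := Real.log_nonneg (by exact_mod_cast (show 1 ≤ N' by omega))
  have hpowlog : Real.log N' ^ c ≤ L ^ c := by
    exact pow_le_pow_left₀ hlogN'0 (hlogN'.trans (by linarith)) c
  have hN'34 : (N' : ℝ) ^ (3 / 4 : ℝ) ≤ N' := by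
    have h1 : (1 : ℝ) ≤ N' := by exact_mod_cast (show 1 ≤ N' by omega)
    calc (N' : ℝ) ^ (3 / 4 : ℝ) ≤ (N' : ℝ) ^ (1 : ℝ) := Real.rpow_le_rpow_of_exponent_le h1 (by norm_num)
      _ = N' := Real.rpow_one _
  have hXbL : 1 + Real.log Xb ≤ 3 * L := one_add_log_le_three_mul hx1 hXb1 hXb2
  have hXbL0 : 0 ≤ 1 + Real.log Xb := by
    have : 0 ≤ Real.log Xb := Real.log_nonneg (by exact_mod_cast hXb1); linarith
  -- assemble
  have hsum : ∑ n ∈ Finset.Icc 1 N,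
      ((((q₀ * n + a₀).toNat).divisors.card : ℕ) : ℝ) * ((((q₁ * n + a₁).toNat).divisors.card : ℕ) : ℝ) ≤
      Cτ * (2 * (x : ℝ) ^ (1 - σ₁ / 4) * L ^ c + 2 * (x : ℝ) ^ (1 - σ₁ / 4)) := by
    refine hmono.trans (hτ'.trans ?_)
    refine mul_le_mul_of_nonneg_left ?_ hCτ.le
    have hxpow0 : 0 ≤ (x : ℝ) ^ (1 - σ₁ / 4) := by positivity
    have hLc0 : 0 ≤ L ^ c := by positivity
    refine add_le_add ?_ (hN'34.trans hN'le)
    calc (N' : ℝ) * Real.log N' ^ c ≤ (2 * (x : ℝ) ^ (1 - σ₁ / 4)) * L ^ c :=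
          mul_le_mul hN'le hpowlog (by positivity) (by positivity)
      _ = 2 * (x : ℝ) ^ (1 - σ₁ / 4) * L ^ c := by ring
  have hxpow0 : 0 ≤ (x : ℝ) ^ (1 - σ₁ / 4) := by positivity
  have hLc1 : 1 ≤ L ^ c := one_le_pow₀ hL1
  calc (1 + Real.log Xb) ^ 2 * ∑ n ∈ Finset.Icc 1 N,
        ((((q₀ * n + a₀).toNat).divisors.card : ℕ) : ℝ) * ((((q₁ * n + a₁).toNat).divisors.card : ℕ) : ℝ)
      ≤ (3 * L) ^ 2 * (Cτ * (2 * (x : ℝ) ^ (1 - σ₁ / 4) * L ^ c + 2 * (x : ℝ) ^ (1 - σ₁ / 4))) := by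
        refine mul_le_mul (pow_le_pow_left₀ hXbL0 hXbL 2) hsum ?_ (by positivity)
        exact Finset.sum_nonneg fun _ _ => by positivity
    _ ≤ (3 * L) ^ 2 * (Cτ * (4 * (x : ℝ) ^ (1 - σ₁ / 4) * L ^ c)) := by
        refine mul_le_mul_of_nonneg_left (mul_le_mul_of_nonneg_left ?_ hCτ.le) (by positivity)
        nlinarith [mul_nonneg hxpow0 (sub_nonneg.mpr hLc1)]
    _ = 36 * Cτ * L ^ (c + 2) * (x : ℝ) ^ (1 - σ₁ / 4) := by ring


set_option maxHeartbeats 800000 in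
/-- **The one-sided middle triple sum is `o(x)`** (pair data form). -/
theorem tripleSum_isLittleO {q₀ a₀ q₁ a₁ : ℤ} (hq₀ : 0 < q₀) (hq₁ : 0 < q₁) (hc₀ : IsCoprime q₀ a₀)
    (hc₁ : IsCoprime q₁ a₁) (hΔ : q₁ * a₀ - q₀ * a₁ ≠ 0) {σ₁ σ₂ : ℝ} (hσ₁ : 0 < σ₁) (h12 : σ₁ < σ₂)
    (hσ₂ : σ₂ < 1 / 2) :
    ∀ θ η : ℝ, 0 < θ → θ ≤ min (σ₁ / 4) (min ((1 / 2 - σ₂) / 4) (1 / 16)) →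
      0 < η → η ≤ min (σ₁ / 4) (min ((1 / 2 - σ₂) / 4) (1 / 16)) →
      (fun x : ℕ => ∑ d₀ ∈ Icc 1 ((q₀.toNat + q₁.toNat) * x + a₀.natAbs + a₁.natAbs),
        ∑ d₁ ∈ Icc 1 ((q₀.toNat + q₁.toNat) * x + a₀.natAbs + a₁.natAbs),
          ∑ m ∈ Icc 1 ((q₀.toNat + q₁.toNat) * x + a₀.natAbs + a₁.natAbs),
          (if ((d₁ : ℤ) * m - a₁) % q₁ = 0 ∧
              (1 ≤ ((d₁ : ℤ) * m - a₁) / q₁ ∧ ((d₁ : ℤ) * m - a₁) / q₁ ≤ x) ∧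
              (1 ≤ q₀ * (((d₁ : ℤ) * m - a₁) / q₁) + a₀ ∧ (d₀ : ℤ) ∣ q₀ * (((d₁ : ℤ) * m - a₁) / q₁) + a₀) ∧
              ((x : ℝ) ^ (1 - η) < (d₀ : ℝ) * d₁ ∧ (d₀ : ℝ) * d₁ ≤ (x : ℝ) ^ (1 + θ) ∧
                ((x : ℝ) ^ σ₁ < (d₀ : ℝ) ∧ (d₀ : ℝ) ≤ (x : ℝ) ^ σ₂)) then
            ((ArithmeticFunction.moebius d₀ : ℝ) * Real.log d₀) *
              ((ArithmeticFunction.moebius d₁ : ℝ) * Real.log d₁) else 0)) =o[atTop]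
      fun x : ℕ => (x : ℝ) := by
  intro θ η hθ0 hθ hη0 hη
  have hθσ : θ ≤ σ₁ / 4 := hθ.trans (min_le_left _ _)
  obtain ⟨C₁, hC₁, c₁, X₁, hsmall⟩ := small_part_le hq₀ hq₁ hσ₁ (by linarith only [h12, hσ₂])
  obtain ⟨C₂, hC₂, e, ν, hν, X₂, hbox⟩ := boxes_part_le hq₀ hq₁ hc₀ hc₁ hΔ hσ₁ h12 hσ₂
  set Bq : ℕ := q₀.toNat + q₁.toNat + a₀.natAbs + a₁.natAbs + 2 with hBq
  rw [Asymptotics.isLittleO_iff]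
  intro ε hε
  -- thresholds making each of the three error terms `≤ (ε/3) x`
  have hpos1 : 0 < σ₁ / 4 := by linarith only [hσ₁]
  have ev1 := eventually_mul_log_pow_le_rpow (3 * C₁ / ε) (c₁ + 2) hpos1
  have ev2 := eventually_mul_log_pow_le_rpow (3 * C₂ / ε) e hν
  have ev3 : ∀ᶠ x : ℕ in atTop, 3 * C₂ / ε ≤ 1 + Real.log x := by
    have := (Real.tendsto_log_atTop.comp tendsto_natCast_atTop_atTop).eventually_ge_atTop (3 * C₂ / ε)
    filter_upwards [this] with x hx
    simp only [Function.comp] at hx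
    linarith only [hx]
  filter_upwards [eventually_ge_atTop X₁, eventually_ge_atTop X₂, eventually_ge_atTop 1,
    eventually_const_le_natCast (Bq : ℝ), ev1, ev2, ev3] with x hX₁ hX₂ hx1 hxB h1 h2 h3
  have hx1R : (1 : ℝ) ≤ x := by exact_mod_cast hx1
  have hx0R : (0 : ℝ) < x := by linarith only [hx1R]
  set L : ℝ := 1 + Real.log x with hL
  have hL1 : 1 ≤ L := by
    have : 0 ≤ Real.log x := Real.log_nonneg hx1R
    rw [hL]; linarith only [this]
  have hL0 : 0 < L := by linarith only [hL1]
  set Xb : ℕ := (q₀.toNat + q₁.toNat) * x + a₀.natAbs + a₁.natAbs with hXb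
  have hq : 1 ≤ q₀.toNat + q₁.toNat := by omega
  have hXb1 : 1 ≤ Xb := by
    have : 1 ≤ (q₀.toNat + q₁.toNat) * x := Nat.one_le_iff_ne_zero.mpr (Nat.mul_ne_zero (by omega) (by omega))
    omega
  have hxXb : x ≤ Xb := by
    have : x ≤ (q₀.toNat + q₁.toNat) * x := Nat.le_mul_of_pos_left x (by omega)
    omega
  have hXbx2 : (Xb : ℝ) ≤ (x : ℝ) ^ 2 := by
    have hBqR : (Bq : ℝ) = (q₀.toNat : ℝ) + q₁.toNat + a₀.natAbs + a₁.natAbs + 2 := by rw [hBq]; push_cast; ring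
    have hXbR : (Xb : ℝ) = ((q₀.toNat : ℝ) + q₁.toNat) * x + a₀.natAbs + a₁.natAbs := by rw [hXb]; push_cast; ring
    rw [hXbR]
    have hB : (Bq : ℝ) ≤ x := hxB
    rw [hBqR] at hB
    have ha : (0 : ℝ) ≤ a₀.natAbs := Nat.cast_nonneg _
    have hb : (0 : ℝ) ≤ a₁.natAbs := Nat.cast_nonneg _
    have h1 : ((q₀.toNat : ℝ) + q₁.toNat) * x ≤ ((x : ℝ) - a₀.natAbs - a₁.natAbs - 2) * x :=
      mul_le_mul_of_nonneg_right (by linarith only [hB]) hx0R.le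
    nlinarith only [h1, ha, hb, hx1R]
  have hXbx2' : (Xb : ℝ) ≤ (x : ℝ) ^ (2 : ℝ) := by rw [Real.rpow_two]; exact hXbx2
  -- `M₀ ≤ Xb`
  set M₀ : ℕ := ⌊(x : ℝ) ^ (σ₁ / 2)⌋₊ with hM₀
  have hM₀Xb : M₀ ≤ Xb := by
    have h1 : (M₀ : ℝ) ≤ (x : ℝ) ^ (σ₁ / 2) := Nat.floor_le (by positivity)
    have h2 : (x : ℝ) ^ (σ₁ / 2) ≤ x := by
      calc (x : ℝ) ^ (σ₁ / 2) ≤ (x : ℝ) ^ (1 : ℝ) :=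
            Real.rpow_le_rpow_of_exponent_le hx1R (by linarith only [h12, hσ₂, hσ₁])
        _ = x := Real.rpow_one _
    have : M₀ ≤ x := by exact_mod_cast h1.trans h2
    exact this.trans hxXb
  -- split the `m`-sum
  rw [Finset.sum_congr rfl fun d₀ _ => Finset.sum_congr rfl fun d₁ _ => sum_Icc_one_eq_add hM₀Xb _]
  simp only [Finset.sum_add_distrib]
  have hS := hsmall x Xb σ₂ θ η hX₁ hθσ hXb1 hXbx2
  have hB := hbox x θ η hX₂ hθ0 hθ hη0 hη
  -- the three error terms are each `≤ (ε/3) x`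
  have hε3 : 0 < ε / 3 := by linarith only [hε]
  have hT1 : C₁ * L ^ (c₁ + 2) * (x : ℝ) ^ (1 - σ₁ / 4) ≤ ε / 3 * x := by
    -- `(3C₁/ε) L^{c₁+2} ≤ x^{σ₁/4}` ⟹ `C₁ L^{c₁+2} x^{1-σ₁/4} ≤ (ε/3) x`
    have hx1 : (x : ℝ) ^ (1 - σ₁ / 4) * (x : ℝ) ^ (σ₁ / 4) = x := by
      rw [← Real.rpow_add hx0R]; norm_num
    have hp : 0 ≤ (x : ℝ) ^ (1 - σ₁ / 4) := by positivity
    have h4 : C₁ * L ^ (c₁ + 2) ≤ ε / 3 * (x : ℝ) ^ (σ₁ / 4) := by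
      have := h1
      rw [div_mul_eq_mul_div, div_le_iff₀ hε] at this
      nlinarith only [this, hε]
    calc C₁ * L ^ (c₁ + 2) * (x : ℝ) ^ (1 - σ₁ / 4) ≤ ε / 3 * (x : ℝ) ^ (σ₁ / 4) * (x : ℝ) ^ (1 - σ₁ / 4) :=
          mul_le_mul_of_nonneg_right h4 hp
      _ = ε / 3 * x := by rw [mul_assoc, mul_comm ((x : ℝ) ^ (σ₁ / 4)), hx1]
  have hT2 : C₂ * (L ^ e * (x : ℝ) ^ (1 - ν)) ≤ ε / 3 * x := by
    have hx1 : (x : ℝ) ^ (1 - ν) * (x : ℝ) ^ ν = x := by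
      rw [← Real.rpow_add hx0R]; norm_num
    have hp : 0 ≤ (x : ℝ) ^ (1 - ν) := by positivity
    have h4 : C₂ * L ^ e ≤ ε / 3 * (x : ℝ) ^ ν := by
      have := h2
      rw [div_mul_eq_mul_div, div_le_iff₀ hε] at this
      nlinarith only [this, hε]
    calc C₂ * (L ^ e * (x : ℝ) ^ (1 - ν)) = C₂ * L ^ e * (x : ℝ) ^ (1 - ν) := by ring
      _ ≤ ε / 3 * (x : ℝ) ^ ν * (x : ℝ) ^ (1 - ν) := mul_le_mul_of_nonneg_right h4 hp
      _ = ε / 3 * x := by rw [mul_assoc, mul_comm ((x : ℝ) ^ ν), hx1]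
  have hT3 : C₂ * ((x : ℝ) / L) ≤ ε / 3 * x := by
    rw [mul_div_assoc', div_le_iff₀ hL0]
    have h4 : 3 * C₂ ≤ ε * L := by
      have := h3; rw [div_le_iff₀ hε] at this; linarith only [this]
    nlinarith only [h4, hx0R]
  have hB' : C₂ * ((x : ℝ) / (1 + Real.log x) + (1 + Real.log x) ^ e * (x : ℝ) ^ (1 - ν)) ≤ ε / 3 * x + ε / 3 * x := by
    rw [← hL, mul_add]; exact add_le_add hT3 hT2
  rw [Real.norm_of_nonneg (Nat.cast_nonneg x)]
  calc ‖(∑ d₀ ∈ Icc 1 Xb, ∑ d₁ ∈ Icc 1 Xb, ∑ m ∈ Icc 1 M₀, _) + (∑ d₀ ∈ Icc 1 Xb, ∑ d₁ ∈ Icc 1 Xb, ∑ m ∈ Ioc M₀ Xb, _)‖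
      ≤ |∑ d₀ ∈ Icc 1 Xb, ∑ d₁ ∈ Icc 1 Xb, ∑ m ∈ Icc 1 M₀, _| + |∑ d₀ ∈ Icc 1 Xb, ∑ d₁ ∈ Icc 1 Xb, ∑ m ∈ Ioc M₀ Xb, _| := by
        rw [Real.norm_eq_abs]; exact abs_add_le _ _
    _ ≤ C₁ * (1 + Real.log x) ^ (c₁ + 2) * (x : ℝ) ^ (1 - σ₁ / 4) +
        C₂ * ((x : ℝ) / (1 + Real.log x) + (1 + Real.log x) ^ e * (x : ℝ) ^ (1 - ν)) := add_le_add hS hB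
    _ ≤ ε / 3 * x + (ε / 3 * x + ε / 3 * x) := by rw [← hL] at hB' ⊢; exact add_le_add hT1 hB'
    _ = ε * x := by ring

/-! ## (E1) From the pair `f` to pair data -/

/-- A polynomial of degree one evaluates as `lc · n + c₀`. -/
theorem eval_eq_of_natDegree_eq_one (g : ℤ[X]) (h : g.natDegree = 1) (n : ℤ) :
    g.eval n = g.leadingCoeff * n + g.coeff 0 := by
  have h2 : g.eval n = ∑ i ∈ Finset.range (g.natDegree + 1), g.coeff i * n ^ i :=
    Polynomial.eval_eq_sum_range n
  rw [h2, h, Finset.sum_range_succ, Finset.sum_range_succ, Finset.sum_range_zero]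
  have hlc : g.leadingCoeff = g.coeff 1 := by rw [Polynomial.leadingCoeff, h]
  rw [hlc]; ring

/-- Sums over `Fintype.piFinset` on `Fin 2` are iterated sums. -/
theorem sum_piFinset_fin_two (t : Fin 2 → Finset ℕ) (g : (Fin 2 → ℕ) → ℝ) :
    ∑ d ∈ Fintype.piFinset t, g d = ∑ a ∈ t 0, ∑ b ∈ t 1, g ![a, b] := by
  rw [← Finset.sum_product']
  refine Finset.sum_nbij' (fun d => (d 0, d 1)) (fun p => ![p.1, p.2]) ?_ ?_ ?_ ?_ ?_
  · intro d hd
    rw [Fintype.mem_piFinset] at hd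
    exact Finset.mem_product.mpr ⟨hd 0, hd 1⟩
  · intro p hp
    rw [Finset.mem_product] at hp
    rw [Fintype.mem_piFinset]
    intro i
    fin_cases i
    · exact hp.1
    · exact hp.2
  · intro d _
    funext i
    fin_cases i <;> rfl
  · intro p _
    rfl
  · intro d _
    congr 1
    funext i
    fin_cases i <;> rfl

/-- The divisors of `v⁺` (for an integer `v ≤ Xb`) as an indicator over `1 ≤ d ≤ Xb`. -/
theorem sum_divisors_toNat_eq (v : ℤ) (Xb : ℕ) (hv : v ≤ Xb) (h : ℕ → ℝ) :
    ∑ d ∈ (v.toNat).divisors, h d =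
      ∑ d ∈ Finset.Icc 1 Xb, if (1 ≤ v ∧ (d : ℤ) ∣ v) then h d else 0 := by
  rw [← Finset.sum_filter]
  refine Finset.sum_congr ?_ fun _ _ => rfl
  ext d
  rw [Nat.mem_divisors, Finset.mem_filter, Finset.mem_Icc]
  constructor
  · rintro ⟨hd, hv0⟩
    have hvpos : 0 < v.toNat := Nat.pos_of_ne_zero hv0
    have hv1 : 1 ≤ v := by
      have := Int.toNat_of_nonneg (Int.lt_toNat.mp (by simpa using hvpos)).le
      omega
    have hvn : (v.toNat : ℤ) = v := Int.toNat_of_nonneg (by omega)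
    have hdpos : 0 < d := Nat.pos_of_dvd_of_pos hd hvpos
    have hdle : d ≤ v.toNat := Nat.le_of_dvd hvpos hd
    refine ⟨⟨hdpos, ?_⟩, hv1, ?_⟩
    · have : (d : ℤ) ≤ Xb := by
        calc (d : ℤ) ≤ v.toNat := by exact_mod_cast hdle
          _ = v := hvn
          _ ≤ Xb := hv
      exact_mod_cast this
    · rw [← hvn]; exact_mod_cast hd
  · rintro ⟨⟨hd1, -⟩, hv1, hdv⟩
    have hvn : (v.toNat : ℤ) = v := Int.toNat_of_nonneg (by omega)
    refine ⟨?_, ?_⟩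
    · rw [← hvn] at hdv; exact_mod_cast hdv
    · have : 0 < v.toNat := by
        have : (0 : ℤ) < v.toNat := by rw [hvn]; omega
        exact_mod_cast this
      exact this.ne'

/-- Reparametrising `n ≤ x` with `d₁ ∣ q₁n + a₁ ≥ 1` by the cofactor `m = (q₁n + a₁)/d₁`. -/
theorem sum_Icc_reparam (q₁ a₁ : ℤ) (hq₁ : 0 < q₁) (d₁ : ℕ) (hd₁ : 0 < d₁) (x Xb : ℕ)
    (hXb : q₁ * x + a₁ ≤ Xb) (H : ℤ → ℝ) :
    ∑ n ∈ Finset.Icc 1 x, (if 1 ≤ q₁ * n + a₁ ∧ (d₁ : ℤ) ∣ q₁ * n + a₁ then H n else 0) =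
    ∑ m ∈ Finset.Icc 1 Xb, (if ((d₁ : ℤ) * m - a₁) % q₁ = 0 ∧
        (1 ≤ ((d₁ : ℤ) * m - a₁) / q₁ ∧ ((d₁ : ℤ) * m - a₁) / q₁ ≤ x)
        then H (((d₁ : ℤ) * m - a₁) / q₁) else 0) := by
  rw [← Finset.sum_filter, ← Finset.sum_filter]
  have hd₁z : (0 : ℤ) < d₁ := by exact_mod_cast hd₁
  refine Finset.sum_nbij' (fun n : ℕ => ((q₁ * n + a₁) / d₁).toNat)
    (fun m : ℕ => (((d₁ : ℤ) * m - a₁) / q₁).toNat) ?_ ?_ ?_ ?_ ?_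
  · -- maps into the target
    intro n hn
    rw [Finset.mem_filter, Finset.mem_Icc] at hn ⊢
    obtain ⟨⟨hn1, hnx⟩, hv1, hdv⟩ := hn
    obtain ⟨k, hk⟩ := hdv
    have hk1 : 1 ≤ k := by
      by_contra h
      push Not at h
      have : (d₁ : ℤ) * k ≤ 0 := by nlinarith
      omega
    have hkdef : (q₁ * n + a₁) / d₁ = k := by
      rw [hk, Int.mul_ediv_cancel_left _ hd₁z.ne']
    rw [hkdef]
    have hkle : k ≤ Xb := by
      have h1 : (d₁ : ℤ) * k ≤ q₁ * x + a₁ := by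
        rw [← hk]; have : (n : ℤ) ≤ x := by exact_mod_cast hnx
        nlinarith
      have h2 : k ≤ (d₁ : ℤ) * k := by nlinarith
      omega
    have hkk : ((k.toNat : ℕ) : ℤ) = k := Int.toNat_of_nonneg (by omega)
    refine ⟨⟨by omega, by omega⟩, ?_⟩
    rw [hkk, show (d₁ : ℤ) * k - a₁ = q₁ * n by rw [← hk]; ring, Int.mul_emod_right,
      Int.mul_ediv_cancel_left _ hq₁.ne']
    exact ⟨rfl, by exact_mod_cast hn1, by exact_mod_cast hnx⟩
  · intro m hm
    rw [Finset.mem_filter, Finset.mem_Icc] at hm ⊢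
    obtain ⟨⟨hm1, hmX⟩, hmod, hn1, hnx⟩ := hm
    set nn : ℤ := ((d₁ : ℤ) * m - a₁) / q₁ with hnn
    have hq : q₁ * nn = (d₁ : ℤ) * m - a₁ := Int.mul_ediv_cancel' (Int.dvd_of_emod_eq_zero hmod)
    have hnnn : ((nn.toNat : ℕ) : ℤ) = nn := Int.toNat_of_nonneg (by omega)
    refine ⟨⟨by omega, by omega⟩, ?_, ?_⟩
    · rw [hnnn, hq]
      have : (1 : ℤ) ≤ (d₁ : ℤ) * m := by
        have h1 : (1 : ℤ) ≤ d₁ := by exact_mod_cast hd₁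
        have h2 : (1 : ℤ) ≤ m := by exact_mod_cast hm1
        nlinarith
      omega
    · rw [hnnn, hq]
      exact ⟨m, by ring⟩
  · -- left inverse
    intro n hn
    rw [Finset.mem_filter, Finset.mem_Icc] at hn
    obtain ⟨⟨hn1, hnx⟩, hv1, hdv⟩ := hn
    obtain ⟨k, hk⟩ := hdv
    have hk0 : 0 ≤ k := by nlinarith
    have hkdef : (q₁ * n + a₁) / d₁ = k := by
      rw [hk, Int.mul_ediv_cancel_left _ hd₁z.ne']
    simp only [hkdef, Int.toNat_of_nonneg hk0]
    rw [show (d₁ : ℤ) * k - a₁ = q₁ * n by rw [← hk]; ring, Int.mul_ediv_cancel_left _ hq₁.ne']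
    exact Int.toNat_natCast n
  · -- right inverse
    intro m hm
    rw [Finset.mem_filter, Finset.mem_Icc] at hm
    obtain ⟨⟨hm1, hmX⟩, hmod, hn1, hnx⟩ := hm
    set nn : ℤ := ((d₁ : ℤ) * m - a₁) / q₁ with hnn
    have hq : q₁ * nn = (d₁ : ℤ) * m - a₁ := Int.mul_ediv_cancel' (Int.dvd_of_emod_eq_zero hmod)
    simp only [Int.toNat_of_nonneg (show (0 : ℤ) ≤ nn by omega)]
    rw [show q₁ * nn + a₁ = (d₁ : ℤ) * m by rw [hq]; ring, Int.mul_ediv_cancel_left _ hd₁z.ne']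
    exact Int.toNat_natCast m
  · -- values agree
    intro n hn
    rw [Finset.mem_filter, Finset.mem_Icc] at hn
    obtain ⟨⟨hn1, hnx⟩, hv1, hdv⟩ := hn
    obtain ⟨k, hk⟩ := hdv
    have hk0 : 0 ≤ k := by nlinarith
    have hkdef : (q₁ * n + a₁) / d₁ = k := by
      rw [hk, Int.mul_ediv_cancel_left _ hd₁z.ne']
    simp only [hkdef, Int.toNat_of_nonneg hk0]
    rw [show (d₁ : ℤ) * k - a₁ = q₁ * n by rw [← hk]; ring, Int.mul_ediv_cancel_left _ hq₁.ne']

/-- **O1 (reparametrisation).** For a pair of degree-one polynomials `fᵢ = qᵢ X + aᵢ` with `qᵢ ≥ 1`, and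
`Xb` at least `max(q₀,q₁)·x + |a₀| + |a₁|`, the one-sided middle sum equals the `(d₀,d₁,m)` triple sum. -/
theorem oneSided_eq_tripleSum (f : Fin 2 → ℤ[X]) (hdeg : ∀ i, (f i).natDegree = 1)
    (hq : ∀ i, 0 < (f i).leadingCoeff) (σ₁ σ₂ θ η : ℝ) (x Xb : ℕ)
    (hXb : ((f 0).leadingCoeff.toNat + (f 1).leadingCoeff.toNat) * x + ((f 0).coeff 0).natAbs +
      ((f 1).coeff 0).natAbs ≤ Xb) :
    (∑ n ∈ Finset.Icc 1 x, ∑ d ∈ Fintype.piFinset (fun i => (((f i).eval (n : ℤ)).toNat).divisors),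
      if (x : ℝ) ^ (1 - η) < ∏ i, (d i : ℝ) ∧ ∏ i, (d i : ℝ) ≤ (x : ℝ) ^ (1 + θ) ∧
          ((x : ℝ) ^ σ₁ < (d 0 : ℝ) ∧ (d 0 : ℝ) ≤ (x : ℝ) ^ σ₂) then
        (∏ i, ((ArithmeticFunction.moebius (d i) : ℝ) * Real.log (d i))) else 0) =
    (∑ d₀ ∈ Finset.Icc 1 Xb, ∑ d₁ ∈ Finset.Icc 1 Xb, ∑ m ∈ Finset.Icc 1 Xb,
      if ((d₁ : ℤ) * m - ((f 1).coeff 0)) % (f 1).leadingCoeff = 0 ∧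
          (1 ≤ ((d₁ : ℤ) * m - ((f 1).coeff 0)) / (f 1).leadingCoeff ∧ ((d₁ : ℤ) * m - ((f 1).coeff 0)) / (f 1).leadingCoeff ≤ x) ∧
          (1 ≤ (f 0).leadingCoeff * (((d₁ : ℤ) * m - ((f 1).coeff 0)) / (f 1).leadingCoeff) + ((f 0).coeff 0) ∧ (d₀ : ℤ) ∣ (f 0).leadingCoeff * (((d₁ : ℤ) * m - ((f 1).coeff 0)) / (f 1).leadingCoeff) + ((f 0).coeff 0)) ∧
          ((x : ℝ) ^ (1 - η) < (d₀ : ℝ) * d₁ ∧ (d₀ : ℝ) * d₁ ≤ (x : ℝ) ^ (1 + θ) ∧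
            ((x : ℝ) ^ σ₁ < (d₀ : ℝ) ∧ (d₀ : ℝ) ≤ (x : ℝ) ^ σ₂)) then
        ((ArithmeticFunction.moebius d₀ : ℝ) * Real.log d₀) * ((ArithmeticFunction.moebius d₁ : ℝ) * Real.log d₁)
      else 0) := by
  set q₀ : ℤ := (f 0).leadingCoeff with hq₀
  set a₀ : ℤ := (f 0).coeff 0 with ha₀
  set q₁ : ℤ := (f 1).leadingCoeff with hq₁
  set a₁ : ℤ := (f 1).coeff 0 with ha₁
  have hq₀p : 0 < q₀ := hq 0
  have hq₁p : 0 < q₁ := hq 1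
  have hev0 : ∀ n : ℤ, (f 0).eval n = q₀ * n + a₀ := eval_eq_of_natDegree_eq_one _ (hdeg 0)
  have hev1 : ∀ n : ℤ, (f 1).eval n = q₁ * n + a₁ := eval_eq_of_natDegree_eq_one _ (hdeg 1)
  -- size bounds: `qᵢ n + aᵢ ≤ Xb` for `n ≤ x`
  have hXb' : ∀ n : ℕ, n ≤ x → q₀ * n + a₀ ≤ Xb ∧ q₁ * n + a₁ ≤ Xb := by
    intro n hn
    have hX : (((q₀.toNat + q₁.toNat) * x + a₀.natAbs + a₁.natAbs : ℕ) : ℤ) ≤ Xb := by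
      exact_mod_cast hXb
    push_cast at hX
    have e0 : (q₀.toNat : ℤ) = q₀ := Int.toNat_of_nonneg hq₀p.le
    have e1 : (q₁.toNat : ℤ) = q₁ := Int.toNat_of_nonneg hq₁p.le
    rw [e0, e1] at hX
    have hn' : (n : ℤ) ≤ x := by exact_mod_cast hn
    have ha0 : a₀ ≤ |a₀| := le_abs_self _
    have ha1 : a₁ ≤ |a₁| := le_abs_self _
    have ha0' : 0 ≤ |a₀| := abs_nonneg _
    have ha1' : 0 ≤ |a₁| := abs_nonneg _
    have h0x : (0 : ℤ) ≤ x := by positivity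
    have m0 : q₀ * (n : ℤ) ≤ q₀ * x := mul_le_mul_of_nonneg_left hn' hq₀p.le
    have m1 : q₁ * (n : ℤ) ≤ q₁ * x := mul_le_mul_of_nonneg_left hn' hq₁p.le
    have m2 : 0 ≤ q₀ * (x : ℤ) := mul_nonneg hq₀p.le h0x
    have m3 : 0 ≤ q₁ * (x : ℤ) := mul_nonneg hq₁p.le h0x
    constructor <;> nlinarith
  -- the weight of `![a, b]`
  have hw : ∀ a b : ℕ, (∏ i, ((ArithmeticFunction.moebius ((![a, b] : Fin 2 → ℕ) i) : ℝ) * Real.log ((![a, b] : Fin 2 → ℕ) i))) =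
      ((ArithmeticFunction.moebius a : ℝ) * Real.log a) * ((ArithmeticFunction.moebius b : ℝ) * Real.log b) := by
    intro a b
    simp [Fin.prod_univ_two]
  have hprod : ∀ a b : ℕ, (∏ i, ((![a, b] : Fin 2 → ℕ) i : ℝ)) = (a : ℝ) * b := by
    intro a b
    simp [Fin.prod_univ_two]
  -- Step 1: `piFinset` over `Fin 2` as an iterated sum; Step 2: divisor sums as indicators
  have step : ∀ n ∈ Finset.Icc 1 x,
      (∑ d ∈ Fintype.piFinset (fun i => (((f i).eval (n : ℤ)).toNat).divisors),
        if (x : ℝ) ^ (1 - η) < ∏ i, (d i : ℝ) ∧ ∏ i, (d i : ℝ) ≤ (x : ℝ) ^ (1 + θ) ∧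
            ((x : ℝ) ^ σ₁ < (d 0 : ℝ) ∧ (d 0 : ℝ) ≤ (x : ℝ) ^ σ₂) then
            (∏ i, ((ArithmeticFunction.moebius (d i) : ℝ) * Real.log (d i))) else 0) =
      ∑ d₀ ∈ Finset.Icc 1 Xb, ∑ d₁ ∈ Finset.Icc 1 Xb,
        if 1 ≤ q₁ * n + a₁ ∧ (d₁ : ℤ) ∣ q₁ * n + a₁ then
          (if 1 ≤ q₀ * n + a₀ ∧ (d₀ : ℤ) ∣ q₀ * n + a₀ then
            (if (x : ℝ) ^ (1 - η) < (d₀ : ℝ) * d₁ ∧ (d₀ : ℝ) * d₁ ≤ (x : ℝ) ^ (1 + θ) ∧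
                ((x : ℝ) ^ σ₁ < (d₀ : ℝ) ∧ (d₀ : ℝ) ≤ (x : ℝ) ^ σ₂) then
              ((ArithmeticFunction.moebius d₀ : ℝ) * Real.log d₀) *
                ((ArithmeticFunction.moebius d₁ : ℝ) * Real.log d₁) else 0) else 0) else 0 := by
    intro n hn
    have hnx : n ≤ x := (Finset.mem_Icc.mp hn).2
    rw [sum_piFinset_fin_two]
    simp only [Fin.isValue, Matrix.cons_val_zero, hprod, hw]
    rw [hev0, hev1]
    rw [sum_divisors_toNat_eq (q₀ * n + a₀) Xb (hXb' n hnx).1]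
    refine Finset.sum_congr rfl fun d₀ _ => ?_
    by_cases h0 : 1 ≤ q₀ * (n : ℤ) + a₀ ∧ (d₀ : ℤ) ∣ q₀ * (n : ℤ) + a₀
    · rw [if_pos h0, sum_divisors_toNat_eq (q₁ * n + a₁) Xb (hXb' n hnx).2]
      refine Finset.sum_congr rfl fun d₁ _ => ?_
      by_cases h1 : 1 ≤ q₁ * (n : ℤ) + a₁ ∧ (d₁ : ℤ) ∣ q₁ * (n : ℤ) + a₁
      · rw [if_pos h1, if_pos h1, if_pos h0]
      · rw [if_neg h1, if_neg h1]
    · rw [if_neg h0]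
      symm
      refine Finset.sum_eq_zero fun d₁ _ => ?_
      rw [if_neg h0]
      split_ifs <;> rfl
  rw [Finset.sum_congr rfl step]
  -- Step 3: bring `n` inside
  rw [Finset.sum_comm]
  refine Finset.sum_congr rfl fun d₀ hd₀ => ?_
  rw [Finset.sum_comm]
  refine Finset.sum_congr rfl fun d₁ hd₁ => ?_
  have hd₁pos : 0 < d₁ := (Finset.mem_Icc.mp hd₁).1
  -- Step 4: reparametrise `n ↦ m = (q₁ n + a₁)/d₁`
  have hXb1 : q₁ * x + a₁ ≤ Xb := (hXb' x le_rfl).2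
  rw [sum_Icc_reparam q₁ a₁ hq₁p d₁ hd₁pos x Xb hXb1 (fun z : ℤ =>
    if 1 ≤ q₀ * z + a₀ ∧ (d₀ : ℤ) ∣ q₀ * z + a₀ then
      (if (x : ℝ) ^ (1 - η) < (d₀ : ℝ) * d₁ ∧ (d₀ : ℝ) * d₁ ≤ (x : ℝ) ^ (1 + θ) ∧
          ((x : ℝ) ^ σ₁ < (d₀ : ℝ) ∧ (d₀ : ℝ) ≤ (x : ℝ) ^ σ₂) then
        ((ArithmeticFunction.moebius d₀ : ℝ) * Real.log d₀) *
          ((ArithmeticFunction.moebius d₁ : ℝ) * Real.log d₁) else 0) else 0)]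
  refine Finset.sum_congr rfl fun m _ => ?_
  simp only [← ite_and, and_assoc]



end MiddleAssembly


/-! ## (E2) The registered stub -/

open Literature.NumberTheory.Sieve

/-- **Piece (swap).** The mirrored one-sided sum (conditions on `d 1`) of `f` is the one-sided sum of
`f ∘ Equiv.swap 0 1`. -/
theorem piece_swap (f : Fin 2 → ℤ[X]) (σ₁ σ₂ θ η : ℝ) (x : ℕ) :
    (∑ n ∈ Finset.Icc 1 x, ∑ d ∈ Fintype.piFinset (fun i => (((f i).eval (n : ℤ)).toNat).divisors),
      if (x : ℝ) ^ (1 - η) < ∏ i, (d i : ℝ) ∧ ∏ i, (d i : ℝ) ≤ (x : ℝ) ^ (1 + θ) ∧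
          ((x : ℝ) ^ σ₁ < (d 1 : ℝ) ∧ (d 1 : ℝ) ≤ (x : ℝ) ^ σ₂) then
          (∏ i, ((ArithmeticFunction.moebius (d i) : ℝ) * Real.log (d i))) else 0) =
    (∑ n ∈ Finset.Icc 1 x, ∑ d ∈ Fintype.piFinset (fun i => ((((f ∘ Equiv.swap (0 : Fin 2) 1) i).eval (n : ℤ)).toNat).divisors),
      if (x : ℝ) ^ (1 - η) < ∏ i, (d i : ℝ) ∧ ∏ i, (d i : ℝ) ≤ (x : ℝ) ^ (1 + θ) ∧
          ((x : ℝ) ^ σ₁ < (d 0 : ℝ) ∧ (d 0 : ℝ) ≤ (x : ℝ) ^ σ₂) then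
        (∏ i, ((ArithmeticFunction.moebius (d i) : ℝ) * Real.log (d i))) else 0) := by
  refine Finset.sum_congr rfl fun n _ => ?_
  set e : Equiv.Perm (Fin 2) := Equiv.swap (0 : Fin 2) 1 with he
  set t : Fin 2 → Finset ℕ := fun i => (((f i).eval (n : ℤ)).toNat).divisors with ht
  have hmem : ∀ d : Fin 2 → ℕ, d ∈ Fintype.piFinset t →
      (d ∘ e) ∈ Fintype.piFinset (fun i => ((((f ∘ e) i).eval (n : ℤ)).toNat).divisors) := by
    intro d hd
    rw [Fintype.mem_piFinset] at hd ⊢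
    intro i
    exact hd (e i)
  have hmem' : ∀ d : Fin 2 → ℕ, d ∈ Fintype.piFinset (fun i => ((((f ∘ e) i).eval (n : ℤ)).toNat).divisors) →
      (d ∘ e) ∈ Fintype.piFinset t := by
    intro d hd
    rw [Fintype.mem_piFinset] at hd ⊢
    intro i
    have := hd (e i)
    simpa [ht, he, Function.comp, Equiv.swap_apply_self] using this
  have hinv : ∀ d : Fin 2 → ℕ, (d ∘ e) ∘ e = d := by
    intro d; funext i; simp [he, Function.comp, Equiv.swap_apply_self]
  refine Finset.sum_nbij' (fun d => d ∘ e) (fun d => d ∘ e) hmem hmem' (fun d _ => hinv d)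
    (fun d _ => hinv d) ?_
  intro d _
  have hprod : ∏ i, ((d ∘ e) i : ℝ) = ∏ i, (d i : ℝ) := Equiv.prod_comp e (fun i => (d i : ℝ))
  have hw : (∏ i, ((ArithmeticFunction.moebius ((d ∘ e) i) : ℝ) * Real.log ((d ∘ e) i))) =
      (∏ i, ((ArithmeticFunction.moebius (d i) : ℝ) * Real.log (d i))) :=
    Equiv.prod_comp e (fun i => ((ArithmeticFunction.moebius (d i) : ℝ) * Real.log (d i)))
  have h0 : (d ∘ e) 0 = d 1 := by simp [he]
  rw [hprod, hw, h0]


/-- `IsBatemanHornSystem` is invariant under reindexing by the swap of `Fin 2`. -/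
theorem isBatemanHornSystem_swap {f : Fin 2 → ℤ[X]} (hf : IsBatemanHornSystem f) :
    IsBatemanHornSystem (f ∘ Equiv.swap (0 : Fin 2) 1) := by
  set e : Equiv.Perm (Fin 2) := Equiv.swap (0 : Fin 2) 1 with he
  refine ⟨fun i => hf.irreducible (e i), fun i => hf.leadingCoeff_pos (e i),
    fun i j hij => hf.pairwise_not_associated (e.injective.ne hij), ?_⟩
  intro p hp
  have hcount : polyRootCountMod (f ∘ e) p = polyRootCountMod f p := by
    unfold polyRootCountMod
    congr 1
    refine Finset.filter_congr fun m _ => ?_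
    rw [show (∏ i, ((f ∘ e) i).eval (m : ℤ)) = ∏ i, (f i).eval (m : ℤ) from
      Equiv.prod_comp e (fun i => (f i).eval (m : ℤ))]
  rw [hcount]
  exact hf.hasNoFixedPrimeDivisor p hp


/-- **Piece (min split), pointwise.** For `1 ≤ x`, `η < 1 − 2σ₂` and a divisor pair `d` INSIDE the window
`x^{1-η} < d₀d₁`, the condition `x^{σ₁} < min(d₀,d₁) ≤ x^{σ₂}` is the disjoint disjunction of
`x^{σ₁} < d₀ ≤ x^{σ₂}` and `x^{σ₁} < d₁ ≤ x^{σ₂}`. -/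
theorem piece_min_split {x : ℕ} (hx : (1 : ℝ) ≤ x) {σ₁ σ₂ η : ℝ} (hη : η ≤ 1 - 2 * σ₂)
    (d : Fin 2 → ℕ) (hwin : (x : ℝ) ^ (1 - η) < ∏ i, (d i : ℝ)) (w : ℝ) :
    (if (x : ℝ) ^ σ₁ < ((min (d 0) (d 1) : ℕ) : ℝ) ∧ ((min (d 0) (d 1) : ℕ) : ℝ) ≤ (x : ℝ) ^ σ₂ then w else 0) =
      (if (x : ℝ) ^ σ₁ < (d 0 : ℝ) ∧ (d 0 : ℝ) ≤ (x : ℝ) ^ σ₂ then w else 0) +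
      (if (x : ℝ) ^ σ₁ < (d 1 : ℝ) ∧ (d 1 : ℝ) ≤ (x : ℝ) ^ σ₂ then w else 0) := by
  have hprod : ∏ i, (d i : ℝ) = (d 0 : ℝ) * (d 1 : ℝ) := Fin.prod_univ_two _
  rw [hprod] at hwin
  have hx0 : (0 : ℝ) < x := by linarith
  -- not both `d 0 ≤ x^{σ₂}` and `d 1 ≤ x^{σ₂}` (else `d₀d₁ ≤ x^{2σ₂} ≤ x^{1-η}`)
  have hnot : ¬ ((d 0 : ℝ) ≤ (x : ℝ) ^ σ₂ ∧ (d 1 : ℝ) ≤ (x : ℝ) ^ σ₂) := by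
    rintro ⟨h0, h1⟩
    have hle : (d 0 : ℝ) * (d 1 : ℝ) ≤ (x : ℝ) ^ σ₂ * (x : ℝ) ^ σ₂ :=
      mul_le_mul h0 h1 (by positivity) (by positivity)
    have hpow : (x : ℝ) ^ σ₂ * (x : ℝ) ^ σ₂ ≤ (x : ℝ) ^ (1 - η) := by
      rw [← Real.rpow_add hx0]
      exact Real.rpow_le_rpow_of_exponent_le hx (by linarith)
    linarith
  have hmin : ((min (d 0) (d 1) : ℕ) : ℝ) = min (d 0 : ℝ) (d 1 : ℝ) := Nat.cast_min _ _
  rw [hmin]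
  by_cases hA : (x : ℝ) ^ σ₁ < (d 0 : ℝ) ∧ (d 0 : ℝ) ≤ (x : ℝ) ^ σ₂
  · -- then `d 0 ≤ d 1`, the min is `d 0`, and `B` fails
    have h01 : (d 0 : ℝ) ≤ (d 1 : ℝ) := by
      by_contra h
      push Not at h
      exact hnot ⟨hA.2, h.le.trans hA.2⟩
    have hB : ¬ ((x : ℝ) ^ σ₁ < (d 1 : ℝ) ∧ (d 1 : ℝ) ≤ (x : ℝ) ^ σ₂) := fun h => hnot ⟨hA.2, h.2⟩
    rw [min_eq_left h01, if_pos hA, if_neg hB, add_zero]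
  · by_cases hB : (x : ℝ) ^ σ₁ < (d 1 : ℝ) ∧ (d 1 : ℝ) ≤ (x : ℝ) ^ σ₂
    · have h10 : (d 1 : ℝ) ≤ (d 0 : ℝ) := by
        by_contra h
        push Not at h
        exact hnot ⟨h.le.trans hB.2, hB.2⟩
      rw [min_eq_right h10, if_pos hB, if_neg hA, zero_add]
    · have hL : ¬ ((x : ℝ) ^ σ₁ < min (d 0 : ℝ) (d 1 : ℝ) ∧ min (d 0 : ℝ) (d 1 : ℝ) ≤ (x : ℝ) ^ σ₂) := by
        intro h
        rcases le_total (d 0 : ℝ) (d 1 : ℝ) with h01 | h10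
        · rw [min_eq_left h01] at h; exact hA h
        · rw [min_eq_right h10] at h; exact hB h
      rw [if_neg hL, if_neg hA, if_neg hB, add_zero]


/-- **The one-sided middle sum of a Bateman–Horn pair of degree ≤ 1 is `o(x)`** (condition on `d 0`):
from `tripleSum_isLittleO` through the reparametrisation `oneSided_eq_tripleSum`. -/
theorem oneSided_isLittleO : ∀ (f : Fin 2 → ℤ[X]), IsBatemanHornSystem f → (∀ i, (f i).natDegree ≤ 1) →
    ∀ σ₁ σ₂ : ℝ, 0 < σ₁ → σ₁ < σ₂ → σ₂ < 1 / 2 →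
    ∃ c : ℝ, 0 < c ∧ ∀ θ η : ℝ, 0 < θ → θ ≤ c → 0 < η → η ≤ c →
      (fun x : ℕ => ∑ n ∈ Finset.Icc 1 x,
        ∑ d ∈ Fintype.piFinset (fun i => (((f i).eval (n : ℤ)).toNat).divisors),
          if (x : ℝ) ^ (1 - η) < ∏ i, (d i : ℝ) ∧ ∏ i, (d i : ℝ) ≤ (x : ℝ) ^ (1 + θ) ∧
              ((x : ℝ) ^ σ₁ < (d 0 : ℝ) ∧ (d 0 : ℝ) ≤ (x : ℝ) ^ σ₂) then
            (∏ i, ((ArithmeticFunction.moebius (d i) : ℝ) * Real.log (d i))) else 0)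
        =o[atTop] fun x : ℕ => (x : ℝ) := by
  intro f hf hlin σ₁ σ₂ h1 h12 h2
  have hdeg : ∀ i, (f i).natDegree = 1 := PairLinear.natDegree_eq_one hf hlin
  set q₀ : ℤ := (f 0).leadingCoeff with hq₀
  set q₁ : ℤ := (f 1).leadingCoeff with hq₁
  set a₀ : ℤ := (f 0).coeff 0 with ha₀
  set a₁ : ℤ := (f 1).coeff 0 with ha₁
  have hq₀p : 0 < q₀ := hf.leadingCoeff_pos 0
  have hq₁p : 0 < q₁ := hf.leadingCoeff_pos 1
  have hc₀ : IsCoprime q₀ a₀ := PairLinear.isCoprime_leadingCoeff_coeff_zero hf (hdeg 0)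
  have hc₁ : IsCoprime q₁ a₁ := PairLinear.isCoprime_leadingCoeff_coeff_zero hf (hdeg 1)
  have hΔ : q₁ * a₀ - q₀ * a₁ ≠ 0 := PairLinear.resultant_ne_zero hf hdeg
  refine ⟨min (σ₁ / 4) (min ((1 / 2 - σ₂) / 4) (1 / 16)), lt_min (by linarith) (lt_min (by linarith) (by norm_num)), ?_⟩
  intro θ η hθ0 hθ hη0 hη
  have hT := MiddleAssembly.tripleSum_isLittleO hq₀p hq₁p hc₀ hc₁ hΔ h1 h12 h2 θ η hθ0 hθ hη0 hη
  refine hT.congr_left fun x => ?_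
  exact (MiddleAssembly.oneSided_eq_tripleSum f hdeg (fun i => hf.leadingCoeff_pos i) σ₁ σ₂ θ η x
    ((q₀.toNat + q₁.toNat) * x + a₀.natAbs + a₁.natAbs) le_rfl).symm

/-- **S1b-P2 · the MIDDLE range of the linear pair window (registered stub `stub_pair_middle`)**, assembled from the one-sided dispersion bound (`oneSided_isLittleO`) for `f` and for `f ∘ swap`, and the pointwise min-split. -/
theorem stub_pair_middle : ∀ (f : Fin 2 → ℤ[X]), IsBatemanHornSystem f → (∀ i, (f i).natDegree ≤ 1) →
    ∀ σ₁ σ₂ : ℝ, 0 < σ₁ → σ₁ < σ₂ → σ₂ < 1 / 2 →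
    ∃ c : ℝ, 0 < c ∧ ∀ θ η : ℝ, 0 < θ → θ ≤ c → 0 < η → η ≤ c →
      (fun x : ℕ => ∑ n ∈ Finset.Icc 1 x,
        ∑ d ∈ Fintype.piFinset (fun i => (((f i).eval (n : ℤ)).toNat).divisors),
          if (x : ℝ) ^ (1 - η) < ∏ i, (d i : ℝ) ∧ ∏ i, (d i : ℝ) ≤ (x : ℝ) ^ (1 + θ) ∧
              ((x : ℝ) ^ σ₁ < ((min (d 0) (d 1) : ℕ) : ℝ) ∧ ((min (d 0) (d 1) : ℕ) : ℝ) ≤ (x : ℝ) ^ σ₂) then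
            ∏ i, ((ArithmeticFunction.moebius (d i) : ℝ) * Real.log (d i)) else 0)
        =o[atTop] fun x : ℕ => (x : ℝ) := by
  intro f hf hlin σ₁ σ₂ h1 h12 h2
  obtain ⟨c₁, hc₁, hA⟩ := oneSided_isLittleO f hf hlin σ₁ σ₂ h1 h12 h2
  have hf' : IsBatemanHornSystem (f ∘ Equiv.swap (0 : Fin 2) 1) := isBatemanHornSystem_swap hf
  have hlin' : ∀ i, ((f ∘ Equiv.swap (0 : Fin 2) 1) i).natDegree ≤ 1 := fun i => hlin _
  obtain ⟨c₂, hc₂, hB⟩ := oneSided_isLittleO _ hf' hlin' σ₁ σ₂ h1 h12 h2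
  set c : ℝ := min (min c₁ c₂) ((1 - 2 * σ₂) / 2) with hc_def
  have hσpos : 0 < (1 - 2 * σ₂) / 2 := by linarith
  have hc0 : 0 < c := lt_min (lt_min hc₁ hc₂) hσpos
  have hcc₁ : c ≤ c₁ := (min_le_left _ _).trans (min_le_left _ _)
  have hcc₂ : c ≤ c₂ := (min_le_left _ _).trans (min_le_right _ _)
  have hcσ : c ≤ (1 - 2 * σ₂) / 2 := min_le_right _ _
  refine ⟨c, hc0, fun θ η hθ hθc hη hηc => ?_⟩
  have H := (hA θ η hθ (hθc.trans hcc₁) hη (hηc.trans hcc₁)).add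
    (hB θ η hθ (hθc.trans hcc₂) hη (hηc.trans hcc₂))
  refine H.congr_left fun x => ?_
  have hη' : η ≤ 1 - 2 * σ₂ := by linarith
  rw [← piece_swap f σ₁ σ₂ θ η x]
  rw [← Finset.sum_add_distrib]
  refine Finset.sum_congr rfl fun n hn => ?_
  rw [← Finset.sum_add_distrib]
  refine Finset.sum_congr rfl fun d _ => ?_
  have hx1 : (1 : ℝ) ≤ (x : ℝ) := by
    have h := Finset.mem_Icc.mp hn
    exact_mod_cast h.1.trans h.2
  symm
  by_cases hW : (x : ℝ) ^ (1 - η) < ∏ i, (d i : ℝ) ∧ ∏ i, (d i : ℝ) ≤ (x : ℝ) ^ (1 + θ)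
  · have key := piece_min_split (σ₁ := σ₁) hx1 hη' d hW.1
      (∏ i, ((ArithmeticFunction.moebius (d i) : ℝ) * Real.log (d i)))
    by_cases hL : (x : ℝ) ^ σ₁ < ((min (d 0) (d 1) : ℕ) : ℝ) ∧ ((min (d 0) (d 1) : ℕ) : ℝ) ≤ (x : ℝ) ^ σ₂
    · by_cases hA' : (x : ℝ) ^ σ₁ < (d 0 : ℝ) ∧ (d 0 : ℝ) ≤ (x : ℝ) ^ σ₂
      · by_cases hB' : (x : ℝ) ^ σ₁ < (d 1 : ℝ) ∧ (d 1 : ℝ) ≤ (x : ℝ) ^ σ₂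
        · rw [if_pos hL, if_pos hA', if_pos hB'] at key
          rw [if_pos ⟨hW.1, hW.2, hL⟩, if_pos ⟨hW.1, hW.2, hA'⟩, if_pos ⟨hW.1, hW.2, hB'⟩]
          exact key
        · rw [if_pos hL, if_pos hA', if_neg hB'] at key
          rw [if_pos ⟨hW.1, hW.2, hL⟩, if_pos ⟨hW.1, hW.2, hA'⟩, if_neg (fun h => hB' h.2.2)]
          exact key
      · by_cases hB' : (x : ℝ) ^ σ₁ < (d 1 : ℝ) ∧ (d 1 : ℝ) ≤ (x : ℝ) ^ σ₂
        · rw [if_pos hL, if_neg hA', if_pos hB'] at key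
          rw [if_pos ⟨hW.1, hW.2, hL⟩, if_neg (fun h => hA' h.2.2), if_pos ⟨hW.1, hW.2, hB'⟩]
          exact key
        · rw [if_pos hL, if_neg hA', if_neg hB'] at key
          rw [if_pos ⟨hW.1, hW.2, hL⟩, if_neg (fun h => hA' h.2.2), if_neg (fun h => hB' h.2.2)]
          exact key
    · by_cases hA' : (x : ℝ) ^ σ₁ < (d 0 : ℝ) ∧ (d 0 : ℝ) ≤ (x : ℝ) ^ σ₂
      · by_cases hB' : (x : ℝ) ^ σ₁ < (d 1 : ℝ) ∧ (d 1 : ℝ) ≤ (x : ℝ) ^ σ₂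
        · rw [if_neg hL, if_pos hA', if_pos hB'] at key
          rw [if_neg (fun h => hL h.2.2), if_pos ⟨hW.1, hW.2, hA'⟩, if_pos ⟨hW.1, hW.2, hB'⟩]
          exact key
        · rw [if_neg hL, if_pos hA', if_neg hB'] at key
          rw [if_neg (fun h => hL h.2.2), if_pos ⟨hW.1, hW.2, hA'⟩, if_neg (fun h => hB' h.2.2)]
          exact key
      · by_cases hB' : (x : ℝ) ^ σ₁ < (d 1 : ℝ) ∧ (d 1 : ℝ) ≤ (x : ℝ) ^ σ₂
        · rw [if_neg hL, if_neg hA', if_pos hB'] at key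
          rw [if_neg (fun h => hL h.2.2), if_neg (fun h => hA' h.2.2), if_pos ⟨hW.1, hW.2, hB'⟩]
          exact key
        · rw [if_neg (fun h => hL h.2.2), if_neg (fun h => hA' h.2.2), if_neg (fun h => hB' h.2.2)]
          ring
  · rw [if_neg (fun h => hW ⟨h.1, h.2.1⟩), if_neg (fun h => hW ⟨h.1, h.2.1⟩),
      if_neg (fun h => hW ⟨h.1, h.2.1⟩)]
    ring


end Summit.Parity.BatemanHorn.Theorems.PolyMobiusTail.EtaFreeWindow
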